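import Mathlib
import Literature.MathematicalPhysics.QuantumFieldTheory.Balaban1983to89.DagBinding
import Literature.MathematicalPhysics.QuantumFieldTheory.Balaban1983to89.B4Sect5Proof
import Literature.MathematicalPhysics.QuantumFieldTheory.Balaban1983to89.B6Lemma21Bridge
import Literature.MathematicalPhysics.QuantumFieldTheory.Balaban1983to89.B5Prop11Lattice
import Literature.MathematicalPhysics.QuantumFieldTheory.Balaban1983to89.B5RealFields
import Literature.MathematicalPhysics.QuantumFieldTheory.Balaban1983to89.B6Lemma24Assembly
import Literature.MathematicalPhysics.QuantumFieldTheory.Balaban1983to89.B6Lemma24Kappa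
import Literature.MathematicalPhysics.QuantumFieldTheory.Balaban1983to89.B6LayerTensor
import Literature.MathematicalPhysics.QuantumFieldTheory.Balaban1983to89.B5Bounds167Lattice
import Literature.MathematicalPhysics.QuantumFieldTheory.Balaban1983to89.B10DagLeaf
import Literature.MathematicalPhysics.QuantumFieldTheory.Balaban1983to89.B6Lemma24Printed
import Literature.MathematicalPhysics.QuantumFieldTheory.Balaban1983to89.B8Lemma1Lattice
import Literature.MathematicalPhysics.QuantumFieldTheory.Balaban1983to89.B4Prop31Zero
import Literature.MathematicalPhysics.QuantumFieldTheory.Balaban1983to89.B4Prop23ZeroBox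
import Literature.MathematicalPhysics.QuantumFieldTheory.Balaban1983to89.B4Ineq118Torus
import Literature.MathematicalPhysics.QuantumFieldTheory.Balaban1983to89.B6LowerBound2153Torus

/-!
# `Balaban1983to89.DagDischarged` — kernel discharges of DAG-leaf conjuncts, recorded against the typed binding, v12

CITATION HEADER (lean-in-tree rule 2026-08-18; audit cell `pub-balaban`, CARVER seat).  `…Balaban1983to89.Dag` (v4.2)
states the citation DAG of T. Bałaban's lattice Yang–Mills ultraviolet-stability series [Balaban1983RegularityDecay]–
[Balaban1989LargeFieldII] over ABSTRACT leaves; `…Balaban1983to89.DagBinding` (v10.2) binds those leaves to the typed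
statements of the per-paper modules (`Upstream.ofPrinted`, …, `Upstream.ofPrintedAllXP`).  Both files are ADDITIVE and
READING-NEUTRAL: a leaf keeps its TYPE (a conjunction of verbatim printed statements used as hypotheses) whatever is
later proved about it.  THIS module is the ledger of what the kernel has DISCHARGED inside those leaf types.  It is
deliberately a STANDALONE LEAF of the import graph — imported by no module other than a package index — so that
the linear-algebra closure of `…B4Sect5Proof` (`QGQInverse`, `SchurTest`, `B6GOmega`, `B6FromB4`, …) and the
combinatorics of `…B6Lemma21Bridge` stay out of the import cones of the `Beta/…`, `T4…` and `FlowStepRuns` modules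
that import `DagBinding`.  (v1.1: docstring-only precision edits after the cross-read C-pv06-13 ∕ G-pv06-10; every
declaration byte-identical to v1.  v2: ADDITIVE — one new import (`…B5Prop11Lattice`, itself a standalone chain of the
pv15 lineage) and the new section «Leaf `b5`» below; every v1.1 declaration byte-identical.  v2.1: ADDITIVE — one
new import (`…B5RealFields`, the same lineage's real-field form of the same package) and the new section «Leaf `b5`,
real fields» below; every v2 declaration byte-identical.  v3: ADDITIVE — two new imports (`…B6Lemma24Assembly`,
`…B6Lemma24Kappa`: the pv09 lineage's standalone Lemma-2.4 chain over the concrete carriers of `…B6Lemma24Carrier`)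
and the new section «Leaf `b6`, Lemma 2.4 in κ-form» below, written on the explicit request of that lineage (cell
journal «KAPPA-BINDING: yes», 2026-08-19T00:07:21Z); every v2.1 declaration byte-identical; no change to `…DagBinding`.  v4: ADDITIVE — one new
import (`…B5Bounds167Lattice`, the pv15 lineage's standalone (1.61)–(1.67) module over `…B5` ∕ `…B5Prop11Plancherel`)
and the new section «Leaf `b5`, the bounds (1.67)» below, plus the docstring-only precision edits of the cross-read C-pv15g4-2 ∕
G-pv15g4-1 (three loci + remarks R1, R2); statement and proof of every v3 declaration byte-identical; no change to `…DagBinding`.  v4.1: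
docstring-only — the fifth bullet's guillemeted quotation of (1.67) now reproduces the printed sentence verbatim (advisory A1
of the cross-read C-B5-35); every declaration byte-identical to v4.  v5: ADDITIVE — one new import (`…B6LayerTensor`, the head of the pv09
lineage's standalone layer-inequality chain `…B6LayerUpperBound` → `…B6LayerRayleigh` → `…B6LayerDimTwo` →
`…B6LayerTensor` over `…B6Lemma24Kappa`) and the new section «Leaf `b6`, the printed Lemma 2.4 for blocks of side
L ≤ 9» below, plus the two docstring precisions it entails (fourth bullet; `lemma24K_latticeTrees_K`); statement and
proof of every v4.1 declaration byte-identical; no change to `…DagBinding`.  v6: ADDITIVE — one new import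
(`…B10DagLeaf`, the b10 lineage's standalone module over `…B10Assembly` ∕ `…B16B10Shape`, which imports no `Dag…`
file) and the new section «Leaf `b10`, first conjunct, literal typing — a NEGATIVE record» below, plus one
docstring-only precision in the fifth bullet (the status of (1.65) = (1.66) in the package: `…B5Action165Lagrange`);
statement and proof of every v5 declaration byte-identical; no change to `…DagBinding`.  v7: ADDITIVE — one new import
(`…B6Lemma24Printed`, the b06 lineage's standalone module over `…B6LayerTensor`, already in the import cone since v5)
and the new section «Leaf `b6`, the PRINTED Lemma 2.4 for the concrete lattice trees, every block size L» below, plus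
the dated docstring precisions it entails (fourth and sixth bullets, whose block-size clauses «L ≥ 10 unproved
(G-B6-09R)» are superseded by the eighth bullet: cell GAPS G-B6-10U; `lemma24Printed_latticeTrees_of_le_nine`);
statement and proof of every v6 declaration byte-identical; no change to `…DagBinding`.  v8: ADDITIVE — one new import
(`…B8Lemma1Lattice`, the b08 lineage's standalone module over `…B8` ∕ `…B8Lemma1Abelian`, neither of which imports a
`Dag…` file) and the new section «Leaf `b8`, conjunct `l1` — Lemma 1 (1.25) p. 79 for the concrete block-pair carriers
of the abelian model» below; statement and proof of every v7 declaration byte-identical; no change to `…DagBinding`.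
v9: ADDITIVE — one new import (`…B4Prop31Zero`, the b04 lineage's standalone module over `…B4Lower18` ∕ `…B4`, neither of
which imports a `Dag…` file) and the new section «Leaf `b4`, conjunct 3 — «Proposition 3.1′ of [2]» (1.22) for the
zero-field form carriers, `A = 0`» below; statement and proof of every v8 declaration byte-identical; no change to
`…DagBinding`.  v10: ADDITIVE — one new import (`…B4Prop23ZeroBox`, the pv17 lineage's standalone module over
`…B4TwoBox120` ∕ `…B4`, neither of which imports a `Dag…` file) and the new section «Leaf `b4`, conjunct 2 —
«Proposition 2.3 of [1]» (1.15)–(1.20) for the zero-field nested-box carriers, `A = 0`» below; statement and proof of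
every v9 declaration byte-identical; no change to `…DagBinding`.  v11: ADDITIVE — one new import (`…B4Ineq118Torus`,
the pv07 lineage's standalone module over `…B4Ineq116Torus`, which imports no `Dag…` file) and the new section
«Leaf `b4`, conjunct 2 — «Proposition 2.3 of [1]» (1.15)–(1.20) for the zero-field torus family, `Ω = Ω₀ = T^{(j)}`,
`A = 0`» below; statement and proof of every v10 declaration byte-identical; no change to `…DagBinding`.  v12:
ADDITIVE — one new import (`…B6LowerBound2153Torus`, the pv09 lineage's standalone module over `…B6Lemma24Torus` ∕
`…B5Bounds167Lattice`, which imports no `Dag…` file) and the new section «Leaf `b6`, the PRINTED Lemma 2.4 on the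
PERIODIC carriers — the series' ambient torus `T`» below; statement and proof of every v11 declaration byte-identical;
no change to `…DagBinding`.)

WHAT IS RECORDED (v1, cell mirror pass 24, journal to 2026-08-18T20:49:31Z; v2 adds the third bullet, cell mirror pass 29,
journal to 2026-08-18T23:27:50Z; v2.1 adds its real-field twin after the cross-reads C-pv24g3-9 ∕ C-pv24g3-10; v3 adds the
fourth bullet, cell mirror pass 31, 2026-08-19; v4 adds the fifth bullet, same pass; v4.1 requotes it; v5 adds the sixth bullet, cell mirror pass 32; v6 adds the seventh — a NEGATIVE record —
cell mirror pass 33; v7 adds the eighth, cell mirror pass 34; v8 adds the ninth, cell mirror pass 35; v9 adds the tenth,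
cell mirror pass 36; v10 adds the eleventh; v11 adds the twelfth, cell
mirror pass 37; v12 adds the thirteenth, cell mirror pass 39):

* Leaf `b4` ([Balaban1983RegularityDecay]: Theorem p. 573, Prop. 2.3 and Prop. 3.1′ p. 574, Sect. 5 Theorem p. 594;
  bound as `B4.LeafB4 X.famE X.famU X.famF X.d4 X.N4`).  Its FOURTH conjunct, the Sect. 5 Theorem on unit-lattice
  operators in the uniform reading `B4.Sect5ThmUniform d N`, is a THEOREM of the package:
  `B4Sect5Proof.sect5ThmUniform_holds : ∀ d N, B4.Sect5ThmUniform d N` (cell surge node T01.4; a finite-dimensional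
  statement — a random-walk ∕ Neumann-series inverse for operators with a gap — proved outright).  Hence the bound `b4`
  field of every binding is EQUIVALENT to the conjunction of the three remaining QUOTED statements
  (`ofPrinted_b4_iff`, `ofPrintedAllXP_b4_iff`).  Nothing is claimed about those three analytic statements.
* Leaf `b6` ([Balaban1984PropagatorsII] Lemma 2.1 p. 234 with Props. 2.2–2.7), PARAMETER form (`DagBinding` §(v8b),
  `B6BlockParam X.D6 = B6Lemma21Param ∧ B6BlockRest`).  `B6Lemma21Bridge.lemma21TwoScale_of_decomp` reduces the
  two-scale form of Lemma 2.1 (`B6Lemma21TwoScale.Lemma21TwoScale`, constant `c1TwoScale d δ₀ α`) to typed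
  contour-system data plus the EXISTENCE of the printed decomposition of a minimising contour (`Decomp247`, the
  sentences of pp. 231–233); composed with `DagBinding.ofPrintedAllXP_b6_of_twoScale` this gives the `b6` field of the
  P-binding from that data and the rest of the block (`ofPrintedAllXP_b6_of_decomp`).  READING NOTE (cell REFEREE R44):
  the cell records located findings on the printed inequality (2.58) — G-A11-1 (the printed constant `12·c₀(½α)^d` is
  exceeded: in d = 4 by the kernel witness `B6Lemma21Counterexample.printed_c1_exceeded` MODULO that module's stated
  geometric path-bound hypotheses, and in d = 3 by the cell's search engines; standing), G-A13-1 (a two-scale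
  reading of the surface legs; the
  finding of one reader lineage, CONTESTED by the boundary referee, G-ref1-18: under the print's `Σ_j = Λ_j ∩ Σ_j` the
  printed per-point factor stands) and G-A16-1 (surface-index branching, the finding of the `B6Lemma21Bridge` author,
  repaired inside the same (2.59) with `c1TwoScale` unchanged).  This module takes NO side: the parameter-form leaf
  `∃ c₁(α)` absorbs either reading, and the theorem below only composes landed implications.
* Leaf `b5` ([Balaban1984PropagatorsI]: Prop. 1.1 (1.89)–(1.90) p. 33, Prop. 1.2 (1.110)–(1.114) pp. 35–36 and the
  form bounds (1.67) p. 29; bound as `B5.MainBlock X.fam5 X.forms5 = Prop11Printed ∧ Prop12Printed ∧ Bounds167`), v2.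
  Its FIRST conjunct, Proposition 1.1, is a THEOREM of the package FOR THE LATTICE CARRIERS `famOfLattice a rest`
  (index `LatIdx d`: `n = L^k ≥ 1` fine points per unit length and the torus periods `M` of (1.29); local fields =
  vector ∕ tensor ∕ 2-tensor fields on `Tor (fine n M) × Fin d`; the six quantities of (1.89) read for `G = Δ_a⁻¹`
  with `Δ_a` the typed site-space operator `B5DeltaA169.DeltaA n M a` of (1.69), each on the kind of field it is
  printed for; the two forms of (1.90) = the real parts of `⟨A, Δ_a A⟩`, `⟨A, (Δ + 1) A⟩`; the Prop.-1.2 ∕ (1.67)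
  fields of `B5.Setting` supplied by the caller, `Rest`, so nothing is junk-valued): `prop11Printed_famOfLattice`,
  assembled from `B5Prop11Lattice.ineq189_G … ineq189_GdivT2` and `ineq190_form` (cell surge node T02.1, pv15 lineage;
  `γ₀ = gammaZero d a = 1 ∕ ((d+1)² · C⋆(d,a))`, constant and proof the package's — the printed «constant γ₀ independent
  of k, T_η» is the uniformity in `LatIdx d`).  Hence for binding carriers whose B5 data ARE the lattice carriers
  (`PrintedCarriersR.withLatticeB5`) the `b5` field is EQUIVALENT to the two remaining QUOTED statements
  `B5.Prop12Printed (famOfLattice a rest) ∧ B5.Bounds167 forms` (`mainBlock_lattice_iff`,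
  `ofPrintedAllXP_withLatticeB5_b5_iff`).  READING NOTE: this discharge is RELATIVE TO THE TYPED LATTICE READING of
  (1.69) — the dictionary «L²-sections on T_η ↔ `Tor (fine n M) × Fin d → ℂ`, (1.69) ↔ `DeltaA`» and its recorded
  divergences from the print (complex-valued fields, the block-averaging conventions) are stated in the module
  docstrings of `…B5DeltaA169` ∕ `…B5Prop11Lattice` and are under the cell's cross-read; it certifies Prop. 1.1 for
  these typed operators and says NOTHING about Prop. 1.2 or (1.67), which stay quoted hypotheses, nor about carriers
  typed otherwise.  (v2.1) The same holds for the REAL lattice carriers `famOfLatticeR a rest` — real fields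
  `Tor (fine n M) × Fin d → ℝ` as printed p. 18 «A : {b ⊂ T_ε} → ℝ», the six quantities of (1.89) read for the real
  matrix `GR n M a = reM Δ_a⁻¹` and the forms of (1.90) for `DeltaAR = reM Δ_a`, `LapR` (the pv15 lineage's
  `…B5RealFields`, same γ₀): `prop11Printed_famOfLatticeR` (from `ineq189R_G … ineq189R_GdivT2`, `ineq190R_form`),
  `mainBlock_latticeR_iff`, `PrintedCarriersR.withLatticeB5R`, `ofPrintedAllXP_withLatticeB5R_b5_iff`.  This removes
  the «complex-valued fields» divergence from the discharge; the block-averaging conventions of the typed (1.69) stay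
  as recorded in those module docstrings, and Prop. 1.2 ∕ (1.67) stay quoted hypotheses for both carrier families.)

* Leaf `b6`, Lemma 2.4 ([Balaban1984PropagatorsII] Lemma 2.4 (2.128) p. 245: the conjunct `B6.Lemma24Printed D.d D.L D.tree`
  of `B6BlockRest`), v3.  The PRINTED conjunct — factor 1∕(12d²), i.e. κ = 1 in `B6.Lemma24K` — is NOT discharged: it
  stays a quoted hypothesis, numerically supported (cell census N-B6-1∕2) and unproved (G-B6-09R) — for blocks of
  side L ≥ 10; for L ≤ 9 it is a THEOREM for the concrete lattice trees, sixth bullet (v5); and from v7 on it is a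
  THEOREM for the concrete lattice trees at EVERY block size L ≥ 1, eighth bullet (the b06 lineage's
  `…B6Lemma24Printed`; G-B6-10U supersedes the «unproved for L ≥ 10» clause for these carriers), so that it stays
  quoted only for carriers typed otherwise —, while its printed
  DERIVATION is kernel-refuted from L = 10 on: the layer sentence of p. 245 and the displayed (2.127) fail at L = 10
  (`B6.claim_p245_fails_L10`, `B6.ineq2127_fails_L10`, G-B6-09), and no constant obtainable from the layer inequality
  reaches 1 once L ≥ 12 (`B6LayerUpperBound.not_layerIneq_one`; every admissible layer constant is ≤ 12∕(L+1) for
  L ≥ 2, `B6LayerUpperBound.layerIneq_le`; exact threshold since: the printed factor 1 is admissible iff L ≤ 9,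
  `B6LayerTensor.layerIneq_one_iff` — both in the import cone from v5 on).  What IS
  recorded is the κ-PARAMETER form, side by side with the printed leaf: `B6BlockRestK D κ` ∕ `B6BlockParamK D κ`
  (Lemma 2.4 as `B6.Lemma24K D.d D.L κ D.tree`, the parameter shape the cell already uses for Lemma 2.1; κ = 1 IS the
  P-binding's `B6BlockRest` ∕ `B6BlockParam`, `Iff.rfl`; the P-leaf implies the K-leaf for every κ ≤ 1,
  `B6.lemma24K_mono`; the six other statements isolated as `B6RestQuoted`), the K-binding
  `Upstream.ofPrintedAllXPK X Y Z V W κ := (ofPrintedAllXP …).withB6 (B6BlockParamK X.D6 κ)` (the existing one-leaf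
  re-binder; `…DagBinding` untouched), and the DISCHARGE of the Lemma-2.4_κ conjunct for block data whose tree-gauge
  carriers are the CONCRETE LATTICE TREES `B6Lemma24Carrier.carrier L Λ′ (q1Of L Λ′)` (blocks of side L ≥ 1 in Z^d,
  d ≥ 2, regions Λ = B(Λ′ j) for finite Λ′ j ⊂ LZ^d; `latticeTrees`, `PrintedCarriersR.withLatticeTrees`): with
  κ = κ₁(d, L) = 2∕(2 + (d−1)(L−1)) by `B6Lemma24Kappa.lemma24K_kappa1` (pv09 lineage, cell surge node T03.4 ∕ kernel
  nodes 13b–14: the constant the printed METHOD yields once its layer step is done at the sharp order 1∕L; the instance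
  named in the request), with κ = κ₀(d, L) by `B6Lemma24Assembly.lemma24K` (the first landed instance, κ₀ ≤ κ₁), and
  for every κ ∈ [0, 1] satisfying the layer inequality `B6Lemma24Kappa.LayerIneq d L κ` by `lemma24K_K`
  (`lemma24K_latticeTrees_kappa1 ∕ _kappa0 ∕ _K`).  Hence for these carriers the κ₁-form rest block is EQUIVALENT to
  Props. 2.2, 2.3, 2.5, 2.6, 2.7 ∧ Cor. 2.8 alone (`b6BlockRestK_latticeTrees_iff`), the κ₁-form leaf — at block level
  and as the `b6` field of the K-binding — to `B6Lemma21Param ∧` those six (`b6BlockParamK_latticeTrees_iff`,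
  `ofPrintedAllXPK_withLatticeTrees_b6_iff`); downstream, `B6.lowerBound2153K_of_lemma24K` consumes `Lemma24K` at any
  κ, so the κ-form leaf feeds (2.153)_κ unchanged (noted, not used here).  READING NOTE: this discharge is RELATIVE TO
  THE TYPED CARRIERS of the pv09 lineage — the ambient lattice Z^d with `Λ′ j ⊂ LZ^d` finite, as Lemma 2.4 itself prints
  («Let a set Λ ⊂ Z^d be a sum of blocks … We put B = 0 outside Λ», p. 245; the series' ambient `T` of (2.118)–(2.122) ∕
  (2.153) is a large torus, `…B6Lemma24PrintedShape` HONEST SCOPE (ii)), the tree gauge (2.121), ‖B‖², Σ_p |∂₁B|²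
  and the block averages Q₁ of (2.125) as typed in `…B6Lemma24Carrier` ∕ `…B6Lemma24PrintedShape` (their docstrings
  record the dictionary and its divergences from the print, under the cell's cross-reads of surge node T03.4); it
  certifies Lemma 2.4 with the constant κ₁∕(12d²) — order 1∕L; the exact layer constant κ_L ~ π²∕L (`B6.kappaL`) is
  not reached — for these carriers, and says NOTHING about the printed L-independent constant (v3–v6; reached from v7
  on, eighth bullet), about carriers typed
  otherwise, or about the other six statements of the block and Lemma 2.1, which stay quoted hypotheses.

* Leaf `b5`, the bounds (1.67) ([Balaban1984PropagatorsI] (1.67) p. 29 «The function under the integral is bounded from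
  below and above by positive constants γ₀, γ₁ dependent on d only, so we have γ₀⟨∂₁B, ∂₁B⟩ ≤ ⟨B, Δ_kB⟩ ≤ γ₁⟨∂₁B, ∂₁B⟩.»
  — the integral being (1.66): the conjunct `B5.Bounds167 X.forms5` of `B5.MainBlock`), v4.  It is a THEOREM of the package FOR
  THE UNIT-TORUS FORM CARRIERS `formsOfLattice` (at index `(n, M) : LatIdx d`: complex vector fields
  `B : Tor M × Fin d → ℂ` on the unit torus `T₁ = Π_μ ℤ/M_μ` at step `k`, `n = L^k`; `d1Sq = ⟨∂₁B, ∂₁B⟩`; `formΔk` = the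
  THIRD EXPRESSION of (1.66)) and for their real twin `formsOfLatticeR` (`B : Tor M × Fin d → ℝ`):
  `bounds167_formsOfLattice(R)` = the pv15 lineage's `B5Bounds167Lattice.bounds167_formOfLattice(R)` BY NAME at the
  index type `LatIdx d` (cell surge node T02.1, SHARPEN pass 29; constants `γ₀ = (4/π²)^(d+2)`, `γ₁ = (π²/4)^(2d+4)`, the
  package's — the print attributes no values).  Hence, with the v2 ∕ v2.1 reductions, for binding carriers whose B5 data
  are the lattice carriers AND the unit-torus forms (`PrintedCarriersR.withLatticeB5Forms` ∕ `withLatticeB5RForms`) the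
  `b5` field is EQUIVALENT to the single remaining QUOTED statement, Proposition 1.2: `mainBlock_latticeForms(R)_iff`,
  `ofPrintedAllXP_withLatticeB5(R)Forms_b5_iff` (and `ofPrintedAllXPK_withLatticeB5Forms_b5_iff` for the κ-form
  K-binding of v3, whose `b5` field is the same).  READING NOTE (honest scope): this discharge is RELATIVE TO THE TYPED
  FORM CARRIER — `formΔk` is DEFINED by the printed momentum representation (1.66) (torus sum with the unitary DFT in
  place of `(2π)^{−d}∫dp′`); the identity (1.65) = (1.66), i.e. that this quadratic form IS `⟨∂H_kB, ∂H_kB⟩` for the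
  minimiser `H_kB` of (1.59) ∕ (1.60), is NOT certified in the kernel FOR THESE CONCRETE OBJECTS (the `…B5Bounds167Lattice`
  header, «What is NOT claimed» (1); the cell holds (1.66) by hand, GAPS C-adv4-32, and numerically, C-B5-9).  PRECISION
  (status of that identity in the package, recorded not used): the pv15 lineage's `…B5Action165Lagrange` kernel-checks
  the «Lagrange route» AS LOGIC — over abstract real inner-product spaces, with the printed operator identities
  (1.69), (1.58), the adjoint of (1.55), the normal equation for `Λ` … as explicit hypotheses, `‖∂H_kB‖²` for `H_kB` of
  the shape (1.60) equals `⟨B′ − ∂₁Λ, φ⁻¹(B′ − ∂₁Λ)⟩` and is the minimum over `λ` (its §1) — and proves CONCRETELY,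
  fibre by fibre, that the third expression of (1.66) (`B5Bounds167Lattice.formDk`, the carrier used here) equals the
  first (its §2–§3); NOT certified there either: that Bałaban's concrete `T_η` operators satisfy those hypotheses, and
  the position ↔ momentum Plancherel step (its HONEST SCOPE (i)–(ii); GAPS G-pv15g4-2).  That module is deliberately
  NOT imported: nothing below uses it.  Further (scope of the v4 discharge, continued): the `p′ = 0` term carries
  `(∂₁B)~(0) = 0` and drops out; B5's sizes `n = L^k`, `M_μ = 2L′_μ` are instances of the arbitrary `n ≥ 1`, `M_μ ≥ 1`
  of `LatIdx d`.  It says NOTHING about Prop. 1.2, which stays a quoted hypothesis for every carrier family, nor about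
  form carriers typed otherwise.

* Leaf `b6`, the PRINTED Lemma 2.4 on small blocks ([Balaban1984PropagatorsII] Lemma 2.4 (2.128) p. 245 with its printed
  factor, constant 1∕(12d²): the conjunct `B6.Lemma24Printed D.d D.L D.tree` of `B6BlockRest`, AS TYPED), v5.  The pv09
  lineage has DECIDED the printed layer sentence of p. 245 in every dimension d ≥ 2: its factor 1 is admissible
  exactly for L ≤ 9 (`B6LayerTensor.layerIneq_one_iff : LayerIneq d L 1 ↔ L ≤ 9`, cell kernel nodes 16–17, with
  `…B6LayerDimTwo`; the failure from L = 10 on is `B6LayerRayleigh.not_layerIneq_one_of_ten_le` ∕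
  `B6.claim_p245_fails_L10`).  Feeding `B6LayerTensor.layerIneq_of_le_nine` into the v3 discharge at a general layer
  constant (`lemma24K_latticeTrees_K`, i.e. `B6Lemma24Kappa.lemma24K_K`, at κ = 1) makes the printed Lemma-2.4 conjunct
  ITSELF a theorem of the package for block data whose tree-gauge carriers are the concrete lattice trees with
  1 ≤ L ≤ 9 (d ≥ 2, Λ′ j ⊂ LZ^d finite): `lemma24K_latticeTrees_one_of_le_nine`, `lemma24Printed_latticeTrees_of_le_nine`
  (`B6.lemma24K_one_iff`: κ = 1 is literally the printed statement).  Hence for these carriers the P-binding's rest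
  block is EQUIVALENT to Props. 2.2, 2.3, 2.5, 2.6, 2.7 ∧ Cor. 2.8 alone (`b6BlockRest_latticeTrees_iff_of_le_nine`) and
  its `b6` leaf — at block level and as the `b6` field of `Upstream.ofPrintedAllXP` — to `B6Lemma21Param ∧` those six
  (`b6BlockParam_latticeTrees_iff_of_le_nine`, `ofPrintedAllXP_withLatticeTrees_b6_iff_of_le_nine`); no κ and no
  K-binding are needed in this regime.  READING NOTE (honest scope): (i) the typed-carrier proviso of the fourth bullet
  applies verbatim (ambient Z^d with Λ′ j ⊂ LZ^d, tree gauge (2.121), ‖B‖², Σ_p |∂₁B|², Q₁ of (2.125) as typed in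
  `…B6Lemma24Carrier`); (ii) the regime is L ≤ 9 ONLY — for L ≥ 10 the printed route fails and (2.128) with the
  printed constant stays a quoted hypothesis, numerically supported and unproved (G-B6-09R), as the fourth bullet says;
  (iii) the series itself fixes «L … an odd, positive integer > 11» ([Balaban1987RG] p. 251 (0.1); cell census
  S-B12.1), i.e. it runs ONLY at block sizes where (ii) applies: this record therefore discharges NOTHING the series
  uses — it locates the open estimate G-B6-09R exactly on the series' own regime L ≥ 13 (odd) and records that the
  printed statement, read on the printed carriers, is true below it.  Nothing is claimed about instantiating any other
  leaf at L ≤ 9.  (v7, dated precision: items (ii)–(iii) record the state at v5–v6.  The b06 lineage has since PROVED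
  (2.128) with the printed constant for these carriers at EVERY L ≥ 1, by a route that is not the printed one —
  eighth bullet; G-B6-10U — so the printed conjunct is no longer a quoted hypothesis for them at any block size, while
  the printed route stays refuted from L = 10 on; this bullet's theorems are the L ≤ 9 special cases and stay.)

* Leaf `b10`, FIRST CONJUNCT, literal typing ([Balaban1985UV3] Theorem 1 p. 257 with the bounds (5) p. 256 and p. 257
  l. 1 «and the constant O(1) is independent of ε, k, g_k in a bounded set»; bound as
  `B10.Thm1Printed X.runs10 ∧ B10.Thm2Printed X.runs10` in `Upstream.ofPrinted`, `B10.Thm1Printed` being unit r2's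
  typing — for every bounded coupling set (0, gmax] ONE constant serves all runs and all k — and
  `B10.Thm1PrintedCompact` (B10.lean; cell GAPS G-B10-01) the cell's audit reading, one constant per compact window
  [gmin, gmax] ⊂ (0, ∞), which is what [Balaban1987RG]–[Balaban1989LargeFieldII] consume), v6 — a NEGATIVE record, the
  first of this file.  The b10 lineage, owner of `…B10Assembly` (the cell's leaf-conditional derivation of the paper:
  every family of tower runs carrying `B10Assembly.LeafSystem`s with common constants satisfies
  `B10.Thm1PrintedCompact ∧ B10.Thm2Printed`, `B10Assembly.thm1Compact_and_thm2_of_leafSystem`), has made the cell's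
  standing print-level finding G-B10-01 kernel at the DAG boundary (`…B10DagLeaf`; cell journal G-B10-01-DAGLEAF,
  cross-read REFEREE6 E86): from the located leaves (62) p. 271, (64) p. 273, (1) p. 256 and three LABELLED READER'S
  ITEMS carried as hypotheses — (R1) the unit configuration at level 0, (R2) the whole-lattice LOWER count of starred
  bonds `s₀|T₁^{(k)}| ≤ |T₁^{(k)*}|` (the count of p. 260 gives s₀ = 2(1 − L⁻³)), (R3) d(𝔤) ≥ d₀ > 0 — every such family
  containing runs with arbitrarily small bare coupling g₀ = gε^{1/2} (arbitrarily fine lattices at fixed g: the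
  continuum limit the paper is about) violates `B10.Thm1Printed` ((62) carries `d(𝔤) log g_k|T₁^{(k)*}|`, so at the unit
  configuration ρ₀(1) = e^{−E} ≥ exp((d₀s₀ log g₀⁻¹ − a₁∕(1 − L⁻³))|T₁^{(0)}|), incompatible with ONE upper constant in
  (5) at k = 0 as g₀ → 0 — through `B16B10Shape.b10_O1_lower_of_bounds5At_zero` by name), and UNCONDITIONALLY so on
  its model family `B10DagLeaf.logRun` (d(𝔤) = 3, |T₁^{(k)*}| = (7∕4)|T₁^{(k)}|, E^{(k)} by (62), E_k by (64),
  ρ_k ≡ e^{−E_k}, ε = 2^{−K}; `B10DagLeaf.logRun_separation`).  Recorded here AGAINST THE BINDING, by name: for carriers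
  whose B10 runs are such tower runs (`PrintedCarriersR.withTowerRuns10`) leaf `b10` of `Upstream.ofPrintedAllXP`
  (equally of the κ-form K-binding of v3 and of `Upstream.ofPrinted`: the field is the same, `ofPrintedAllXP_b10_eq`,
  `ofPrinted_b10_eq`) is FALSE — `not_b10_withTowerRuns10_of_leafSystems`, `not_b10_withTowerRuns10_of_fineLattices` —
  and false on the model rebinding for EVERY choice of the other carriers (`not_b10_withTowerRuns10_logRun`), while
  the COMPACT node `b10Compact X := B10.Thm1PrintedCompact X.runs10 ∧ B10.Thm2Printed X.runs10` holds for the same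
  carriers from the leaf system ALONE (`b10Compact_withTowerRuns10_of_leafSystems`, `b10Compact_withTowerRuns10_logRun`,
  `b10Compact_and_not_b10_logRun`) and follows from the literal leaf for any family with couplings bounded above
  (`b10Compact_of_b10`, i.e. `B10.thm1Compact_of_thm1Printed`).  READING NOTE (cell REFEREE R44; honest scope): (i) this
  is a statement about the TYPING of node `b10` — which reading of Theorem 1 the paper's own bookkeeping can and cannot
  deliver — not about Bałaban's densities: whether the true ρ_k of (1)–(2) carry a `LeafSystem` (with the
  g-INDEPENDENT volume bounds of p. 273 «we get easily») is exactly the audit question of the series, and (R1)–(R3) are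
  elementary but HYPOTHESES of the cited theorems, never facts; (ii) the finding agrees with the paper's own caveats
  p. 256 «The constant O(1) goes to ∞ as g → 0» (said of (3)) and p. 257 «g_k in a bounded set» (REFEREE6 E86,
  advisory A1); the print-level objection G-B10-01 — with E defined by (62)–(64), at k = 0, g fixed, ε → 0 the O(1) of
  (5) cannot be independent of ε — stands as the cell recorded it (b10 gen 1) and is neither sharpened nor softened
  here; (iii) `…DagBinding` is NOT changed: node `b10` keeps the verbatim typing, now FLAGGED «stronger than the paper's
  leaf system delivers»; the b10 lineage's suggested rebinding `b10 := B10.Thm1PrintedCompact ∧ B10.Thm2Printed`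
  (cell journal 2026-08-19T01:09:18Z) would be an additive `…DagBinding` revision on request, and `b10Compact` is its
  exact text.

* Leaf `b6`, the PRINTED Lemma 2.4 at EVERY block size ([Balaban1984PropagatorsII] Lemma 2.4 (2.128) p. 245 with its
  printed constant 1∕(12d²): the conjunct `B6.Lemma24Printed D.d D.L D.tree` of `B6BlockRest`, AS TYPED), v7 — the
  first discharge of this file that reaches the series' own regime «L … an odd, positive integer > 11»
  ([Balaban1987RG] p. 251 (0.1); cell census S-B12.1).  The b06 lineage (`…B6Lemma24Printed`; cell GAPS C-b06g8-1,
  cross-read C-pv27-37, verdict update G-B6-10U) has PROVED (2.128) WITH ITS PRINTED CONSTANT for the concrete lattice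
  carriers of `…B6Lemma24Carrier` in every dimension d ≥ 2 and at every block size L ≥ 1 —
  `B6Lemma24Printed.lemma24Printed_carrier` — by a route that is NOT the printed one and does not use the refuted
  sentence before (2.127): a layer-RESTRICTED tree-gauge Poincaré inequality in the gauge (2.121)
  (`B6Lemma24Printed.layer_sq_le`: the printed comb telescoping of p. 244 with the plaquette multiplicity counted over
  the bonds of ONE hyperplane), the EXACT mean∕fluctuation split of the face sums of (2.124)
  (`B6Lemma24Printed.face_split`; the mean part is exactly the square that (2.125) bounds, so only the fluctuation
  pays a layer constant), and the scalar assembly at the layer constant κ₁(2, L) = 2∕(L+1), admissible in every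
  dimension (`B6Lemma24Printed.assembly_core_one`; `B6Lemma24Kappa.layerIneq_kappa1` transported by
  `B6LayerTensor.layerIneq_iff_two`).  Fed into the v3 reductions BY NAME, this makes the printed Lemma-2.4 conjunct
  ITSELF a theorem of the package for block data whose tree-gauge carriers are the concrete lattice trees
  (`latticeTrees`, `PrintedCarriersR.withLatticeTrees`) at every L ≥ 1: `lemma24Printed_latticeTrees`,
  `lemma24K_latticeTrees_one`; for every κ ≤ 1 with NO layer hypothesis `lemma24K_latticeTrees_of_le_one`; on the
  series' regime L > 11 `lemma24Printed_latticeTrees_of_eleven_lt`.  Hence for these carriers, at ANY block size, the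
  P-binding's rest block is EQUIVALENT to Props. 2.2, 2.3, 2.5, 2.6, 2.7 ∧ Cor. 2.8 alone
  (`b6BlockRest_latticeTrees_iff`) and its `b6` leaf — at block level, as the `b6` field of `Upstream.ofPrintedAllXP`,
  and as the `b6` field of the K-binding of v3 at every κ ≤ 1 — to `B6Lemma21Param ∧` those six
  (`b6BlockParam_latticeTrees_iff`, `ofPrintedAllXP_withLatticeTrees_b6_iff`, `b6BlockParamK_latticeTrees_iff_of_le_one`,
  `ofPrintedAllXPK_withLatticeTrees_b6_iff_of_le_one`).  This SUPERSEDES the block-size clauses of the fourth and sixth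
  bullets («unproved (G-B6-09R) — for blocks of side L ≥ 10»; sixth bullet, items (ii)–(iii)), which stay as the dated
  record of v3–v6; the v3 ∕ v5 instances (κ₁, κ₀, the `LayerIneq`-conditional one, L ≤ 9) become special cases and
  stay.  READING NOTE (cell REFEREE R44; honest scope): (i) the typed-carrier proviso of the fourth bullet applies
  verbatim — ambient Z^d with Λ′ j ⊂ LZ^d finite (not the series' torus `T` of (2.118)–(2.122) ∕ (2.153):
  `…B6Lemma24PrintedShape` HONEST SCOPE (ii)), the tree gauge (2.121), ‖B‖² over the bonds with an end-point in Λ,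
  Σ_p over the once-recorded plaquettes near Λ, Q₁ of (2.125) over the coarse bonds with at least one end-point in Λ′
  (the G-B6-09R reading), as typed in `…B6Lemma24Carrier` (dictionary and divergences D-b06.2 ∕ D-b06.3 ∕ D-b06.20 in
  those module docstrings and the cell's cross-reads of surge node T03.4); the abstract node `B6.Lemma24Printed d L fam`
  for ARBITRARY tree data is not claimed (it is a hypothesis shape), nor anything about carriers typed otherwise;
  (ii) the printed DERIVATION stays kernel-refuted from L = 10 on — the layer sentence of p. 245 and (2.127) fail at
  L = 10 (`B6.claim_p245_fails_L10`, `B6.ineq2127_fails_L10`; the printed factor 1 is admissible in the layer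
  inequality iff L ≤ 9, `B6LayerTensor.layerIneq_one_iff`): G-B6-09 and G-B6-09R's objection to the printed ROUTE stand
  verbatim (G-B6-10U); what is discharged is the printed STATEMENT on the typed carriers, by the package's own proof;
  (iii) Lemma 2.1 (parameter form `B6Lemma21Param`) and Props. 2.2, 2.3, 2.5, 2.6, 2.7, Cor. 2.8 stay QUOTED
  hypotheses; nothing is claimed about any other leaf, and `…DagBinding` is not changed (node `b6` keeps its type; the
  discharge is recorded against it, by name).

* Leaf `b8`, conjunct `l1` ([Balaban1985RegularSpaces] Lemma 1 (1.24)–(1.25) p. 79: the conjunct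
  `l1 : B8.Lemma1Printed d loc` of the faithful leaf `B8LeafR` — and of the r1 bundle `B8.Concl` —, AS TYPED), v8.
  The b08 lineage (`…B8Lemma1Lattice`; cell GAPS C-B8-33, DIVERGENCE D-b08-g12.1; cross-read ok pv11-g9 2026-08-19T02:08:50Z C-pv11g9-5 (objections none, no DOCFIX)) has PROVED
  `B8.Lemma1Printed d (blockPair d L)` for EVERY d and EVERY L, hypothesis-free —
  `B8Lemma1Lattice.lemma1Printed_blockPair` — for the CONCRETE BLOCK-PAIR CARRIERS of the cell's ABELIAN (additive)
  model: one `B8.LocalData` per coarse bond c = ⟨y, y + Le_μ⟩ of the corner lattice (index type `Site d × Fin d`, a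
  superset of the bonds of Ω₁^{(1)}), configurations ∕ perturbations = additive bond fields θ on ℤ^d, `small` = (1.7)
  for k = 1 on the plaquettes of B(c₋) ∪ B(c₊) for both θ₀ and θ₀ + θ′, `axialClose` = (1.24) (axial gauge on the
  staircase trees Γ_{y,x} of [Balaban1985Averaging] p. 24 and the block-mean condition), `pertDev` = the sup of |θ′_b|
  over the bonds with both ends in B(c₋) ∪ B(c₊); the proof is the printed count — discrete Stokes on the tree ladder
  («the same reasoning as in [3] (between (44) and (46))», p. 79), (1.26) from the two (1.7)-bounds, the crossing-bond
  chain of ≤ (d−1)(L−1) steps, the block mean (1.20) — run through the abelian averaging step of `…B8Lemma1Abelian`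
  (adv1 lineage), whose four geometric binders the module discharges.  Fed in BY NAME (`lemma1Printed_blockPair`),
  this makes the Lemma-1 conjunct a theorem of the package for binding carriers whose Lemma-1 data are that family
  (`PrintedCarriersR.withBlockPair X Lb`, every natural block size Lb): the `b8` field of `Upstream.ofPrintedAllXP` —
  which IS the faithful leaf `B8LeafR` over the carriers (`ofPrintedAllXP_b8_eq`, `rfl`) — is then EQUIVALENT to the
  faithful leaf WITHOUT `l1`, `B8LeafRest`: Thm 2 p. 83, Prop 3 p. 87, Thm 4 p. 88, Prop 5 p. 94 (both halves),
  Prop 6 p. 99, Prop 7 p. 100 (repaired reading `B8SectGH.Prop7PrintedR`), Thm 8 p. 101 (`B8SectGH.Thm8PrintedAt 1`)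
  (`b8LeafR_iff_l1_and_rest`, `b8LeafR_blockPair_iff`, `ofPrintedAllXP_withBlockPair_b8_iff` ∕ `_of_rest`; at the
  K-binding of v3, whose `b8` field is the P-binding's, `ofPrintedAllXPK_withBlockPair_b8_iff`); what B9 consumes from
  the leaf, Thm 8 at γ = 1 (`DagBinding.ofPrintedR_b8_thm8`), comes from the rest alone (`thm8_withBlockPair_of_rest`,
  bookkeeping).  READING NOTE (cell REFEREE R44; honest scope = `…B8Lemma1Lattice` HONEST SCOPE (i)–(v)): (i) ABELIAN
  MODEL ONLY — the non-abelian remainders of the printed G-valued statement (the R(·)-transports of (1.22) ∕ (1.26) and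
  of the crossing-bond chain, the BCH corrections behind the averages (15) = (42) of [Balaban1985Averaging], the
  difference between |V − 1| and |(1∕i) log V|) are NOT formalised; what is certified is that the printed COUNT yields
  the printed constant 4d²α₀ + α₁ once those remainders are ignored, with the MEAN-BASED reading of the last step
  (`B8Lemma1Abelian.coeff_lt_printed`; the chain completed literally at b₀ exceeds 4d² for d ≥ 2,
  `B8Lemma1Abelian.printedChain_gt` — cell census G-B8-10, not re-litigated here); Lemma 1 for GROUP-VALUED lattice
  configurations — the abstract node `B8.Lemma1Printed d loc` for ARBITRARY `loc` — is NOT claimed and stays a quoted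
  hypothesis for carriers typed otherwise; (ii) the plaquette hypotheses are asked only on B(c₋) ∪ B(c₊) and only the
  j = 1 clause of (1.7) is used (as in (1.26)), so the typed lemma is formally stronger there; corner-anchored blocks
  and d-first staircase trees are the [Balaban1985Averaging] p. 24 convention as read by the cell; (iii) the leaf's
  REAL block-size parameter `L8` (entering Prop 3 ∕ Prop 6) is not tied by the typing to the natural block size Lb of
  the `l1` carriers — immaterial for the discharge, which holds at every Lb, but recorded; (iv) Thm 2 – Thm 8 stay
  QUOTED hypotheses ((1.147) stays absent from the leaf, G-B8-09); nothing is claimed about any other leaf, and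
  `…DagBinding` is not changed (node `b8` keeps its type; the discharge is recorded against it, by name).

* Leaf `b4`, conjunct 3 ([Balaban1983RegularityDecay] «Proposition 3.1′ of [2]» (1.21)–(1.22) p. 574: the conjunct
  `B4.Prop31Printed famF` of `B4.LeafB4`, surge node T01.3, AS TYPED), v9.  The b04 lineage (`…B4Prop31Zero`; cell
  GAPS C-b04g10-1, DIVERGENCE D-b04g10-1; cross-read ok r1-g10 2026-08-19T02:40:20Z C-r1g10-5 (misquotations 0∕12, ABSOLUTE-RULE 0, objections 0, DOCFIX 0; advisories A-1 ∕ A-2 optional)) has PROVED `B4.Prop31Printed (zeroFieldForms d a₋ m²₊)`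
  for EVERY d and EVERY window `0 < a₋`, `0 ≤ m²₊`, hypothesis-free — `B4Prop31Zero.prop31Printed_zeroField` — for
  the CONCRETE ZERO-FIELD CARRIERS of `B4.FormSetting`: one instance per (mesh n ≥ 1, finite Ω^{(k)} ⊂ ℤ^{d+1},
  a_k ≥ a₋, 0 ≤ m² ≤ m²₊, charge e, number N of real field components) (index type `B4Prop31Zero.ZeroIdx d a₋ m²₊`),
  `Cfg = (Ω^{(k)} → ℝ^N)`, `form φ = Σ_c ⟨φ_c, Δ^{(k)}(Ω, 0)φ_c⟩` with the operator (1.14) at `A = 0` over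
  `B4Lower18.fineOpR`, `covDiffSq` the bond sum at `U ≡ 1`, `l2sq` the site sum, `unitBlocks := True`,
  `reg121 := True`; the witnesses are `γ₀ = min(a₋/(8(d+1) + 2m²₊), 1/8)`, threshold `e₁ = 1` and error constant
  `C(α) = 0` for every `α > 0` (`B4Prop31Zero.ineq122_A0`).  Fed in BY NAME (`prop31Printed_zeroFieldForms`), this
  makes conjunct 3 a theorem of the package for binding carriers whose B4 form family IS that family
  (`PrintedCarriersR.withZeroFieldForms X d a₋ m²₊`): the `b4` field of `Upstream.ofPrintedAllXP` — which IS
  `B4.LeafB4` over the carriers (`ofPrintedAllXP_b4_eq`, `rfl`) — is then EQUIVALENT to the TWO remaining quoted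
  statements, Theorem p. 573 (`B4.ThmPrinted X.famE`) and Prop. 2.3 p. 574 (`B4.Prop23Printed X.famU`), the Sect. 5
  Theorem conjunct being proved since v1 (`leafB4_zeroFieldForms_iff`, `ofPrintedAllXP_withZeroFieldForms_b4_iff` ∕
  `_of_quoted`; at the K-binding of v3, whose `b4` field is the P-binding's, `ofPrintedAllXPK_withZeroFieldForms_b4_iff`).
  READING NOTE (cell REFEREE R44; honest scope = `…B4Prop31Zero` HONEST SCOPE): (i) `A = 0` ONLY — the printed
  hypothesis (1.21) is then void, «for e sufficiently small» is not needed and the printed error term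
  −O(1)e^{2−α}Σ|φ(x)|² is dropped (C(α) = 0); NOTHING is claimed about `A ≠ 0`, which is the content of the paper's
  §4 (4.7)–(4.22) and of [2] Lemma 2.4 (cell census G-B4-06 ∕ G-B4-07 ∕ G-B4-08, not re-litigated here); the abstract
  node `B4.Prop31Printed famF` for an ARBITRARY `famF` is NOT claimed and stays a quoted hypothesis for carriers typed
  otherwise; (ii) the constant γ₀ depends on the window (a₋, m²₊) — the print says «depending on d only», the printed
  proof's own constant ½min{γ₀′/(2d), a_k/(a_k + O(1))} «if m² ≤ O(1)» depends on a_k and on a bound for m² (cell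
  DIVERGENCE D-b04.3, `B4.prop31_gamma0`); (iii) Ω^{(k)} is FINITE (a `Finset`; the paper's regions are finite in
  every use; the torus variant is not typed in that module); (iv) the lattice dimension parameter `d` of the zero-field
  family (lattice ℤ^{d+1}) is not tied by the typing to the Sect. 5 Theorem's `(X.d4, X.N4)` — immaterial for the
  discharge, which holds at every d, but recorded; (v) Theorem p. 573 and Prop. 2.3 stay QUOTED hypotheses; nothing is
  claimed about any other leaf, and `…DagBinding` is not changed (node `b4` keeps its type; the discharge is recorded
  against it, by name).

* Leaf `b4`, conjunct 2 ([Balaban1983RegularityDecay] «Proposition 2.3 of [1]» (1.15)–(1.20) p. 574: the conjunct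
  `B4.Prop23Printed famU` of `B4.LeafB4`, surge node T01.2, AS TYPED), v10.  The pv17 lineage (`…B4Prop23ZeroBox`;
  cell GAPS C-pv17-51, DIVERGENCE D-pv17.15; cross-read ok pv12-g9 2026-08-19T02:47:54Z C-pv12g9-1 (misquotations 0∕2, ABSOLUTE-RULE 0, objections 0, dictionary faithful 11∕11 by `rfl`; advisories A1 cosmetic ∕ A2 records-only, no DOCFIX owed)) has PROVED
  `B4.Prop23Printed (zeroFieldBoxes d ℓ a₋ a₊ m²₊ a₂₋ a₂₊)` for EVERY d, EVERY ℓ ≥ 1 and EVERY window `0 < a₋`,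
  `0 < a₂₋`, hypothesis-free — `B4Prop23ZeroBox.prop23Printed_zeroFieldBoxes` — for the CONCRETE ZERO-FIELD
  NESTED-BOX CARRIERS of `B4.UnitSetting`: one instance per (mesh n ≥ 1, running constants a_j ∈ [a₋, a₊],
  m_j² ∈ [0, m²₊], a ∈ [a₂₋, a₂₊], nested Neumann boxes □ ⊂ □₀ of L-blocks (`B4TwoBox120.Fits`), finite Λ ⊆ □^{(j)},
  charge e) (index type `B4Prop23ZeroBox.ZeroBoxIdx d ℓ a₋ a₊ m²₊ a₂₋ a₂₊`), `udist` the sup norm, `distLc` ∕ `distOc`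
  the distances to □^{(j)} ∖ Λ ∕ to the outer complement, `kerC` ∕ `kerDC` ∕ `kerDC0` the kernels of
  C_Λ^{(j)}(□) = ((Δ^{(j)}(□) + aL^{−2}P)|_Λ)^{−1} and its two differences, `form115` the two-sided form bound,
  `regular := True`, `bigBlocks := True`; (1.15) is `B4BoxCov237.cov237_box_form_bounds`, (1.16)
  `B4BoxCov237.cov116_box_sub_decay`, (1.17)–(1.18) `B4BoxCov237.cov118_box_finset_delta`, (1.19)–(1.20)
  `B4TwoBox120.cov120_twoBox_finset_delta`, with `δ₀ = min` ∕ `c₀ = max` of their constants and threshold `e₁ = 1`.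
  Fed in BY NAME (`prop23Printed_zeroFieldBoxes`), this makes conjunct 2 a theorem of the package for binding
  carriers whose B4 unit-lattice family IS that family (`PrintedCarriersR.withZeroFieldBoxes X d ℓ a₋ a₊ m²₊ a₂₋ a₂₊`):
  the `b4` field of `Upstream.ofPrintedAllXP` is then EQUIVALENT to Theorem p. 573 (`B4.ThmPrinted X.famE`) and
  «Prop. 3.1′ of [2]» (`B4.Prop31Printed X.famF`) (`leafB4_zeroFieldBoxes_iff`, `ofPrintedAllXP_withZeroFieldBoxes_b4_iff`
  ∕ `_of_quoted`, `ofPrintedAllXPK_withZeroFieldBoxes_b4_iff`); and for carriers carrying BOTH zero-field families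
  (`(X.withZeroFieldForms d′ a′₋ m′²₊).withZeroFieldBoxes d ℓ …`, v9 + v10) the `b4` field is EQUIVALENT to Theorem
  p. 573 ALONE (`leafB4_zeroFieldBoth_iff`, `ofPrintedAllXP_withZeroFieldBoth_b4_iff`).  READING NOTE (cell REFEREE
  R44; honest scope = `…B4Prop23ZeroBox` HONEST SCOPE (i)–(vi)): (i) `A = 0` ONLY (`U ≡ 1`) — «for e sufficiently
  small» and the regularity condition (1.7), the whole difficulty of §§2–4 for `A ≠ 0`, are absent (`regular := True`,
  the e-binders discharged trivially); NOTHING is claimed about `A ≠ 0`; the abstract node `B4.Prop23Printed famU` for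
  an ARBITRARY `famU` is NOT claimed; (ii) NESTED NEUMANN BOXES of L-blocks only, not general unions of big blocks;
  Ω^{(k)c} in (1.20) read as □₀^{(j)} ∖ □^{(j)} and Λ^c in (1.18) as □^{(j)} ∖ Λ (recorded divergences of
  `B4TwoBox120` ∕ `B4BoxCov237`); (iii) «Λ being a sum of big blocks» is NOT imposed (`bigBlocks := True`) — formally
  stronger there, weaker in (i)–(ii); (iv) the constants are existential and depend on d, ℓ AND the window (print:
  «dependent on d and M only»); (v) sup norm in the exponents; (vi) the family's parameters (d, ℓ) are not tied by the
  typing to `(X.d4, X.N4)` nor to the v9 zero-field form family's; Theorem p. 573 stays a QUOTED hypothesis (and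
  «Prop. 3.1′ of [2]» for carriers typed otherwise); nothing is claimed about any other leaf, and `…DagBinding` is not
  changed (node `b4` keeps its type; the discharge is recorded against it, by name).

* Leaf `b4`, conjunct 2 for a SECOND concrete family — the zero-field TORUS family, Ω = Ω₀ = T^{(j)}, U = 1
  ([Balaban1983RegularityDecay] «Proposition 2.3 of [1]» (1.15)–(1.20) p. 574: the conjunct `B4.Prop23Printed famU`
  of `B4.LeafB4`, surge node T01.2, AS TYPED), v11.  The pv07 lineage (`…B4Ineq118Torus`; cell certification
  C-pv07-31, node G-pv07-5j, DIVERGENCE D-pv07.23; cross-read XREAD ok b2b-balaban-adv9-g29 2026-08-19T02:54:18Z, C-adv9-67) has PROVED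
  `B4.Prop23Printed (torusFam d L a m²₊)` for EVERY dimension `d ≥ 1`, EVERY odd block size `L > 1`, EVERY `a > 0`
  and EVERY mass cap `m²₊`, hypothesis-free — `B4Ineq118Torus.prop23Printed_torusFam` (through B1's literal Prop. 2.3
  (2.33)–(2.38), `prop23Literal_torusFam` and `B1.prop23Printed_of_literal`) — for the CONCRETE ZERO-FIELD TORUS
  INSTANCE FAMILY of `B4.UnitSetting`: one instance per (volume ∕ tower parameters `P = (d, L, m, K)`, bare mass
  `m² ≥ 0`, level `1 ≤ j ≤ m + K` under the cap `(L^jε)²m² ≤ m²₊`, subset `Λ ⊂ T^{(j)}` of the level-j unit torus)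
  (index type `B4Ineq118Torus.TorusInst d L m²₊`), read with Ω = Ω₀ = T^{(j)} and A = 0: `LSite = Λ`, `udist` the sup
  torus metric `T^{(j)}` in L^jε-units, `distLc = dist(·, T^{(j)} ∖ Λ)`, `distOc = dist(·, T^{(j)c}) = 0` (empty
  complement), `kerC = |C^{(j)}_Λ|` with `C^{(j)}_Λ = ((aL^{−2}Q^*Q + Δ^{(j)})|_Λ)^{−1}` the restricted covariance of
  the concrete scalar torus tower (1.13), `kerDC = |δC^{(j)}_Λ|` (1.17), `kerDC0 = |C^{(j)}_Λ(Ω) − C^{(j)}_Λ(Ω₀)| = 0`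
  (1.19) at Ω = Ω₀, `form115 γ₀ γ₁` the two inequalities (1.15) for `aL^{−2}Q^*Q + Δ^{(j)}` on `ℝ^{T^{(j)}}`, `e = 1`,
  `regular := True`, `bigBlocks := True`; constants `γ₀ = gamma115u L a`, `γ₁ = aL^{−2} + a` (`B4Ineq115Torus.ineq115`),
  `δ₀ = δ₁∕4`, `c₀ = max(2∕γ₀, c118)`, threshold `e₁ = 1`; (1.16) for EVERY Λ is `B4Ineq118Torus.abs_CLam_le` (b04's
  §5 engine `B4Sect5Torus.inv_submatrix_decay` at `B4Ineq116Torus.Carg_hyp56`), (1.18) `abs_deltaC_le_distC`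
  (`B4Sect5Torus.deltaC_bound`), (1.20) empty.  Fed in BY NAME (`leafB4_conj2_torusFam`), this makes conjunct 2 a
  theorem of the package for binding carriers whose B4 unit-lattice family IS that family (`PrintedCarriersR.withTorusFam
  X d L a m²₊`): the `b4` field of `Upstream.ofPrintedAllXP` is then EQUIVALENT to Theorem p. 573 (`B4.ThmPrinted
  X.famE`) and «Prop. 3.1′ of [2]» (`B4.Prop31Printed X.famF`) (`leafB4_torusFam_iff`, `ofPrintedAllXP_withTorusFam_b4_iff`
  ∕ `_of_quoted`, `ofPrintedAllXPK_withTorusFam_b4_iff`); and for carriers carrying the torus family AND the zero-field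
  form family of v9 (`(X.withZeroFieldForms d′ a′₋ m′²₊).withTorusFam d L a m²₊`) the `b4` field is EQUIVALENT to
  Theorem p. 573 ALONE (`leafB4_torusForms_iff`, `ofPrintedAllXP_withTorusForms_b4_iff`) — the same net state as v10's
  for the nested-box family, now for the case Ω = T that [1] part I and [Balaban1984PropagatorsI] p. 39 actually use.
  READING NOTE (cell REFEREE R44; honest scope = `…B4Ineq118Torus` Dictionary ∕ HONEST SCOPE (i)–(viii) and
  NOT-CERTIFIED (a)–(e)): (i) Ω = Ω₀ = the WHOLE TORUS only — (1.19)–(1.20) carry NO content for this family and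
  `dist(x, Λᶜ)` is the torus distance to `T^{(j)} ∖ Λ`; regions Ω ⊊ torus are NOT here (the nested-box family of v10
  is the complementary zero-field record); (ii) `A = 0` ONLY (`U ≡ 1`) — «A regular» and «for e sufficiently small»
  are vacuous (`regular := True`, `e = 1`); NOTHING is claimed about `A ≠ 0`, the whole difficulty of §§2–4 of the
  paper; the abstract node `B4.Prop23Printed famU` for an ARBITRARY `famU` is NOT claimed; (iii) «Λ being a sum of
  big blocks» is NOT imposed (`bigBlocks := True`; the §5 route gives (1.16)∕(1.18) for arbitrary Λ, as the Sect. 5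
  Theorem is printed); (iv) printed route vs the tree's: (5.8) by the block-resolvent identity and (5.7), not the
  random walk (5.24)–(5.27) (D-pv07.23); (v) sup torus metric; (vi)–(vii) dimension indexing over all `P` with
  `P.d = d ≥ 1`, mass cap `(L^jε)²m² ≤ m²₊`; (viii) the constants are explicit functions of b04's existential window
  constants `(κ, M)` — «dependent on d and M only» becomes «on d, L, a, m²₊», no numerical values; levels `j ≥ 1` only
  (j = 0 not here); `γ₁` is the cruder `aL^{−2} + a`, not (5.1)'s; the family's parameters (d, L) are not tied by the
  typing to `(X.d4, X.N4)` nor to the v9 form family's; Theorem p. 573 stays a QUOTED hypothesis (and «Prop. 3.1′ of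
  [2]» for carriers typed otherwise); nothing is claimed about any other leaf, and `…DagBinding` is not changed (node
  `b4` keeps its type; the discharge is recorded against it, by name).

* Leaf `b6`, the PRINTED Lemma 2.4 on the PERIODIC carriers — the series' ambient torus `T` ([Balaban1984PropagatorsII]
  Lemma 2.4 (2.128) p. 245, printed constant 1∕(12d²): the conjunct `B6.Lemma24Printed D.d D.L D.tree` of `B6BlockRest`,
  AS TYPED; use-site p. 249 «on the whole lattice T^{(k)}, or on a subset Λ ⊂ T^{(k)}»), v12 — lifting proviso (i) of
  the eighth bullet («not the series' torus `T`») for a concrete periodic carrier family.  The pv09 lineage has PROVED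
  (2.128) WITH ITS PRINTED CONSTANT ON THE TORUS — `B6Lemma24Torus.lemma24_torus` (p182680; cross-read ok ref6-g19
  2026-08-19T02:42:43Z REFEREE6 E101): every d ≥ 2, L ≥ 1, periods M_i ≥ 1 with L ∣ M_i, every M-periodic B in the
  gauge (2.121) on the blocks of T′, by the b06 route of the eighth bullet transported to the torus (`face_split` summed
  over the torus coarse bonds, `assembly_core_one` at the layer constant 2∕(L+1), (2.123); torus bookkeeping in place of
  «B = 0 outside Λ»), NOT by the printed route — and typed it on B5's OWN configuration type `Tor M × Fin d → ℝ`
  (`…B5Prop11Plancherel`) as `B6LowerBound2153Torus.lemma24Printed_tor` (whole torus; v1.1 p182822, cross-read pv07-g8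
  2026-08-19T03:05:10Z C-pv07-32, ok-with-objection → DOCFIX delivered in v1.2) and `…lemma24Printed_torSub` (the
  printed case «or on a subset Λ ⊂ T^{(k)}»; v1.2 p182877, cross-read ref5-g19 2026-08-19T03:51:08Z REFEREE5 #125
  C-ref5-125, boundary clean).  Fed into the v3 ∕ v7 reductions BY NAME, the printed Lemma-2.4 conjunct is a theorem of
  the package for block data whose tree-gauge carriers are the periodic carriers (`torusTrees D L M`,
  `torusSubTrees D L M Λ`; `PrintedCarriersR.withTorusTrees`, `.withTorusSubTrees`) at every L ≥ 1 — on the series'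
  regime L > 11 `lemma24Printed_torusTrees_of_eleven_lt` —: `lemma24Printed_torusTrees` ∕ `…SubTrees`,
  `lemma24K_torusTrees_one` ∕ `…SubTrees_one`, `lemma24K_torusTrees_of_le_one` (every κ ≤ 1); hence the rest block is
  EQUIVALENT to Props. 2.2, 2.3, 2.5, 2.6, 2.7 ∧ Cor. 2.8 alone (`b6BlockRest_torusTrees_iff` ∕ `…SubTrees_iff`) and the
  `b6` leaf — block level, `Upstream.ofPrintedAllXP`, and the K-binding at every κ ≤ 1 — to `B6Lemma21Param ∧` those
  six (`b6BlockParam_torusTrees_iff` ∕ `…SubTrees_iff`, `ofPrintedAllXP_withTorusTrees_b6_iff` ∕ `…SubTrees_b6_iff`,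
  `b6BlockParamK_torusTrees_iff_of_le_one`, `ofPrintedAllXPK_withTorusTrees_b6_iff_of_le_one`; the three concrete
  families side by side `b6_lemma24_families`).  READING NOTE (cell REFEREE R44; honest scope = `…B6LowerBound2153Torus`
  HONEST SCOPE (i)–(iv), `…B6Lemma24Torus` scope): (i) carriers exactly as typed there — discrete torus `Tor M` with
  non-zero periods divisible by L, configurations `Tor M × Fin d → ℝ`, gauge (2.121) on every block of T′ for the
  periodic extension, ‖B‖² = Σ_x Σ_ν B(x,ν)², Σ_p |(∂₁B)(p)|² = `B5Bounds167Lattice.d1Sq` ((1.67) of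
  [Balaban1984PropagatorsI]), Q₁ verbatim (2.125) over the coarse bonds of T; subset case Λ = B(Λ′₀), «B = 0 outside Λ»
  in the bond convention, gauge on the blocks of Λ′₀, Q₁-sum over the coarse bonds meeting Λ′₀; the scaled torus
  T^{(k)}_η enters through its unit-lattice model only; the abstract node `B6.Lemma24Printed d L fam` for ARBITRARY tree
  data is not claimed, nor anything about carriers typed otherwise; (ii) the printed DERIVATION stays kernel-refuted
  from L = 10 on (`B6.claim_p245_fails_L10`, `B6.ineq2127_fails_L10`; G-B6-09 ∕ G-B6-09R ∕ G-B6-10U stand) — what is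
  discharged is the printed STATEMENT on the typed periodic carriers, by the package's own proof; (iii) (2.153) itself
  (`…lowerBound2153_tor` ∕ `_torSub`, with (2.118) discharged for the (1.66) form by `B5Bounds167Lattice.ineq167` at
  the package constant γ₀ = (4∕π²)^{d+2}) is the USE of the lemma, not one of the eight typed statements, and is NOT
  recorded here; (iv) Lemma 2.1 (`B6Lemma21Param`) and Props. 2.2, 2.3, 2.5, 2.6, 2.7, Cor. 2.8 stay QUOTED; nothing is
  claimed about any other leaf, and `…DagBinding` is not changed (node `b6` keeps its type;
  the discharge is recorded against it, by name).

WHAT IS NOT RECORDED.  No statement of the manuscripts under audit is asserted; no other leaf or leaf conjunct is discharged (v7 widens the v3 ∕ v5 discharge of the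
Lemma-2.4 conjunct of `b6` to every block size, for the same typed carriers; v8 adds the Lemma-1 conjunct `l1` of `b8`
for the block-pair carriers of the abelian model, the other eight statements of that leaf staying quoted; v9 adds
conjunct 3 of `b4`, «Proposition 3.1′ of [2]», for the zero-field form carriers at `A = 0`, Theorem p. 573 and Prop. 2.3
staying quoted; v10 adds conjunct 2 of `b4`, «Proposition 2.3 of [1]», for the zero-field nested-box unit-lattice
carriers at `A = 0` — with v9, leaf `b4` over both zero-field families asks Theorem p. 573 alone; v11 adds the same
conjunct for a second concrete family, the zero-field TORUS family, Ω = Ω₀ = T^{(j)}, U = 1 — with v9, again Theorem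
p. 573 alone; v12 adds the printed Lemma-2.4 conjunct of `b6` for the PERIODIC tree-gauge carriers on the series' torus
`T`, whole torus and Λ ⊂ T, the other seven B6 statements staying quoted); the v6
record on node `b10` is NEGATIVE and about the typing only (`…DagBinding` untouched, no printed statement refuted); in
particular NOTHING here bears on `Dag.Leaves.betaPositive` (cell census T09.F, the located UNPRINTED input of the
`uvBounds` chain) or on the analytic leaves of B4–B16.  value = typed skeleton + citation DAG + located gaps, NOT summit
progress.
-/

namespace Literature.MathematicalPhysics.QuantumFieldTheory.Balaban1983to89.DagDischarged

open DagBinding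

/-! ## Leaf `b4`: the Sect. 5 Theorem conjunct is proved -/

/-- The bundle `B4.LeafB4` is equivalent to its three QUOTED conjuncts: the fourth, the Sect. 5 Theorem (uniform
reading), is supplied by `B4Sect5Proof.sect5ThmUniform_holds`. [cite: Balaban1983RegularityDecay, Sect. 5 Theorem p.594] -/
theorem leafB4_iff_quoted {I₁ I₂ I₃ : Type} (famE : I₁ → B4.EtaSetting) (famU : I₂ → B4.UnitSetting)
    (famF : I₃ → B4.FormSetting) (d N : ℕ) :
    B4.LeafB4 famE famU famF d N ↔ B4.ThmPrinted famE ∧ B4.Prop23Printed famU ∧ B4.Prop31Printed famF :=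
  ⟨fun h => ⟨h.1, h.2.1, h.2.2.1⟩, fun h => B4Sect5Proof.leafB4_of_printed h.1 h.2.1 h.2.2⟩

/-- The `b4` field of the v1 binding `Upstream.ofPrinted` IS `B4.LeafB4` over the carriers (bookkeeping, `rfl`). [folklore] -/
theorem ofPrinted_b4_eq (X : PrintedCarriers) (b9 b11 rOp rBS : Prop) :
    (Upstream.ofPrinted X b9 b11 rOp rBS).b4 = B4.LeafB4 X.famE X.famU X.famF X.d4 X.N4 :=
  rfl

/-- **Leaf `b4` reduced to three quoted statements** (v1 binding): the bound `b4` field holds iff the Theorem p. 573,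
Prop. 2.3 and Prop. 3.1′ (p. 574) hold over the chosen families — the Sect. 5 Theorem needs no quotation.
[cite: Balaban1983RegularityDecay, Theorem p.573, Props. p.574, Sect. 5 Theorem p.594] -/
theorem ofPrinted_b4_iff (X : PrintedCarriers) (b9 b11 rOp rBS : Prop) :
    (Upstream.ofPrinted X b9 b11 rOp rBS).b4 ↔
      B4.ThmPrinted X.famE ∧ B4.Prop23Printed X.famU ∧ B4.Prop31Printed X.famF :=
  leafB4_iff_quoted X.famE X.famU X.famF X.d4 X.N4

/-- The three quoted statements give the bound `b4` field (v1 binding). [cite: Balaban1983RegularityDecay, Theorem p.573, Props. p.574] -/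
theorem ofPrinted_b4_of_quoted (X : PrintedCarriers) (b9 b11 rOp rBS : Prop) (h₁ : B4.ThmPrinted X.famE)
    (h₂ : B4.Prop23Printed X.famU) (h₃ : B4.Prop31Printed X.famF) : (Upstream.ofPrinted X b9 b11 rOp rBS).b4 :=
  (ofPrinted_b4_iff X b9 b11 rOp rBS).2 ⟨h₁, h₂, h₃⟩

/-- The `b4` field of the current P-binding `Upstream.ofPrintedAllXP` is the same `B4.LeafB4` (the extension chain
`ofPrinted → ofPrintedR → ofPrintedFull → ofPrintedAll → ofPrintedAllX → ofPrintedAllXP` never touches `b4`; `rfl`). [folklore] -/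
theorem ofPrintedAllXP_b4_eq (X : PrintedCarriersR) (Y : PrintedCarriers9X) (Z : PrintedCarriers11)
    (V : PrintedCarriers14R) (W : PrintedCarriers15) :
    (Upstream.ofPrintedAllXP X Y Z V W).b4 = B4.LeafB4 X.famE X.famU X.famF X.d4 X.N4 :=
  rfl

/-- **Leaf `b4` reduced to three quoted statements** (current P-binding). [cite: Balaban1983RegularityDecay, Theorem p.573, Props. p.574, Sect. 5 Theorem p.594] -/
theorem ofPrintedAllXP_b4_iff (X : PrintedCarriersR) (Y : PrintedCarriers9X) (Z : PrintedCarriers11)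
    (V : PrintedCarriers14R) (W : PrintedCarriers15) :
    (Upstream.ofPrintedAllXP X Y Z V W).b4 ↔
      B4.ThmPrinted X.famE ∧ B4.Prop23Printed X.famU ∧ B4.Prop31Printed X.famF := by
  rw [ofPrintedAllXP_b4_eq]
  exact leafB4_iff_quoted X.famE X.famU X.famF X.d4 X.N4

/-- The three quoted statements give the `b4` field of the current P-binding. [cite: Balaban1983RegularityDecay, Theorem p.573, Props. p.574] -/
theorem ofPrintedAllXP_b4_of_quoted (X : PrintedCarriersR) (Y : PrintedCarriers9X) (Z : PrintedCarriers11)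
    (V : PrintedCarriers14R) (W : PrintedCarriers15) (h₁ : B4.ThmPrinted X.famE) (h₂ : B4.Prop23Printed X.famU)
    (h₃ : B4.Prop31Printed X.famF) : (Upstream.ofPrintedAllXP X Y Z V W).b4 :=
  (ofPrintedAllXP_b4_iff X Y Z V W).2 ⟨h₁, h₂, h₃⟩

/-- From the bound `b4` field, the Sect. 5 Theorem in BOTH printed quantifier readings — now unconditionally, the field
being used only to fix `(d, N)`. [cite: Balaban1983RegularityDecay, Sect. 5 Theorem (5.6)–(5.10) p.594] -/
theorem sect5_both_readings (X : PrintedCarriers) :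
    B4.Sect5ThmUniform X.d4 X.N4 ∧ B4.Sect5ThmLiteral X.d4 X.N4 :=
  ⟨B4Sect5Proof.sect5ThmUniform_holds X.d4 X.N4, B4Sect5Proof.sect5ThmLiteral_holds X.d4 X.N4⟩

/-! ## Leaf `b6` (parameter form): Lemma 2.1 from the decomposition data -/

/-- **The P-binding's `b6` field from contour-system data, the existence of the printed decomposition (2.47) of the
minimising contours, and the rest of B6's stated block.**  Composition of `B6Lemma21Bridge.lemma21TwoScale_of_decomp`
(Lemma 2.1 in the two-scale constant `c1TwoScale`, from the data) with `DagBinding.ofPrintedAllXP_b6_of_twoScale`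
(two-scale form ⇒ parameter form `∃ c₁(α)` ⇒ leaf).  The hypotheses are, per index `i` of the block's family of
geometries: a contour system realising the geometry with connected bond graph and the level gap `N i ≥ R·M`
(`B6Geometry`), and — under the printed hypotheses (2.21)–(2.22) — the decomposition data `Decomp247` at every site
(the sentences of pp. 231–233, typed field by field in `B6Lemma21Bridge`); `0 < δ₀` is the printed positivity of the
decay rate.  Reading-neutral (module docstring). [cite: Balaban1984PropagatorsII, Lemma 2.1 p.234 + pp.231–233; repaired constant] -/
theorem ofPrintedAllXP_b6_of_decomp (X : PrintedCarriersR) (Y : PrintedCarriers9X) (Z : PrintedCarriers11)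
    (V : PrintedCarriers14R) (W : PrintedCarriers15) (hδ : 0 < X.D6.δ₀)
    (C : ∀ i, B6Geometry.ContourSystem (X.D6.geo i)) (N : X.D6.I → ℕ)
    (hreal : ∀ i, B6Geometry.Realizes (X.D6.geo i) (C i)) (hconn : ∀ i, (C i).bond.Connected)
    (hgap : ∀ i, B6Geometry.LevelGap (C i).bond (C i).zone (N i))
    (hRM : ∀ i, (X.D6.geo i).R * (X.D6.geo i).M ≤ N i)
    (hdecomp : ∀ i, (X.D6.geo i).Hyp21_22 → ∀ y : (X.D6.geo i).Site, B6Lemma21Bridge.Decomp247 (X.D6.geo i) X.D6.d y)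
    (hrest : B6BlockRest X.D6) : (Upstream.ofPrintedAllXP X Y Z V W).b6 :=
  ofPrintedAllXP_b6_of_twoScale X Y Z V W
    (B6Lemma21Bridge.lemma21TwoScale_of_decomp X.D6.d X.D6.δ₀ hδ X.D6.geo C N hreal hconn hgap hRM hdecomp) hrest

/-- The same discharge stated for the parameter-form block itself (no binding carriers). [cite: Balaban1984PropagatorsII, Lemma 2.1 p.234; repaired constant] -/
theorem b6BlockParam_of_decomp (D : B6.BlockData) (hδ : 0 < D.δ₀)
    (C : ∀ i, B6Geometry.ContourSystem (D.geo i)) (N : D.I → ℕ)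
    (hreal : ∀ i, B6Geometry.Realizes (D.geo i) (C i)) (hconn : ∀ i, (C i).bond.Connected)
    (hgap : ∀ i, B6Geometry.LevelGap (C i).bond (C i).zone (N i))
    (hRM : ∀ i, (D.geo i).R * (D.geo i).M ≤ N i)
    (hdecomp : ∀ i, (D.geo i).Hyp21_22 → ∀ y : (D.geo i).Site, B6Lemma21Bridge.Decomp247 (D.geo i) D.d y)
    (hrest : B6BlockRest D) : B6BlockParam D :=
  b6BlockParam_of_twoScale D
    (B6Lemma21Bridge.lemma21TwoScale_of_decomp D.d D.δ₀ hδ D.geo C N hreal hconn hgap hRM hdecomp) hrest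

/-- With the `b6` field so discharged, B6's "main technical results" (Prop. 2.6 ∧ Cor. 2.8, p. 249) for the B9 base
follow as before (`DagBinding.ofPrintedAllXP_b6_mainResults`). [cite: Balaban1984PropagatorsII, p.249] -/
theorem mainResults_of_decomp (X : PrintedCarriersR) (Y : PrintedCarriers9X) (Z : PrintedCarriers11)
    (V : PrintedCarriers14R) (W : PrintedCarriers15) (hδ : 0 < X.D6.δ₀)
    (C : ∀ i, B6Geometry.ContourSystem (X.D6.geo i)) (N : X.D6.I → ℕ)
    (hreal : ∀ i, B6Geometry.Realizes (X.D6.geo i) (C i)) (hconn : ∀ i, (C i).bond.Connected)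
    (hgap : ∀ i, B6Geometry.LevelGap (C i).bond (C i).zone (N i))
    (hRM : ∀ i, (X.D6.geo i).R * (X.D6.geo i).M ≤ N i)
    (hdecomp : ∀ i, (X.D6.geo i).Hyp21_22 → ∀ y : (X.D6.geo i).Site, B6Lemma21Bridge.Decomp247 (X.D6.geo i) X.D6.d y)
    (hrest : B6BlockRest X.D6) : B6.MainResults X.D6 :=
  ofPrintedAllXP_b6_mainResults X Y Z V W (ofPrintedAllXP_b6_of_decomp X Y Z V W hδ C N hreal hconn hgap hRM hdecomp hrest)

/-! ## Leaf `b5`: the Prop. 1.1 conjunct is proved for the lattice carriers (v2) -/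

section LeafB5

open scoped BigOperators Matrix ComplexConjugate ComplexOrder
open B5Prop11Plancherel B5Prop11Lattice B5DeltaA169 B5Prop11Lower

/-- Index of the lattice family of Prop. 1.1: `n = L^k ≥ 1` fine lattice points per unit interval and the torus
periods `M_μ ≥ 1` of (1.29) (the family index «k, T_η» of the printed «γ₀ independent of k, T_η»). [cite: Balaban1984PropagatorsI, (1.29) p.23, Prop. 1.1 p.33] -/
structure LatIdx (d : ℕ) where
  n : ℕ
  M : Fin d → ℕ
  hn : 1 ≤ n
  hM : ∀ μ, NeZero (M μ)

namespace LatIdx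

variable {d : ℕ} (i : LatIdx d)

/-- `n ≥ 1`, so `n ≠ 0` (the instance the torus `Tor (fine n M)` needs). [folklore] -/
instance instN : NeZero i.n := ⟨by have := i.hn; omega⟩

/-- `M_μ ≠ 0` (field `hM`, registered as an instance on `i.M μ`). [folklore] -/
instance instM (μ : Fin d) : NeZero (i.M μ) := i.hM μ

/-- Vector fields on the fine torus: the `J`, `A` of (1.89)–(1.90) in the typed reading of `…B5DeltaA169`. [folklore] -/
abbrev V : Type := Tor (fine i.n i.M) × Fin d → ℂ

/-- The local fields of (1.89): a vector field (entries `‖GJ‖`, `‖∇GJ‖`, `‖∇∇GJ‖`), a tensor field `(J_ν)`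
(entries `‖G∇*J‖`, `‖∇G∇*J‖`) or a 2-tensor field (entry `‖G∇*∇*J‖`). [cite: Balaban1984PropagatorsI, (1.89) p.33] -/
abbrev Loc : Type := i.V ⊕ ((Fin d → i.V) ⊕ (Fin d × Fin d → i.V))

/-- `‖J‖` of (1.89) on each kind of field (`ℓ²` norm of a field ∕ of a tensor field). [folklore] -/
noncomputable def l2Norm : i.Loc → ℝ
  | .inl J => l2 J
  | .inr (.inl J) => l2T J
  | .inr (.inr J) => l2T J

/-- `0 ≤ ‖J‖`. [folklore] -/
theorem l2Norm_nonneg (J : i.Loc) : 0 ≤ i.l2Norm J := by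
  rcases J with J | J | J <;> exact Real.sqrt_nonneg _

/-- The six quantities of (1.89) for `G = Δ_a⁻¹` (`Δ_a = B5DeltaA169.DeltaA n M a`, the typed (1.69)), each read on the
kind of field it is printed for and `0` on the other kinds (where (1.89) says nothing). [cite: Balaban1984PropagatorsI, (1.89) p.33] -/
noncomputable def l2op (a : ℝ) : Fin 6 → i.Loc → ℝ
  | ⟨0, _⟩, .inl J => l2 ((DeltaA i.n i.M a)⁻¹ *ᵥ J)
  | ⟨1, _⟩, .inl J => l2T (grad i.n i.M ((DeltaA i.n i.M a)⁻¹ *ᵥ J))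
  | ⟨2, _⟩, .inr (.inl J) => l2 ((DeltaA i.n i.M a)⁻¹ *ᵥ divT i.n i.M J)
  | ⟨3, _⟩, .inr (.inl J) => l2T (grad i.n i.M ((DeltaA i.n i.M a)⁻¹ *ᵥ divT i.n i.M J))
  | ⟨4, _⟩, .inl J => l2T (grad2 i.n i.M ((DeltaA i.n i.M a)⁻¹ *ᵥ J))
  | ⟨5, _⟩, .inr (.inr J) => l2 ((DeltaA i.n i.M a)⁻¹ *ᵥ divT2 i.n i.M J)
  | _, _ => 0

/-- `⟨A, Δ_a A⟩` of (1.90), real part (the form is real on the Hermitian `Δ_a`). [cite: Balaban1984PropagatorsI, (1.90) p.33] -/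
noncomputable def formΔa (a : ℝ) (A : i.V) : ℝ := (star A ⬝ᵥ (DeltaA i.n i.M a *ᵥ A)).re

/-- `⟨A, (Δ + I) A⟩` of (1.90), real part. [cite: Balaban1984PropagatorsI, (1.90) p.33] -/
noncomputable def formΔI (A : i.V) : ℝ := (star A ⬝ᵥ ((Lap i.n i.M + 1) *ᵥ A)).re

end LatIdx

/-- The Prop.-1.2 ∕ (1.67) fields of `B5.Setting` that `B5.Prop11Printed` does not read (sites, distance, scale `k`,
supports, sup ∕ Hölder norms, cut-off functions, the quantities of (1.110)–(1.114)), supplied by the caller so that the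
lattice carriers carry no junk values. [folklore] -/
structure Rest (Loc : Type) where
  Site : Type
  dist : Site → Site → ℝ
  k : ℕ
  suppIn : Loc → Site → Prop
  supNorm : Loc → ℝ
  holder : ℝ → Loc → ℝ
  Cut : Type
  cutIn : Cut → Site → Prop
  cutH : ℝ → Cut → ℝ
  cutSup : Cut → ℝ
  e : Fin 4 → Loc → Site → ℝ
  h1 : Loc → ℝ → Cut → ℝ
  e4 : Loc → Site → ℝ
  h2 : Loc → ℝ → Cut → ℝ
  l2loc : Fin 6 → Loc → Cut → ℝ

variable {d : ℕ}

/-- **The lattice carriers of leaf `b5`**: the Prop.-1.1 fields of `B5.Setting` are the typed lattice objects above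
(parameter `a > 0` of (1.69)), the Prop.-1.2 ∕ (1.67) fields are `rest i`. [cite: Balaban1984PropagatorsI, Prop. 1.1 p.33] -/
noncomputable def famOfLattice (a : ℝ) (rest : ∀ i : LatIdx d, Rest i.Loc) (i : LatIdx d) : B5.Setting where
  Site := (rest i).Site
  dist := (rest i).dist
  k := (rest i).k
  Loc := i.Loc
  suppIn := (rest i).suppIn
  supNorm := (rest i).supNorm
  l2Norm := i.l2Norm
  holder := (rest i).holder
  Cut := (rest i).Cut
  cutIn := (rest i).cutIn
  cutH := (rest i).cutH
  cutSup := (rest i).cutSup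
  l2op := i.l2op a
  e := (rest i).e
  h1 := (rest i).h1
  e4 := (rest i).e4
  h2 := (rest i).h2
  l2loc := (rest i).l2loc
  Vec := i.V
  formΔa := i.formΔa a
  formΔI := i.formΔI

/-- **Proposition 1.1 BY NAME for the lattice carriers**: `B5.Prop11Printed (famOfLattice a rest)` with
`γ₀ = gammaZero d a`, uniformly in the index (k, T_η) — assembled from the landed `B5Prop11Lattice.ineq189_*` (the six
bounds (1.89) for the typed `Δ_a⁻¹`) and `B5Prop11Lattice.ineq190_form` ((1.90) as forms); the entries of `l2op` on
which (1.89) says nothing are `0 ≤ γ₀⁻¹‖J‖`. [cite: Balaban1984PropagatorsI, Prop. 1.1 (1.89)–(1.90) p.33 (kernel version for the typed operators of …B5DeltaA169; constant and proof the package's)] -/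
theorem prop11Printed_famOfLattice (a : ℝ) (ha : 0 < a) (rest : ∀ i : LatIdx d, Rest i.Loc) :
    B5.Prop11Printed (famOfLattice a rest) := by
  refine ⟨gammaZero d a, gammaZero_pos d a, fun i => ⟨?_, ?_⟩⟩
  · intro k J
    have h0 : (0 : ℝ) ≤ (gammaZero d a)⁻¹ * i.l2Norm J :=
      mul_nonneg (inv_nonneg.mpr (gammaZero_pos d a).le) (i.l2Norm_nonneg J)
    match k, J with
    | ⟨0, _⟩, .inl J => exact ineq189_G i.n i.hn i.M a ha J
    | ⟨1, _⟩, .inl J => exact ineq189_gradG i.n i.hn i.M a ha J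
    | ⟨2, _⟩, .inr (.inl J) => exact ineq189_GdivT i.n i.hn i.M a ha J
    | ⟨3, _⟩, .inr (.inl J) => exact ineq189_gradGdivT i.n i.hn i.M a ha J
    | ⟨4, _⟩, .inl J => exact ineq189_grad2G i.n i.hn i.M a ha J
    | ⟨5, _⟩, .inr (.inr J) => exact ineq189_GdivT2 i.n i.hn i.M a ha J
    | ⟨0, _⟩, .inr _ => exact h0
    | ⟨1, _⟩, .inr _ => exact h0
    | ⟨2, _⟩, .inl _ => exact h0
    | ⟨2, _⟩, .inr (.inr _) => exact h0
    | ⟨3, _⟩, .inl _ => exact h0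
    | ⟨3, _⟩, .inr (.inr _) => exact h0
    | ⟨4, _⟩, .inr _ => exact h0
    | ⟨5, _⟩, .inl _ => exact h0
    | ⟨5, _⟩, .inr (.inl _) => exact h0
  · intro A
    change gammaZero d a * i.formΔI A ≤ i.formΔa a A
    exact ineq190_form i.n i.hn i.M a ha A

/-- **Leaf `b5` for the lattice carriers reduced to its two QUOTED conjuncts** (Prop. 1.2, the bounds (1.67)).
Nothing is claimed about those two statements. [cite: Balaban1984PropagatorsI, Prop. 1.2 (1.110)–(1.114) pp.35–36, (1.67) p.29] -/
theorem mainBlock_lattice_iff (a : ℝ) (ha : 0 < a) (rest : ∀ i : LatIdx d, Rest i.Loc)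
    (forms : LatIdx d → B5.FormData) :
    B5.MainBlock (famOfLattice a rest) forms ↔ B5.Prop12Printed (famOfLattice a rest) ∧ B5.Bounds167 forms :=
  ⟨fun h => h.2, fun h => ⟨prop11Printed_famOfLattice a ha rest, h⟩⟩

/-- The `b5` field of the current P-binding `Upstream.ofPrintedAllXP` is `B5.MainBlock X.fam5 X.forms5` (the extension
chain `ofPrinted → … → ofPrintedAllXP` never touches `b5`; `rfl`). [folklore] -/
theorem ofPrintedAllXP_b5_eq (X : PrintedCarriersR) (Y : PrintedCarriers9X) (Z : PrintedCarriers11)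
    (V : PrintedCarriers14R) (W : PrintedCarriers15) :
    (Upstream.ofPrintedAllXP X Y Z V W).b5 = B5.MainBlock X.fam5 X.forms5 :=
  rfl

/-- Binding carriers whose B5 data ARE the lattice carriers (index `LatIdx d`, settings `famOfLattice a rest`, form data
`forms`); every other field of `X` unchanged. [folklore] -/
noncomputable def _root_.Literature.MathematicalPhysics.QuantumFieldTheory.Balaban1983to89.DagBinding.PrintedCarriersR.withLatticeB5
    (X : PrintedCarriersR) (d : ℕ) (a : ℝ) (rest : ∀ i : LatIdx d, Rest i.Loc) (forms : LatIdx d → B5.FormData) :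
    PrintedCarriersR :=
  { X with I5 := LatIdx d, fam5 := famOfLattice a rest, forms5 := forms }

/-- **Leaf `b5` of the current P-binding, for carriers with lattice B5 data, is EQUIVALENT to Prop. 1.2 ∧ (1.67)**
(Prop. 1.1 being `prop11Printed_famOfLattice`). [cite: Balaban1984PropagatorsI, Props. 1.1–1.2 pp.33–36, (1.67) p.29] -/
theorem ofPrintedAllXP_withLatticeB5_b5_iff (X : PrintedCarriersR) (Y : PrintedCarriers9X) (Z : PrintedCarriers11)
    (V : PrintedCarriers14R) (W : PrintedCarriers15) (d : ℕ) (a : ℝ) (ha : 0 < a)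
    (rest : ∀ i : LatIdx d, Rest i.Loc) (forms : LatIdx d → B5.FormData) :
    (Upstream.ofPrintedAllXP (X.withLatticeB5 d a rest forms) Y Z V W).b5 ↔
      B5.Prop12Printed (famOfLattice a rest) ∧ B5.Bounds167 forms := by
  rw [ofPrintedAllXP_b5_eq]
  exact mainBlock_lattice_iff a ha rest forms

/-- The two quoted statements give the `b5` field of the current P-binding for carriers with lattice B5 data. [cite: Balaban1984PropagatorsI, Prop. 1.2 pp.35–36, (1.67) p.29] -/
theorem ofPrintedAllXP_withLatticeB5_b5_of_quoted (X : PrintedCarriersR) (Y : PrintedCarriers9X)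
    (Z : PrintedCarriers11) (V : PrintedCarriers14R) (W : PrintedCarriers15) (d : ℕ) (a : ℝ) (ha : 0 < a)
    (rest : ∀ i : LatIdx d, Rest i.Loc) (forms : LatIdx d → B5.FormData)
    (h12 : B5.Prop12Printed (famOfLattice a rest)) (h167 : B5.Bounds167 forms) :
    (Upstream.ofPrintedAllXP (X.withLatticeB5 d a rest forms) Y Z V W).b5 :=
  (ofPrintedAllXP_withLatticeB5_b5_iff X Y Z V W d a ha rest forms).2 ⟨h12, h167⟩

/-- Bookkeeping (`rfl`): replacing the B5 data leaves every other leaf of the P-binding unchanged — stated for the two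
leaves this module discharges elsewhere (`b4`, `b6`). [folklore] -/
theorem ofPrintedAllXP_withLatticeB5_b4_b6 (X : PrintedCarriersR) (Y : PrintedCarriers9X) (Z : PrintedCarriers11)
    (V : PrintedCarriers14R) (W : PrintedCarriers15) (d : ℕ) (a : ℝ)
    (rest : ∀ i : LatIdx d, Rest i.Loc) (forms : LatIdx d → B5.FormData) :
    (Upstream.ofPrintedAllXP (X.withLatticeB5 d a rest forms) Y Z V W).b4 = (Upstream.ofPrintedAllXP X Y Z V W).b4 ∧
    (Upstream.ofPrintedAllXP (X.withLatticeB5 d a rest forms) Y Z V W).b6 = (Upstream.ofPrintedAllXP X Y Z V W).b6 :=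
  ⟨rfl, rfl⟩

end LeafB5

/-! ## Leaf `b5`, real fields: the Prop. 1.1 conjunct for the REAL lattice carriers, as printed p. 18 (v2.1) -/

section LeafB5Real

open scoped BigOperators Matrix
open B5Prop11Plancherel B5Prop11Lattice B5DeltaA169 B5Prop11Lower B5RealFields

namespace LatIdx

variable {d : ℕ} (i : LatIdx d)

/-- REAL vector fields on the fine torus, «A : {b ⊂ T_ε} → ℝ» (p. 18): the `J`, `A` of (1.89)–(1.90) in the real
typed reading of `…B5RealFields`. [cite: Balaban1984PropagatorsI, p.18, (1.89) p.33] -/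
abbrev VR : Type := Tor (fine i.n i.M) × Fin d → ℝ

/-- The real local fields of (1.89): a vector field, a tensor field `(J_ν)` or a 2-tensor field. [cite: Balaban1984PropagatorsI, (1.89) p.33] -/
abbrev LocR : Type := i.VR ⊕ ((Fin d → i.VR) ⊕ (Fin d × Fin d → i.VR))

/-- `‖J‖` of (1.89) on each kind of real field. [folklore] -/
noncomputable def l2NormR : i.LocR → ℝ
  | .inl J => l2R J
  | .inr (.inl J) => l2TR J
  | .inr (.inr J) => l2TR J

/-- `0 ≤ ‖J‖`. [folklore] -/
theorem l2NormR_nonneg (J : i.LocR) : 0 ≤ i.l2NormR J := by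
  rcases J with J | J | J <;> exact Real.sqrt_nonneg _

/-- The six quantities of (1.89) for the REAL `G = GR n M a` (`B5RealFields`, the real matrix of the typed Δ_a⁻¹),
each read on the kind of field it is printed for and `0` on the other kinds. [cite: Balaban1984PropagatorsI, (1.89) p.33] -/
noncomputable def l2opR (a : ℝ) : Fin 6 → i.LocR → ℝ
  | ⟨0, _⟩, .inl J => l2R (GR i.n i.M a *ᵥ J)
  | ⟨1, _⟩, .inl J => l2TR (gradR i.n i.M (GR i.n i.M a *ᵥ J))
  | ⟨2, _⟩, .inr (.inl J) => l2R (GR i.n i.M a *ᵥ divTR i.n i.M J)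
  | ⟨3, _⟩, .inr (.inl J) => l2TR (gradR i.n i.M (GR i.n i.M a *ᵥ divTR i.n i.M J))
  | ⟨4, _⟩, .inl J => l2TR (grad2R i.n i.M (GR i.n i.M a *ᵥ J))
  | ⟨5, _⟩, .inr (.inr J) => l2R (GR i.n i.M a *ᵥ divT2R i.n i.M J)
  | _, _ => 0

/-- `⟨A, Δ_a A⟩` of (1.90) for a real field (`DeltaAR`). [cite: Balaban1984PropagatorsI, (1.90) p.33] -/
noncomputable def formΔaR (a : ℝ) (A : i.VR) : ℝ := A ⬝ᵥ (DeltaAR i.n i.M a *ᵥ A)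

/-- `⟨A, (Δ + I) A⟩` of (1.90) for a real field (`LapR`). [cite: Balaban1984PropagatorsI, (1.90) p.33] -/
noncomputable def formΔIR (A : i.VR) : ℝ := A ⬝ᵥ ((LapR i.n i.M + 1) *ᵥ A)

end LatIdx

variable {d : ℕ}

/-- **The REAL lattice carriers of leaf `b5`**: as `famOfLattice`, with real fields (p. 18) and the real operators of
`…B5RealFields`; the Prop.-1.2 ∕ (1.67) fields are `rest i`. [cite: Balaban1984PropagatorsI, p.18, Prop. 1.1 p.33] -/
noncomputable def famOfLatticeR (a : ℝ) (rest : ∀ i : LatIdx d, Rest i.LocR) (i : LatIdx d) : B5.Setting where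
  Site := (rest i).Site
  dist := (rest i).dist
  k := (rest i).k
  Loc := i.LocR
  suppIn := (rest i).suppIn
  supNorm := (rest i).supNorm
  l2Norm := i.l2NormR
  holder := (rest i).holder
  Cut := (rest i).Cut
  cutIn := (rest i).cutIn
  cutH := (rest i).cutH
  cutSup := (rest i).cutSup
  l2op := i.l2opR a
  e := (rest i).e
  h1 := (rest i).h1
  e4 := (rest i).e4
  h2 := (rest i).h2
  l2loc := (rest i).l2loc
  Vec := i.VR
  formΔa := i.formΔaR a
  formΔI := i.formΔIR

/-- **Proposition 1.1 BY NAME for the REAL lattice carriers**: `B5.Prop11Printed (famOfLatticeR a rest)` with the same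
`γ₀ = gammaZero d a` — assembled from `B5RealFields.ineq189R_*` and `B5RealFields.ineq190R_form`.
[cite: Balaban1984PropagatorsI, Prop. 1.1 (1.89)–(1.90) p.33 (kernel version for the real typed operators of …B5RealFields; constant and proof the package's)] -/
theorem prop11Printed_famOfLatticeR (a : ℝ) (ha : 0 < a) (rest : ∀ i : LatIdx d, Rest i.LocR) :
    B5.Prop11Printed (famOfLatticeR a rest) := by
  refine ⟨gammaZero d a, gammaZero_pos d a, fun i => ⟨?_, ?_⟩⟩
  · intro k J
    have h0 : (0 : ℝ) ≤ (gammaZero d a)⁻¹ * i.l2NormR J :=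
      mul_nonneg (inv_nonneg.mpr (gammaZero_pos d a).le) (i.l2NormR_nonneg J)
    match k, J with
    | ⟨0, _⟩, .inl J => exact ineq189R_G i.n i.hn i.M a ha J
    | ⟨1, _⟩, .inl J => exact ineq189R_gradG i.n i.hn i.M a ha J
    | ⟨2, _⟩, .inr (.inl J) => exact ineq189R_GdivT i.n i.hn i.M a ha J
    | ⟨3, _⟩, .inr (.inl J) => exact ineq189R_gradGdivT i.n i.hn i.M a ha J
    | ⟨4, _⟩, .inl J => exact ineq189R_grad2G i.n i.hn i.M a ha J
    | ⟨5, _⟩, .inr (.inr J) => exact ineq189R_GdivT2 i.n i.hn i.M a ha J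
    | ⟨0, _⟩, .inr _ => exact h0
    | ⟨1, _⟩, .inr _ => exact h0
    | ⟨2, _⟩, .inl _ => exact h0
    | ⟨2, _⟩, .inr (.inr _) => exact h0
    | ⟨3, _⟩, .inl _ => exact h0
    | ⟨3, _⟩, .inr (.inr _) => exact h0
    | ⟨4, _⟩, .inr _ => exact h0
    | ⟨5, _⟩, .inl _ => exact h0
    | ⟨5, _⟩, .inr (.inl _) => exact h0
  · intro A
    change gammaZero d a * i.formΔIR A ≤ i.formΔaR a A
    exact ineq190R_form i.n i.hn i.M a ha A

/-- Leaf `b5` for the REAL lattice carriers reduced to its two QUOTED conjuncts. [cite: Balaban1984PropagatorsI, Prop. 1.2 (1.110)–(1.114) pp.35–36, (1.67) p.29] -/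
theorem mainBlock_latticeR_iff (a : ℝ) (ha : 0 < a) (rest : ∀ i : LatIdx d, Rest i.LocR)
    (forms : LatIdx d → B5.FormData) :
    B5.MainBlock (famOfLatticeR a rest) forms ↔ B5.Prop12Printed (famOfLatticeR a rest) ∧ B5.Bounds167 forms :=
  ⟨fun h => h.2, fun h => ⟨prop11Printed_famOfLatticeR a ha rest, h⟩⟩

/-- Binding carriers whose B5 data are the REAL lattice carriers. [folklore] -/
noncomputable def _root_.Literature.MathematicalPhysics.QuantumFieldTheory.Balaban1983to89.DagBinding.PrintedCarriersR.withLatticeB5R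
    (X : PrintedCarriersR) (d : ℕ) (a : ℝ) (rest : ∀ i : LatIdx d, Rest i.LocR) (forms : LatIdx d → B5.FormData) :
    PrintedCarriersR :=
  { X with I5 := LatIdx d, fam5 := famOfLatticeR a rest, forms5 := forms }

/-- Leaf `b5` of the current P-binding, for carriers with REAL lattice B5 data, is EQUIVALENT to Prop. 1.2 ∧ (1.67).
[cite: Balaban1984PropagatorsI, Props. 1.1–1.2 pp.33–36, (1.67) p.29] -/
theorem ofPrintedAllXP_withLatticeB5R_b5_iff (X : PrintedCarriersR) (Y : PrintedCarriers9X) (Z : PrintedCarriers11)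
    (V : PrintedCarriers14R) (W : PrintedCarriers15) (d : ℕ) (a : ℝ) (ha : 0 < a)
    (rest : ∀ i : LatIdx d, Rest i.LocR) (forms : LatIdx d → B5.FormData) :
    (Upstream.ofPrintedAllXP (X.withLatticeB5R d a rest forms) Y Z V W).b5 ↔
      B5.Prop12Printed (famOfLatticeR a rest) ∧ B5.Bounds167 forms := by
  rw [ofPrintedAllXP_b5_eq]
  exact mainBlock_latticeR_iff a ha rest forms

/-- The two quoted statements give the `b5` field for carriers with REAL lattice B5 data. [cite: Balaban1984PropagatorsI, Prop. 1.2 pp.35–36, (1.67) p.29] -/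
theorem ofPrintedAllXP_withLatticeB5R_b5_of_quoted (X : PrintedCarriersR) (Y : PrintedCarriers9X)
    (Z : PrintedCarriers11) (V : PrintedCarriers14R) (W : PrintedCarriers15) (d : ℕ) (a : ℝ) (ha : 0 < a)
    (rest : ∀ i : LatIdx d, Rest i.LocR) (forms : LatIdx d → B5.FormData)
    (h12 : B5.Prop12Printed (famOfLatticeR a rest)) (h167 : B5.Bounds167 forms) :
    (Upstream.ofPrintedAllXP (X.withLatticeB5R d a rest forms) Y Z V W).b5 :=
  (ofPrintedAllXP_withLatticeB5R_b5_iff X Y Z V W d a ha rest forms).2 ⟨h12, h167⟩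

/-- Bookkeeping (`rfl`): the other discharged leaves are untouched by the real B5 data. [folklore] -/
theorem ofPrintedAllXP_withLatticeB5R_b4_b6 (X : PrintedCarriersR) (Y : PrintedCarriers9X) (Z : PrintedCarriers11)
    (V : PrintedCarriers14R) (W : PrintedCarriers15) (d : ℕ) (a : ℝ)
    (rest : ∀ i : LatIdx d, Rest i.LocR) (forms : LatIdx d → B5.FormData) :
    (Upstream.ofPrintedAllXP (X.withLatticeB5R d a rest forms) Y Z V W).b4 = (Upstream.ofPrintedAllXP X Y Z V W).b4 ∧
    (Upstream.ofPrintedAllXP (X.withLatticeB5R d a rest forms) Y Z V W).b6 = (Upstream.ofPrintedAllXP X Y Z V W).b6 :=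
  ⟨rfl, rfl⟩

end LeafB5Real

/-! ## Leaf `b6`, Lemma 2.4 in κ-form: the κ-parameter leaf and its discharge for the concrete lattice trees (v3) -/

section LeafB6Kappa

/-- The conjuncts of `B6BlockRest` OTHER than Lemma 2.4 — Props. 2.2, 2.3, 2.5, 2.6, 2.7 and Cor. 2.8, verbatim —
the six statements of the rest block that stay QUOTED hypotheses whatever is recorded about Lemma 2.4. [cite: Balaban1984PropagatorsII, Props. 2.2–2.7, Cor. 2.8 pp.234–249] -/
def B6RestQuoted (D : B6.BlockData) : Prop :=
  B6.Prop22Printed D.geo D.Gp ∧ B6.Prop23Printed D.d D.geo D.Cinv ∧ B6.Prop25Printed D.loc ∧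
  B6.Prop26Printed D.geo D.G ∧ B6.Prop27Printed D.d D.geo D.Qinv ∧ B6.Cor28Printed D.d D.geo D.H

/-- Kernel check: the P-binding's rest block IS the printed Lemma 2.4 together with the six quoted statements. [folklore] -/
theorem b6BlockRest_iff_lemma24_and_quoted (D : B6.BlockData) :
    B6BlockRest D ↔ B6.Lemma24Printed D.d D.L D.tree ∧ B6RestQuoted D :=
  ⟨fun h => ⟨h.2.2.1, h.1, h.2.1, h.2.2.2⟩, fun h => ⟨h.2.1, h.2.2.1, h.1, h.2.2.2⟩⟩

/-- Props. 2.2, 2.3, 2.5, 2.6, 2.7, Cor. 2.8 verbatim and Lemma 2.4 with a general factor κ (`B6.Lemma24K`: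
(κ∕(12d²)) L^{−d−1} ‖B‖² ≤ L^{d−2} Σ_c |(Q₁B)(c)|² + Σ_p |(∂₁B)(p)|² under the tree gauge) — the rest block with its
Lemma-2.4 conjunct in κ-PARAMETER form (the parameter shape the cell already uses for Lemma 2.1, `B6Lemma21Param`).
[cite: Balaban1984PropagatorsII, Lemma 2.4 (2.128) p.245 (factor κ in place of the printed 1); Props. 2.2–2.7, Cor. 2.8] -/
def B6BlockRestK (D : B6.BlockData) (κ : ℝ) : Prop :=
  B6.Prop22Printed D.geo D.Gp ∧ B6.Prop23Printed D.d D.geo D.Cinv ∧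
  B6.Lemma24K D.d D.L κ D.tree ∧ B6.Prop25Printed D.loc ∧ B6.Prop26Printed D.geo D.G ∧
  B6.Prop27Printed D.d D.geo D.Qinv ∧ B6.Cor28Printed D.d D.geo D.H

/-- The `b6` leaf with Lemma 2.1 in parameter form AND Lemma 2.4 with factor κ. [cite: Balaban1984PropagatorsII, Lemma 2.1 p.234 (parameter form), Lemma 2.4 (2.128) p.245 (factor κ)] -/
def B6BlockParamK (D : B6.BlockData) (κ : ℝ) : Prop := B6Lemma21Param D ∧ B6BlockRestK D κ

/-- κ = 1 is literally the P-binding's rest block (`B6.Lemma24K … 1 … = B6.Lemma24Printed …` definitionally). [folklore] -/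
theorem b6BlockRestK_one_iff (D : B6.BlockData) : B6BlockRestK D 1 ↔ B6BlockRest D := Iff.rfl

/-- κ = 1 is literally the P-binding's `b6` leaf. [folklore] -/
theorem b6BlockParamK_one_iff (D : B6.BlockData) : B6BlockParamK D 1 ↔ B6BlockParam D := Iff.rfl

/-- Kernel check: the κ-form rest block IS Lemma 2.4_κ together with the six quoted statements. [folklore] -/
theorem b6BlockRestK_iff_lemma24K_and_quoted (D : B6.BlockData) (κ : ℝ) :
    B6BlockRestK D κ ↔ B6.Lemma24K D.d D.L κ D.tree ∧ B6RestQuoted D :=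
  ⟨fun h => ⟨h.2.2.1, h.1, h.2.1, h.2.2.2⟩, fun h => ⟨h.2.1, h.2.2.1, h.1, h.2.2.2⟩⟩

/-- Once its Lemma-2.4_κ conjunct is supplied, the κ-form rest block is EQUIVALENT to the six quoted statements. [folklore] -/
theorem b6BlockRestK_iff_quoted_of_lemma24K (D : B6.BlockData) (κ : ℝ) (h24 : B6.Lemma24K D.d D.L κ D.tree) :
    B6BlockRestK D κ ↔ B6RestQuoted D :=
  ⟨fun h => ((b6BlockRestK_iff_lemma24K_and_quoted D κ).1 h).2,
    fun h => (b6BlockRestK_iff_lemma24K_and_quoted D κ).2 ⟨h24, h⟩⟩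

/-- … and the κ-form leaf to `B6Lemma21Param ∧` the six quoted statements. [folklore] -/
theorem b6BlockParamK_iff_of_lemma24K (D : B6.BlockData) (κ : ℝ) (h24 : B6.Lemma24K D.d D.L κ D.tree) :
    B6BlockParamK D κ ↔ B6Lemma21Param D ∧ B6RestQuoted D :=
  and_congr Iff.rfl (b6BlockRestK_iff_quoted_of_lemma24K D κ h24)

/-- Monotonicity in κ (L > 0, ‖B‖² ≥ 0; `B6.lemma24K_mono`): a smaller factor is a weaker rest block. [folklore] -/
theorem b6BlockRestK_mono (D : B6.BlockData) {κ κ' : ℝ} (hL : 0 < D.L) (hκ : κ' ≤ κ)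
    (hN : ∀ j B, 0 ≤ (D.tree j).normSq B) (h : B6BlockRestK D κ) : B6BlockRestK D κ' :=
  ⟨h.1, h.2.1, B6.lemma24K_mono D.d D.L κ κ' hL hκ D.tree hN h.2.2.1, h.2.2.2⟩

/-- Weakening the Lemma-2.4 factor from the printed 1 to any κ ≤ 1 costs nothing: the P-binding's rest block implies
the κ-form rest block. [folklore] -/
theorem b6BlockRestK_of_rest (D : B6.BlockData) (κ : ℝ) (hL : 0 < D.L) (hκ : κ ≤ 1)
    (hN : ∀ j B, 0 ≤ (D.tree j).normSq B) (h : B6BlockRest D) : B6BlockRestK D κ :=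
  b6BlockRestK_mono D hL hκ hN ((b6BlockRestK_one_iff D).2 h)

/-- The P-binding's `b6` leaf implies the κ-form leaf for every κ ≤ 1. [folklore] -/
theorem b6BlockParamK_of_param (D : B6.BlockData) (κ : ℝ) (hL : 0 < D.L) (hκ : κ ≤ 1)
    (hN : ∀ j B, 0 ≤ (D.tree j).normSq B) (h : B6BlockParam D) : B6BlockParamK D κ :=
  ⟨h.1, b6BlockRestK_of_rest D κ hL hκ hN h.2⟩

/-- The κ-form leaf still delivers B6's "main technical results" (Prop. 2.6 ∧ Cor. 2.8, p. 249) for the B9 base,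
for every κ. [cite: Balaban1984PropagatorsII, p.249] -/
theorem b6BlockParamK_mainResults (D : B6.BlockData) (κ : ℝ) (h : B6BlockParamK D κ) : B6.MainResults D :=
  ⟨h.2.2.2.2.2.1, h.2.2.2.2.2.2.2⟩

/-- **The K-binding**: `Upstream.ofPrintedAllXP` with its `b6` leaf replaced by the κ-form leaf `B6BlockParamK X.D6 κ`
(via the existing one-leaf re-binder `Upstream.withB6`; no change to `…DagBinding`).  At κ = 1 its `b6` leaf is
literally the P-binding's (`ofPrintedAllXPK_one_b6_iff`). [cite: Balaban1984PropagatorsII, Lemma 2.4 (2.128) p.245 (factor κ)] -/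
def _root_.Literature.MathematicalPhysics.QuantumFieldTheory.Balaban1983to89.DagBinding.Upstream.ofPrintedAllXPK
    (X : PrintedCarriersR) (Y : PrintedCarriers9X) (Z : PrintedCarriers11) (V : PrintedCarriers14R)
    (W : PrintedCarriers15) (κ : ℝ) : Upstream :=
  (Upstream.ofPrintedAllXP X Y Z V W).withB6 (B6BlockParamK X.D6 κ)

/-- Leaves of the K-binding (`rfl`): `b6` is the κ-form leaf, every other leaf is the P-binding's. [folklore] -/
theorem ofPrintedAllXPK_leaves (X : PrintedCarriersR) (Y : PrintedCarriers9X) (Z : PrintedCarriers11)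
    (V : PrintedCarriers14R) (W : PrintedCarriers15) (κ : ℝ) :
    (Upstream.ofPrintedAllXPK X Y Z V W κ).b6 = B6BlockParamK X.D6 κ ∧
    (Upstream.ofPrintedAllXPK X Y Z V W κ).b4 = (Upstream.ofPrintedAllXP X Y Z V W).b4 ∧
    (Upstream.ofPrintedAllXPK X Y Z V W κ).b5 = (Upstream.ofPrintedAllXP X Y Z V W).b5 ∧
    (Upstream.ofPrintedAllXPK X Y Z V W κ).b7 = (Upstream.ofPrintedAllXP X Y Z V W).b7 ∧
    (Upstream.ofPrintedAllXPK X Y Z V W κ).b8 = (Upstream.ofPrintedAllXP X Y Z V W).b8 ∧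
    (Upstream.ofPrintedAllXPK X Y Z V W κ).b9 = (Upstream.ofPrintedAllXP X Y Z V W).b9 ∧
    (Upstream.ofPrintedAllXPK X Y Z V W κ).b10 = (Upstream.ofPrintedAllXP X Y Z V W).b10 ∧
    (Upstream.ofPrintedAllXPK X Y Z V W κ).b11 = (Upstream.ofPrintedAllXP X Y Z V W).b11 ∧
    (Upstream.ofPrintedAllXPK X Y Z V W κ).b12 = (Upstream.ofPrintedAllXP X Y Z V W).b12 ∧
    (Upstream.ofPrintedAllXPK X Y Z V W κ).b13 = (Upstream.ofPrintedAllXP X Y Z V W).b13 ∧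
    (Upstream.ofPrintedAllXPK X Y Z V W κ).rOperation = (Upstream.ofPrintedAllXP X Y Z V W).rOperation ∧
    (Upstream.ofPrintedAllXPK X Y Z V W κ).rBasicStep = (Upstream.ofPrintedAllXP X Y Z V W).rBasicStep :=
  ⟨rfl, rfl, rfl, rfl, rfl, rfl, rfl, rfl, rfl, rfl, rfl, rfl⟩

/-- At κ = 1 the K-binding's `b6` leaf is literally the P-binding's. [folklore] -/
theorem ofPrintedAllXPK_one_b6_iff (X : PrintedCarriersR) (Y : PrintedCarriers9X) (Z : PrintedCarriers11)
    (V : PrintedCarriers14R) (W : PrintedCarriers15) :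
    (Upstream.ofPrintedAllXPK X Y Z V W 1).b6 ↔ (Upstream.ofPrintedAllXP X Y Z V W).b6 :=
  Iff.rfl

/-- The P-binding's `b6` leaf implies the K-binding's for every κ ≤ 1. [folklore] -/
theorem ofPrintedAllXPK_b6_of_XP (X : PrintedCarriersR) (Y : PrintedCarriers9X) (Z : PrintedCarriers11)
    (V : PrintedCarriers14R) (W : PrintedCarriers15) (κ : ℝ) (hL : 0 < X.D6.L) (hκ : κ ≤ 1)
    (hN : ∀ j B, 0 ≤ (X.D6.tree j).normSq B) (h : (Upstream.ofPrintedAllXP X Y Z V W).b6) :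
    (Upstream.ofPrintedAllXPK X Y Z V W κ).b6 :=
  b6BlockParamK_of_param X.D6 κ hL hκ hN h

/-- The K-binding's `b6` leaf still delivers B6's main results (Prop. 2.6 ∧ Cor. 2.8) for the B9 base. [cite: Balaban1984PropagatorsII, p.249] -/
theorem ofPrintedAllXPK_b6_mainResults (X : PrintedCarriersR) (Y : PrintedCarriers9X) (Z : PrintedCarriers11)
    (V : PrintedCarriers14R) (W : PrintedCarriers15) (κ : ℝ) (h : (Upstream.ofPrintedAllXPK X Y Z V W κ).b6) :
    B6.MainResults X.D6 :=
  b6BlockParamK_mainResults X.D6 κ h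

open B6Lemma24Carrier (carrier q1Of)
open B6LayerPoincare (kappa0)
open B6LayerPoincarePair (kappa1)
open B6Lemma24Kappa (LayerIneq)

/-- Block data whose Lemma-2.4 carriers are the CONCRETE LATTICE TREES of the pv09 lineage (`…B6Lemma24Carrier`):
blocks of side `L` in Z^d (d = `D.d`), regions Λ = B(Λ′ j) for finite Λ′ j ⊂ LZ^d, configurations on the bonds of Z^d
vanishing outside Λ, the tree gauge (2.121), ‖B‖², Σ_p |∂₁B|² and the block averages Q₁ of (2.125) as typed there;
every other field of `D` unchanged (so `B6Lemma21Param`, `B6RestQuoted` of `latticeTrees D L Λ′` are those of `D`,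
definitionally). [cite: Balaban1984PropagatorsII, (2.121)–(2.128) pp.244–245] -/
noncomputable def latticeTrees (D : B6.BlockData) {J : Type} (L : ℕ) (Λ' : J → Finset (Fin D.d → ℤ)) :
    B6.BlockData :=
  { D with L := (L : ℝ), J := J, tree := fun j => carrier L (Λ' j) (q1Of L (Λ' j)) }

/-- Bookkeeping (`Iff.rfl`): the Lemma-2.1 parameter conjunct of `latticeTrees D L Λ′` is that of `D`. [folklore] -/
theorem b6Lemma21Param_latticeTrees_iff (D : B6.BlockData) {J : Type} (L : ℕ) (Λ' : J → Finset (Fin D.d → ℤ)) :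
    B6Lemma21Param (latticeTrees D L Λ') ↔ B6Lemma21Param D := Iff.rfl

/-- Bookkeeping (`Iff.rfl`): the six quoted statements of `latticeTrees D L Λ′` are those of `D`. [folklore] -/
theorem b6RestQuoted_latticeTrees_iff (D : B6.BlockData) {J : Type} (L : ℕ) (Λ' : J → Finset (Fin D.d → ℤ)) :
    B6RestQuoted (latticeTrees D L Λ') ↔ B6RestQuoted D := Iff.rfl

/-- **DISCHARGE, general layer constant** (pv09-g4 `B6Lemma24Kappa.lemma24K_K`): for every κ ∈ [0, 1] satisfying the
layer inequality `LayerIneq d L κ` (the repaired form of the p. 245 layer sentence, constant free), the Lemma-2.4_κ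
conjunct holds for the concrete lattice trees (d ≥ 2, L ≥ 1, Λ′ j ⊂ LZ^d).  Every such κ is ≤ 12∕(L+1)
(for L ≥ 2 by `B6LayerUpperBound.layerIneq_le`, in the import cone since v5; at L = 1 trivially, from κ ≤ 1). [cite: Balaban1984PropagatorsII, Lemma 2.4 (2.128) p.245 (kernel version for the typed carriers of …B6Lemma24Carrier, factor κ; constant and proof the package's)] -/
theorem lemma24K_latticeTrees_K (D : B6.BlockData) {J : Type} (L : ℕ) (hd : 2 ≤ D.d) (hL : 1 ≤ L) {κ : ℝ}
    (hκ0 : 0 ≤ κ) (hκ1 : κ ≤ 1) (hlayer : LayerIneq D.d L κ)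
    (Λ' : J → Finset (Fin D.d → ℤ)) (hΛ : ∀ j, ∀ y ∈ Λ' j, ∀ i, (L : ℤ) ∣ y i) :
    B6.Lemma24K (latticeTrees D L Λ').d (latticeTrees D L Λ').L κ (latticeTrees D L Λ').tree :=
  B6Lemma24Kappa.lemma24K_K hd hL hκ0 hκ1 hlayer Λ' hΛ

/-- **DISCHARGE with κ₁(d, L) = 2∕(2 + (d−1)(L−1))** — the constant the printed method yields once its layer step is
done at the sharp order 1∕L (pv09-g4 `B6Lemma24Kappa.lemma24K_kappa1`; the instance named in the lineage's
request). [cite: Balaban1984PropagatorsII, Lemma 2.4 (2.128) p.245 (kernel version for the typed carriers of …B6Lemma24Carrier, factor κ₁(d,L); constant and proof the package's)] -/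
theorem lemma24K_latticeTrees_kappa1 (D : B6.BlockData) {J : Type} (L : ℕ) (hd : 2 ≤ D.d) (hL : 1 ≤ L)
    (Λ' : J → Finset (Fin D.d → ℤ)) (hΛ : ∀ j, ∀ y ∈ Λ' j, ∀ i, (L : ℤ) ∣ y i) :
    B6.Lemma24K (latticeTrees D L Λ').d (latticeTrees D L Λ').L (kappa1 D.d L) (latticeTrees D L Λ').tree :=
  B6Lemma24Kappa.lemma24K_kappa1 hd hL Λ' hΛ

/-- DISCHARGE with κ₀(d, L) of `…B6LayerPoincare` (pv09-g4 `B6Lemma24Assembly.lemma24K`, the first landed instance;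
κ₀ ≤ κ₁ by arithmetic — no declaration —, kept for the record). [cite: Balaban1984PropagatorsII, Lemma 2.4 (2.128) p.245 (kernel version for the typed carriers of …B6Lemma24Carrier, factor κ₀(d,L); constant and proof the package's)] -/
theorem lemma24K_latticeTrees_kappa0 (D : B6.BlockData) {J : Type} (L : ℕ) (hd : 2 ≤ D.d) (hL : 1 ≤ L)
    (Λ' : J → Finset (Fin D.d → ℤ)) (hΛ : ∀ j, ∀ y ∈ Λ' j, ∀ i, (L : ℤ) ∣ y i) :
    B6.Lemma24K (latticeTrees D L Λ').d (latticeTrees D L Λ').L (kappa0 D.d L) (latticeTrees D L Λ').tree :=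
  B6Lemma24Assembly.lemma24K hd hL Λ' hΛ

/-- **Leaf `b6`, κ₁-form, for the concrete lattice trees, reduced to its QUOTED statements**: the κ₁-form rest block
is EQUIVALENT to Props. 2.2, 2.3, 2.5, 2.6, 2.7 ∧ Cor. 2.8 alone — the Lemma-2.4 conjunct is a theorem of the package.
[cite: Balaban1984PropagatorsII, Props. 2.2–2.7, Cor. 2.8 pp.234–249 (quoted); Lemma 2.4 (2.128) p.245 (factor κ₁, proved)] -/
theorem b6BlockRestK_latticeTrees_iff (D : B6.BlockData) {J : Type} (L : ℕ) (hd : 2 ≤ D.d) (hL : 1 ≤ L)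
    (Λ' : J → Finset (Fin D.d → ℤ)) (hΛ : ∀ j, ∀ y ∈ Λ' j, ∀ i, (L : ℤ) ∣ y i) :
    B6BlockRestK (latticeTrees D L Λ') (kappa1 D.d L) ↔ B6RestQuoted D :=
  b6BlockRestK_iff_quoted_of_lemma24K (latticeTrees D L Λ') (kappa1 D.d L)
    (lemma24K_latticeTrees_kappa1 D L hd hL Λ' hΛ)

/-- The same at any admissible layer constant κ ∈ [0, 1]. [cite: Balaban1984PropagatorsII, Props. 2.2–2.7, Cor. 2.8 (quoted); Lemma 2.4 (2.128) p.245 (factor κ, proved under LayerIneq)] -/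
theorem b6BlockRestK_latticeTrees_iff_K (D : B6.BlockData) {J : Type} (L : ℕ) (hd : 2 ≤ D.d) (hL : 1 ≤ L)
    {κ : ℝ} (hκ0 : 0 ≤ κ) (hκ1 : κ ≤ 1) (hlayer : LayerIneq D.d L κ)
    (Λ' : J → Finset (Fin D.d → ℤ)) (hΛ : ∀ j, ∀ y ∈ Λ' j, ∀ i, (L : ℤ) ∣ y i) :
    B6BlockRestK (latticeTrees D L Λ') κ ↔ B6RestQuoted D :=
  b6BlockRestK_iff_quoted_of_lemma24K (latticeTrees D L Λ') κ
    (lemma24K_latticeTrees_K D L hd hL hκ0 hκ1 hlayer Λ' hΛ)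

/-- **The κ₁-form `b6` leaf for the concrete lattice trees is EQUIVALENT to `B6Lemma21Param D ∧` the six quoted
statements** (Lemma 2.1 in parameter form and Props. 2.2, 2.3, 2.5, 2.6, 2.7, Cor. 2.8 stay hypotheses; Lemma 2.4_{κ₁}
is proved). [cite: Balaban1984PropagatorsII, Lemma 2.1 p.234 (parameter form), Props. 2.2–2.7, Cor. 2.8 (quoted); Lemma 2.4 (2.128) p.245 (factor κ₁, proved)] -/
theorem b6BlockParamK_latticeTrees_iff (D : B6.BlockData) {J : Type} (L : ℕ) (hd : 2 ≤ D.d) (hL : 1 ≤ L)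
    (Λ' : J → Finset (Fin D.d → ℤ)) (hΛ : ∀ j, ∀ y ∈ Λ' j, ∀ i, (L : ℤ) ∣ y i) :
    B6BlockParamK (latticeTrees D L Λ') (kappa1 D.d L) ↔ B6Lemma21Param D ∧ B6RestQuoted D :=
  b6BlockParamK_iff_of_lemma24K (latticeTrees D L Λ') (kappa1 D.d L) (lemma24K_latticeTrees_kappa1 D L hd hL Λ' hΛ)

/-- The quoted statements give the κ₁-form `b6` leaf for the concrete lattice trees. [cite: Balaban1984PropagatorsII, Lemma 2.1 p.234 (parameter form), Props. 2.2–2.7, Cor. 2.8 (quoted)] -/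
theorem b6BlockParamK_latticeTrees_of_quoted (D : B6.BlockData) {J : Type} (L : ℕ) (hd : 2 ≤ D.d) (hL : 1 ≤ L)
    (Λ' : J → Finset (Fin D.d → ℤ)) (hΛ : ∀ j, ∀ y ∈ Λ' j, ∀ i, (L : ℤ) ∣ y i)
    (h21 : B6Lemma21Param D) (hq : B6RestQuoted D) : B6BlockParamK (latticeTrees D L Λ') (kappa1 D.d L) :=
  (b6BlockParamK_latticeTrees_iff D L hd hL Λ' hΛ).2 ⟨h21, hq⟩

/-- Binding carriers whose B6 tree-gauge data are the concrete lattice trees (every other carrier unchanged). [folklore] -/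
noncomputable def _root_.Literature.MathematicalPhysics.QuantumFieldTheory.Balaban1983to89.DagBinding.PrintedCarriersR.withLatticeTrees
    (X : PrintedCarriersR) {J : Type} (L : ℕ) (Λ' : J → Finset (Fin X.D6.d → ℤ)) : PrintedCarriersR :=
  { X with D6 := latticeTrees X.D6 L Λ' }

/-- **Leaf `b6` of the K-binding at κ = κ₁(d, L), for carriers with concrete lattice trees, is EQUIVALENT to
`B6Lemma21Param ∧` Props. 2.2, 2.3, 2.5, 2.6, 2.7 ∧ Cor. 2.8** — Lemma 2.4_{κ₁} needs no quotation. [cite: Balaban1984PropagatorsII, Lemma 2.1 p.234 (parameter form), Props. 2.2–2.7, Cor. 2.8 (quoted); Lemma 2.4 (2.128) p.245 (factor κ₁, proved)] -/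
theorem ofPrintedAllXPK_withLatticeTrees_b6_iff (X : PrintedCarriersR) (Y : PrintedCarriers9X)
    (Z : PrintedCarriers11) (V : PrintedCarriers14R) (W : PrintedCarriers15) {J : Type} (L : ℕ)
    (hd : 2 ≤ X.D6.d) (hL : 1 ≤ L) (Λ' : J → Finset (Fin X.D6.d → ℤ))
    (hΛ : ∀ j, ∀ y ∈ Λ' j, ∀ i, (L : ℤ) ∣ y i) :
    (Upstream.ofPrintedAllXPK (X.withLatticeTrees L Λ') Y Z V W (kappa1 X.D6.d L)).b6 ↔
      B6Lemma21Param X.D6 ∧ B6RestQuoted X.D6 :=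
  b6BlockParamK_latticeTrees_iff X.D6 L hd hL Λ' hΛ

/-- The quoted statements give that leaf. [cite: Balaban1984PropagatorsII, Lemma 2.1 p.234 (parameter form), Props. 2.2–2.7, Cor. 2.8 (quoted)] -/
theorem ofPrintedAllXPK_withLatticeTrees_b6_of_quoted (X : PrintedCarriersR) (Y : PrintedCarriers9X)
    (Z : PrintedCarriers11) (V : PrintedCarriers14R) (W : PrintedCarriers15) {J : Type} (L : ℕ)
    (hd : 2 ≤ X.D6.d) (hL : 1 ≤ L) (Λ' : J → Finset (Fin X.D6.d → ℤ))
    (hΛ : ∀ j, ∀ y ∈ Λ' j, ∀ i, (L : ℤ) ∣ y i) (h21 : B6Lemma21Param X.D6) (hq : B6RestQuoted X.D6) :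
    (Upstream.ofPrintedAllXPK (X.withLatticeTrees L Λ') Y Z V W (kappa1 X.D6.d L)).b6 :=
  (ofPrintedAllXPK_withLatticeTrees_b6_iff X Y Z V W L hd hL Λ' hΛ).2 ⟨h21, hq⟩

/-- Hence B6's main results (Prop. 2.6 ∧ Cor. 2.8) for these carriers from the quoted statements alone (they are two
of them — bookkeeping, recorded for the B9 base). [cite: Balaban1984PropagatorsII, p.249] -/
theorem mainResults_withLatticeTrees_of_quoted (X : PrintedCarriersR) {J : Type} (L : ℕ)
    (Λ' : J → Finset (Fin X.D6.d → ℤ)) (hq : B6RestQuoted X.D6) : B6.MainResults (X.withLatticeTrees L Λ').D6 :=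
  ⟨hq.2.2.2.1, hq.2.2.2.2.2⟩

/-- Bookkeeping (`rfl`): the other discharged leaves are untouched by the lattice-tree data and by κ. [folklore] -/
theorem ofPrintedAllXPK_withLatticeTrees_b4_b5 (X : PrintedCarriersR) (Y : PrintedCarriers9X)
    (Z : PrintedCarriers11) (V : PrintedCarriers14R) (W : PrintedCarriers15) {J : Type} (L : ℕ)
    (Λ' : J → Finset (Fin X.D6.d → ℤ)) (κ : ℝ) :
    (Upstream.ofPrintedAllXPK (X.withLatticeTrees L Λ') Y Z V W κ).b4 = (Upstream.ofPrintedAllXP X Y Z V W).b4 ∧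
    (Upstream.ofPrintedAllXPK (X.withLatticeTrees L Λ') Y Z V W κ).b5 = (Upstream.ofPrintedAllXP X Y Z V W).b5 :=
  ⟨rfl, rfl⟩

end LeafB6Kappa

/-! ## Leaf `b5`, the bounds (1.67): the third conjunct for the unit-torus form carriers (v4) -/

section LeafB5Forms

open B5Bounds167Lattice

variable {d : ℕ}

/-- The (1.64)–(1.67) FORM DATA of the lattice family: at index `i = (n, M)` (`n = L^k ≥ 1`, torus periods `M`) the
unit torus `T₁ = Π_μ ℤ/M_μ`, complex vector fields `B : Tor M × Fin d → ℂ`, `formΔk` := ⟨B, Δ_kB⟩ AS GIVEN BY THE THIRD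
EXPRESSION OF (1.66) (torus sum with the unitary DFT for `(2π)^{−d}∫dp′`), `d1Sq` := ⟨∂₁B, ∂₁B⟩ — the pv15 lineage's
`B5Bounds167Lattice.formOfLattice i.n i.M` (cell surge node T02.1, SHARPEN pass 29).  The identity (1.65) = (1.66) is NOT
certified there (its module header, «What is NOT claimed» (1)); see the reading note in this file's header.
[cite: Balaban1984PropagatorsI, (1.64)–(1.67) p.29 (packaging the pv15 lineage's)] -/
noncomputable def formsOfLattice (i : LatIdx d) : B5.FormData := formOfLattice i.n i.M

/-- The same form data for REAL vector fields `B : Tor M × Fin d → ℝ` (the fields of the paper are real), through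
`ℝ ⊂ ℂ`: `B5Bounds167Lattice.formOfLatticeR i.n i.M`. [cite: Balaban1984PropagatorsI, (1.64)–(1.67) p.29 (packaging the pv15 lineage's)] -/
noncomputable def formsOfLatticeR (i : LatIdx d) : B5.FormData := formOfLatticeR i.n i.M

/-- `formsOfLattice i` is literally `formOfLattice i.n i.M` (`rfl`). [folklore] -/
theorem formsOfLattice_eq (i : LatIdx d) : formsOfLattice i = formOfLattice i.n i.M := rfl

/-- `formsOfLatticeR i` is literally `formOfLatticeR i.n i.M` (`rfl`). [folklore] -/
theorem formsOfLatticeR_eq (i : LatIdx d) : formsOfLatticeR i = formOfLatticeR i.n i.M := rfl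

/-- **The (1.67) conjunct DISCHARGED BY NAME for the unit-torus form carriers**: `B5.Bounds167 formsOfLattice`, i.e.
ONE pair `γ₀ = (4/π²)^(d+2)`, `γ₁ = (π²/4)^(2d+4)` (depending on `d` only; the package's, the print gives none) with
`γ₀⟨∂₁B,∂₁B⟩ ≤ ⟨B,Δ_kB⟩ ≤ γ₁⟨∂₁B,∂₁B⟩` for every index `(n, M)` and every field `B` — the pv15 lineage's
`B5Bounds167Lattice.bounds167_formOfLattice`, by name, at the index type `LatIdx d`.
[cite: Balaban1984PropagatorsI, (1.67) p.29] -/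
theorem bounds167_formsOfLattice : B5.Bounds167 (formsOfLattice (d := d)) :=
  bounds167_formOfLattice (I := LatIdx d) (fun i => i.n) (fun i => i.hn) (fun i => i.M)

/-- The same for the real form carriers (`bounds167_formOfLatticeR`, same constants). [cite: Balaban1984PropagatorsI, (1.67) p.29] -/
theorem bounds167_formsOfLatticeR : B5.Bounds167 (formsOfLatticeR (d := d)) :=
  bounds167_formOfLatticeR (I := LatIdx d) (fun i => i.n) (fun i => i.hn) (fun i => i.M)

/-- **Leaf `b5` for the complex lattice carriers WITH the unit-torus forms reduces to Prop. 1.2 alone**: Prop. 1.1 is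
`prop11Printed_famOfLattice` (v2), (1.67) is `bounds167_formsOfLattice`; Prop. 1.2 stays QUOTED — nothing is claimed
about it. [cite: Balaban1984PropagatorsI, Prop. 1.2 (1.110)–(1.114) pp.35–36] -/
theorem mainBlock_latticeForms_iff (a : ℝ) (ha : 0 < a) (rest : ∀ i : LatIdx d, Rest i.Loc) :
    B5.MainBlock (famOfLattice a rest) formsOfLattice ↔ B5.Prop12Printed (famOfLattice a rest) := by
  rw [mainBlock_lattice_iff a ha rest formsOfLattice]
  exact ⟨fun h => h.1, fun h => ⟨h, bounds167_formsOfLattice⟩⟩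

/-- The real twin: leaf `b5` for the REAL lattice carriers (v2.1, printed p. 18 real fields) with the REAL unit-torus
forms reduces to Prop. 1.2 alone. [cite: Balaban1984PropagatorsI, Prop. 1.2 (1.110)–(1.114) pp.35–36] -/
theorem mainBlock_latticeFormsR_iff (a : ℝ) (ha : 0 < a) (rest : ∀ i : LatIdx d, Rest i.LocR) :
    B5.MainBlock (famOfLatticeR a rest) formsOfLatticeR ↔ B5.Prop12Printed (famOfLatticeR a rest) := by
  rw [mainBlock_latticeR_iff a ha rest formsOfLatticeR]
  exact ⟨fun h => h.1, fun h => ⟨h, bounds167_formsOfLatticeR⟩⟩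

/-- Binding carriers whose B5 data are the complex lattice carriers AND the unit-torus forms (`withLatticeB5` with
`forms := formsOfLattice`); every other field of `X` unchanged. [folklore] -/
noncomputable def _root_.Literature.MathematicalPhysics.QuantumFieldTheory.Balaban1983to89.DagBinding.PrintedCarriersR.withLatticeB5Forms
    (X : PrintedCarriersR) (d : ℕ) (a : ℝ) (rest : ∀ i : LatIdx d, Rest i.Loc) : PrintedCarriersR :=
  X.withLatticeB5 d a rest formsOfLattice

/-- The real twin of `withLatticeB5Forms` (`withLatticeB5R` with `forms := formsOfLatticeR`). [folklore] -/
noncomputable def _root_.Literature.MathematicalPhysics.QuantumFieldTheory.Balaban1983to89.DagBinding.PrintedCarriersR.withLatticeB5RForms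
    (X : PrintedCarriersR) (d : ℕ) (a : ℝ) (rest : ∀ i : LatIdx d, Rest i.LocR) : PrintedCarriersR :=
  X.withLatticeB5R d a rest formsOfLatticeR

/-- **Leaf `b5` of the current P-binding, for carriers with complex lattice B5 data and the unit-torus forms, is
EQUIVALENT to Prop. 1.2** (two of its three conjuncts being theorems of the package for these carriers).
[cite: Balaban1984PropagatorsI, Props. 1.1–1.2 pp.33–36, (1.67) p.29] -/
theorem ofPrintedAllXP_withLatticeB5Forms_b5_iff (X : PrintedCarriersR) (Y : PrintedCarriers9X) (Z : PrintedCarriers11)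
    (V : PrintedCarriers14R) (W : PrintedCarriers15) (d : ℕ) (a : ℝ) (ha : 0 < a)
    (rest : ∀ i : LatIdx d, Rest i.Loc) :
    (Upstream.ofPrintedAllXP (X.withLatticeB5Forms d a rest) Y Z V W).b5 ↔ B5.Prop12Printed (famOfLattice a rest) := by
  rw [PrintedCarriersR.withLatticeB5Forms, ofPrintedAllXP_withLatticeB5_b5_iff X Y Z V W d a ha rest formsOfLattice]
  exact ⟨fun h => h.1, fun h => ⟨h, bounds167_formsOfLattice⟩⟩

/-- The real twin of `ofPrintedAllXP_withLatticeB5Forms_b5_iff`. [cite: Balaban1984PropagatorsI, Props. 1.1–1.2 pp.33–36, (1.67) p.29] -/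
theorem ofPrintedAllXP_withLatticeB5RForms_b5_iff (X : PrintedCarriersR) (Y : PrintedCarriers9X) (Z : PrintedCarriers11)
    (V : PrintedCarriers14R) (W : PrintedCarriers15) (d : ℕ) (a : ℝ) (ha : 0 < a)
    (rest : ∀ i : LatIdx d, Rest i.LocR) :
    (Upstream.ofPrintedAllXP (X.withLatticeB5RForms d a rest) Y Z V W).b5 ↔ B5.Prop12Printed (famOfLatticeR a rest) := by
  rw [PrintedCarriersR.withLatticeB5RForms, ofPrintedAllXP_withLatticeB5R_b5_iff X Y Z V W d a ha rest formsOfLatticeR]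
  exact ⟨fun h => h.1, fun h => ⟨h, bounds167_formsOfLatticeR⟩⟩

/-- Prop. 1.2 (quoted) gives the `b5` field of the current P-binding for these carriers. [cite: Balaban1984PropagatorsI, Prop. 1.2 pp.35–36] -/
theorem ofPrintedAllXP_withLatticeB5Forms_b5_of_prop12 (X : PrintedCarriersR) (Y : PrintedCarriers9X)
    (Z : PrintedCarriers11) (V : PrintedCarriers14R) (W : PrintedCarriers15) (d : ℕ) (a : ℝ) (ha : 0 < a)
    (rest : ∀ i : LatIdx d, Rest i.Loc) (h12 : B5.Prop12Printed (famOfLattice a rest)) :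
    (Upstream.ofPrintedAllXP (X.withLatticeB5Forms d a rest) Y Z V W).b5 :=
  (ofPrintedAllXP_withLatticeB5Forms_b5_iff X Y Z V W d a ha rest).2 h12

/-- The real twin of `ofPrintedAllXP_withLatticeB5Forms_b5_of_prop12`. [cite: Balaban1984PropagatorsI, Prop. 1.2 pp.35–36] -/
theorem ofPrintedAllXP_withLatticeB5RForms_b5_of_prop12 (X : PrintedCarriersR) (Y : PrintedCarriers9X)
    (Z : PrintedCarriers11) (V : PrintedCarriers14R) (W : PrintedCarriers15) (d : ℕ) (a : ℝ) (ha : 0 < a)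
    (rest : ∀ i : LatIdx d, Rest i.LocR) (h12 : B5.Prop12Printed (famOfLatticeR a rest)) :
    (Upstream.ofPrintedAllXP (X.withLatticeB5RForms d a rest) Y Z V W).b5 :=
  (ofPrintedAllXP_withLatticeB5RForms_b5_iff X Y Z V W d a ha rest).2 h12

/-- The κ-form K-binding (v3) has the same `b5` field (`ofPrintedAllXPK` touches only `b6`), so the reduction to Prop. 1.2
holds there too. [cite: Balaban1984PropagatorsI, Props. 1.1–1.2 pp.33–36, (1.67) p.29] -/
theorem ofPrintedAllXPK_withLatticeB5Forms_b5_iff (X : PrintedCarriersR) (Y : PrintedCarriers9X) (Z : PrintedCarriers11)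
    (V : PrintedCarriers14R) (W : PrintedCarriers15) (κ : ℝ) (d : ℕ) (a : ℝ) (ha : 0 < a)
    (rest : ∀ i : LatIdx d, Rest i.Loc) :
    (Upstream.ofPrintedAllXPK (X.withLatticeB5Forms d a rest) Y Z V W κ).b5 ↔ B5.Prop12Printed (famOfLattice a rest) :=
  ofPrintedAllXP_withLatticeB5Forms_b5_iff X Y Z V W d a ha rest

/-- Bookkeeping (`rfl`): replacing the B5 data leaves the `b4` and `b6` fields of the P-binding unchanged (both carrier
families). [folklore] -/
theorem ofPrintedAllXP_withLatticeB5Forms_b4_b6 (X : PrintedCarriersR) (Y : PrintedCarriers9X) (Z : PrintedCarriers11)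
    (V : PrintedCarriers14R) (W : PrintedCarriers15) (d : ℕ) (a : ℝ)
    (rest : ∀ i : LatIdx d, Rest i.Loc) (restR : ∀ i : LatIdx d, Rest i.LocR) :
    ((Upstream.ofPrintedAllXP (X.withLatticeB5Forms d a rest) Y Z V W).b4 = (Upstream.ofPrintedAllXP X Y Z V W).b4 ∧
      (Upstream.ofPrintedAllXP (X.withLatticeB5Forms d a rest) Y Z V W).b6 = (Upstream.ofPrintedAllXP X Y Z V W).b6) ∧
    ((Upstream.ofPrintedAllXP (X.withLatticeB5RForms d a restR) Y Z V W).b4 = (Upstream.ofPrintedAllXP X Y Z V W).b4 ∧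
      (Upstream.ofPrintedAllXP (X.withLatticeB5RForms d a restR) Y Z V W).b6 = (Upstream.ofPrintedAllXP X Y Z V W).b6) :=
  ⟨⟨rfl, rfl⟩, ⟨rfl, rfl⟩⟩

end LeafB5Forms

/-! ## Leaf `b6`, the PRINTED Lemma 2.4 for the concrete lattice trees with blocks of side L ≤ 9 (v5) -/

section LeafB6SmallBlocks

open B6Lemma24Kappa (LayerIneq)
open B6LayerTensor (layerIneq_of_le_nine)

/-- **DISCHARGE at the printed factor, small blocks** (pv09-g4 `B6LayerTensor.layerIneq_of_le_nine` fed into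
`B6Lemma24Kappa.lemma24K_K`): for block data whose tree-gauge carriers are the concrete lattice trees with
1 ≤ L ≤ 9 (d ≥ 2, Λ′ j ⊂ LZ^d finite) the Lemma-2.4_κ conjunct holds AT κ = 1 — the printed layer sentence of p. 245
is admissible exactly for L ≤ 9 (`B6LayerTensor.layerIneq_one_iff`), so the printed route goes through there.
[cite: Balaban1984PropagatorsII, Lemma 2.4 (2.128) p.245 (kernel version for the typed carriers of …B6Lemma24Carrier, printed factor 1, blocks of side L ≤ 9; proof the package's, by the printed layer route)] -/
theorem lemma24K_latticeTrees_one_of_le_nine (D : B6.BlockData) {J : Type} (L : ℕ) (hd : 2 ≤ D.d) (hL : 1 ≤ L)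
    (hL9 : L ≤ 9) (Λ' : J → Finset (Fin D.d → ℤ)) (hΛ : ∀ j, ∀ y ∈ Λ' j, ∀ i, (L : ℤ) ∣ y i) :
    B6.Lemma24K (latticeTrees D L Λ').d (latticeTrees D L Λ').L 1 (latticeTrees D L Λ').tree :=
  lemma24K_latticeTrees_K D L hd hL zero_le_one le_rfl (layerIneq_of_le_nine hd hL9 le_rfl) Λ' hΛ

/-- **The PRINTED Lemma 2.4 (2.128), AS TYPED in the leaf (`B6.Lemma24Printed`, constant 1∕(12d²)), is a theorem of the
package for the concrete lattice trees with 1 ≤ L ≤ 9** (`B6.lemma24K_one_iff`: κ = 1 is literally the printed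
statement).  Nothing is said for L ≥ 10, where the printed layer route fails (`B6LayerRayleigh.not_layerIneq_one_of_ten_le`,
`B6.claim_p245_fails_L10`) and (2.128) with the printed constant is open (cell census G-B6-09R) — and the series
itself takes «L … an odd, positive integer > 11» ([Balaban1987RG] p. 251 (0.1), cell census S-B12.1).
(v7, dated precision: superseded for every L ≥ 1 by `lemma24Printed_latticeTrees` — section «every block size L»,
the b06 lineage's `B6Lemma24Printed.lemma24Printed_carrier`, G-B6-10U; this L ≤ 9 instance stays for the record.)
[cite: Balaban1984PropagatorsII, Lemma 2.4 (2.128) p.245 (kernel version for the typed carriers of …B6Lemma24Carrier, blocks of side L ≤ 9; proof the package's)] -/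
theorem lemma24Printed_latticeTrees_of_le_nine (D : B6.BlockData) {J : Type} (L : ℕ) (hd : 2 ≤ D.d) (hL : 1 ≤ L)
    (hL9 : L ≤ 9) (Λ' : J → Finset (Fin D.d → ℤ)) (hΛ : ∀ j, ∀ y ∈ Λ' j, ∀ i, (L : ℤ) ∣ y i) :
    B6.Lemma24Printed (latticeTrees D L Λ').d (latticeTrees D L Λ').L (latticeTrees D L Λ').tree :=
  (B6.lemma24K_one_iff _ _ _).1 (lemma24K_latticeTrees_one_of_le_nine D L hd hL hL9 Λ' hΛ)

/-- **Leaf `b6`'s rest block AS PRINTED, for the concrete lattice trees with L ≤ 9, reduced to its QUOTED statements**: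
`B6BlockRest` is EQUIVALENT to Props. 2.2, 2.3, 2.5, 2.6, 2.7 ∧ Cor. 2.8 alone — the printed Lemma-2.4 conjunct is a
theorem of the package in this regime. [cite: Balaban1984PropagatorsII, Props. 2.2–2.7, Cor. 2.8 pp.234–249 (quoted); Lemma 2.4 (2.128) p.245 (printed factor, proved for L ≤ 9)] -/
theorem b6BlockRest_latticeTrees_iff_of_le_nine (D : B6.BlockData) {J : Type} (L : ℕ) (hd : 2 ≤ D.d) (hL : 1 ≤ L)
    (hL9 : L ≤ 9) (Λ' : J → Finset (Fin D.d → ℤ)) (hΛ : ∀ j, ∀ y ∈ Λ' j, ∀ i, (L : ℤ) ∣ y i) :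
    B6BlockRest (latticeTrees D L Λ') ↔ B6RestQuoted D :=
  (b6BlockRestK_one_iff _).symm.trans
    (b6BlockRestK_latticeTrees_iff_K D L hd hL zero_le_one le_rfl (layerIneq_of_le_nine hd hL9 le_rfl) Λ' hΛ)

/-- **The P-binding's `b6` leaf (`B6BlockParam`: Lemma 2.1 in parameter form, the rest block AS PRINTED) for the concrete
lattice trees with L ≤ 9 is EQUIVALENT to `B6Lemma21Param D ∧` the six quoted statements** — no κ, no K-binding is
needed in this regime. [cite: Balaban1984PropagatorsII, Lemma 2.1 p.234 (parameter form), Props. 2.2–2.7, Cor. 2.8 (quoted); Lemma 2.4 (2.128) p.245 (printed factor, proved for L ≤ 9)] -/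
theorem b6BlockParam_latticeTrees_iff_of_le_nine (D : B6.BlockData) {J : Type} (L : ℕ) (hd : 2 ≤ D.d) (hL : 1 ≤ L)
    (hL9 : L ≤ 9) (Λ' : J → Finset (Fin D.d → ℤ)) (hΛ : ∀ j, ∀ y ∈ Λ' j, ∀ i, (L : ℤ) ∣ y i) :
    B6BlockParam (latticeTrees D L Λ') ↔ B6Lemma21Param D ∧ B6RestQuoted D :=
  (b6BlockParamK_one_iff _).symm.trans
    (b6BlockParamK_iff_of_lemma24K (latticeTrees D L Λ') 1 (lemma24K_latticeTrees_one_of_le_nine D L hd hL hL9 Λ' hΛ))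

/-- The quoted statements give the P-binding's `b6` leaf for the concrete lattice trees with L ≤ 9. [cite: Balaban1984PropagatorsII, Lemma 2.1 p.234 (parameter form), Props. 2.2–2.7, Cor. 2.8 (quoted)] -/
theorem b6BlockParam_latticeTrees_of_quoted_of_le_nine (D : B6.BlockData) {J : Type} (L : ℕ) (hd : 2 ≤ D.d)
    (hL : 1 ≤ L) (hL9 : L ≤ 9) (Λ' : J → Finset (Fin D.d → ℤ)) (hΛ : ∀ j, ∀ y ∈ Λ' j, ∀ i, (L : ℤ) ∣ y i)
    (h21 : B6Lemma21Param D) (hq : B6RestQuoted D) : B6BlockParam (latticeTrees D L Λ') :=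
  (b6BlockParam_latticeTrees_iff_of_le_nine D L hd hL hL9 Λ' hΛ).2 ⟨h21, hq⟩

/-- **Leaf `b6` of the P-binding `Upstream.ofPrintedAllXP`, for carriers with concrete lattice trees of side L ≤ 9, is
EQUIVALENT to `B6Lemma21Param ∧` Props. 2.2, 2.3, 2.5, 2.6, 2.7 ∧ Cor. 2.8** — the printed Lemma 2.4 needs no
quotation there. [cite: Balaban1984PropagatorsII, Lemma 2.1 p.234 (parameter form), Props. 2.2–2.7, Cor. 2.8 (quoted); Lemma 2.4 (2.128) p.245 (printed factor, proved for L ≤ 9)] -/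
theorem ofPrintedAllXP_withLatticeTrees_b6_iff_of_le_nine (X : PrintedCarriersR) (Y : PrintedCarriers9X)
    (Z : PrintedCarriers11) (V : PrintedCarriers14R) (W : PrintedCarriers15) {J : Type} (L : ℕ)
    (hd : 2 ≤ X.D6.d) (hL : 1 ≤ L) (hL9 : L ≤ 9) (Λ' : J → Finset (Fin X.D6.d → ℤ))
    (hΛ : ∀ j, ∀ y ∈ Λ' j, ∀ i, (L : ℤ) ∣ y i) :
    (Upstream.ofPrintedAllXP (X.withLatticeTrees L Λ') Y Z V W).b6 ↔ B6Lemma21Param X.D6 ∧ B6RestQuoted X.D6 :=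
  b6BlockParam_latticeTrees_iff_of_le_nine X.D6 L hd hL hL9 Λ' hΛ

/-- The quoted statements give that leaf. [cite: Balaban1984PropagatorsII, Lemma 2.1 p.234 (parameter form), Props. 2.2–2.7, Cor. 2.8 (quoted)] -/
theorem ofPrintedAllXP_withLatticeTrees_b6_of_quoted_of_le_nine (X : PrintedCarriersR) (Y : PrintedCarriers9X)
    (Z : PrintedCarriers11) (V : PrintedCarriers14R) (W : PrintedCarriers15) {J : Type} (L : ℕ)
    (hd : 2 ≤ X.D6.d) (hL : 1 ≤ L) (hL9 : L ≤ 9) (Λ' : J → Finset (Fin X.D6.d → ℤ))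
    (hΛ : ∀ j, ∀ y ∈ Λ' j, ∀ i, (L : ℤ) ∣ y i) (h21 : B6Lemma21Param X.D6) (hq : B6RestQuoted X.D6) :
    (Upstream.ofPrintedAllXP (X.withLatticeTrees L Λ') Y Z V W).b6 :=
  (ofPrintedAllXP_withLatticeTrees_b6_iff_of_le_nine X Y Z V W L hd hL hL9 Λ' hΛ).2 ⟨h21, hq⟩

/-- Bookkeeping (`rfl`): the other discharged leaves of the P-binding are untouched by the lattice-tree data. [folklore] -/
theorem ofPrintedAllXP_withLatticeTrees_b4_b5 (X : PrintedCarriersR) (Y : PrintedCarriers9X)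
    (Z : PrintedCarriers11) (V : PrintedCarriers14R) (W : PrintedCarriers15) {J : Type} (L : ℕ)
    (Λ' : J → Finset (Fin X.D6.d → ℤ)) :
    (Upstream.ofPrintedAllXP (X.withLatticeTrees L Λ') Y Z V W).b4 = (Upstream.ofPrintedAllXP X Y Z V W).b4 ∧
    (Upstream.ofPrintedAllXP (X.withLatticeTrees L Λ') Y Z V W).b5 = (Upstream.ofPrintedAllXP X Y Z V W).b5 :=
  ⟨rfl, rfl⟩

end LeafB6SmallBlocks

/-! ## Leaf `b10`, first conjunct, literal typing — a NEGATIVE record (v6)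

[Balaban1985UV3] Theorem 1 (p. 257 [3]) with the bounds (5) (p. 256 [2]) and p. 257 l. 1 *"and the constant O(1) is
independent of ε, k, g_k in a bounded set."* is bound in node `b10` as `B10.Thm1Printed X.runs10 ∧ B10.Thm2Printed X.runs10`
(`DagBinding.Upstream.ofPrinted`), `B10.Thm1Printed` being unit r2's typing (for every bounded coupling set (0, gmax] ONE
constant serves all runs and all k) and `B10.Thm1PrintedCompact` (B10.lean, cell GAPS G-B10-01) the cell's audit reading
(one constant per compact window [gmin, gmax] ⊂ (0, ∞)).  The b10 lineage's `…B10DagLeaf` (cell journal G-B10-01-DAGLEAF,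
cross-read REFEREE6 E86) proves, from the located leaves (62) p. 271, (64) p. 273, (1) p. 256 and three LABELLED READER'S
ITEMS carried as hypotheses, that every family of tower runs carrying `B10Assembly.LeafSystem`s with common constants and
arbitrarily small bare couplings violates `B10.Thm1Printed`, unconditionally so on its model family `B10DagLeaf.logRun`,
while `B10.Thm1PrintedCompact ∧ B10.Thm2Printed` holds (`B10Assembly.thm1Compact_and_thm2_of_leafSystem`).  This section
records those kernel facts AGAINST THE BINDING, by name, for carriers whose B10 runs are such tower runs; it rebinds
nothing (`…DagBinding` untouched) and says nothing about Bałaban's densities (module docstring, seventh bullet). -/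

section LeafB10Literal

/-- The `b10` field of the current P-binding is, by `rfl`, the literal node
`B10.Thm1Printed X.runs10 ∧ B10.Thm2Printed X.runs10` of `Upstream.ofPrinted`. [cite: Balaban1985UV3, Thm 1 p.257, Thm 2 p.272] -/
theorem ofPrintedAllXP_b10_eq (X : PrintedCarriersR) (Y : PrintedCarriers9X) (Z : PrintedCarriers11)
    (V : PrintedCarriers14R) (W : PrintedCarriers15) :
    (Upstream.ofPrintedAllXP X Y Z V W).b10 = (B10.Thm1Printed X.runs10 ∧ B10.Thm2Printed X.runs10) :=
  rfl

/-- The same for the v3 binding `Upstream.ofPrinted` over the printed carriers. [cite: Balaban1985UV3, Thm 1 p.257, Thm 2 p.272] -/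
theorem ofPrinted_b10_eq (X : PrintedCarriers) (b9 b11 rOp rBS : Prop) :
    (Upstream.ofPrinted X b9 b11 rOp rBS).b10 = (B10.Thm1Printed X.runs10 ∧ B10.Thm2Printed X.runs10) :=
  rfl

/-- **The COMPACT node** `B10.Thm1PrintedCompact X.runs10 ∧ B10.Thm2Printed X.runs10`: Theorem 1 in the cell's audit
reading (B10.lean `B10.Thm1PrintedCompact`, cell GAPS G-B10-01 — one constant per compact coupling window, which is what
[Balaban1987RG]–[Balaban1989LargeFieldII] consume) ∧ Theorem 2.  It is the exact text of the b10 lineage's suggested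
rebinding of node `b10` (cell journal 2026-08-19T01:09:18Z); DEFINED here for the record, bound nowhere. [cite: Balaban1985UV3, Thm 1 p.257, Thm 2 p.272] -/
def b10Compact (X : PrintedCarriers) : Prop :=
  B10.Thm1PrintedCompact X.runs10 ∧ B10.Thm2Printed X.runs10

/-- The literal leaf gives the compact node for any family whose couplings are positive and bounded above
(`B10.thm1Compact_of_thm1Printed`; in the paper g_k ≤ gε₀^{1/2}, p. 256). [folklore] -/
theorem b10Compact_of_b10 (X : PrintedCarriersR) (Y : PrintedCarriers9X) (Z : PrintedCarriers11)
    (V : PrintedCarriers14R) (W : PrintedCarriers15) (gtop : ℝ) (htop : 0 < gtop)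
    (hg : ∀ i k, k ≤ (X.runs10 i).K → 0 < (X.runs10 i).g k ∧ (X.runs10 i).g k ≤ gtop)
    (h : (Upstream.ofPrintedAllXP X Y Z V W).b10) : b10Compact X.toPrintedCarriers := by
  rw [ofPrintedAllXP_b10_eq] at h
  exact ⟨B10.thm1Compact_of_thm1Printed X.runs10 gtop htop hg h.1, h.2⟩

/-- Binding carriers whose B10 data ARE a family of tower runs `T : I → B10.TowerRun` (index `I`, runs
`(T i).toRunData`); every other field of `X` unchanged. [folklore] -/
noncomputable def _root_.Literature.MathematicalPhysics.QuantumFieldTheory.Balaban1983to89.DagBinding.PrintedCarriersR.withTowerRuns10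
    (X : PrintedCarriersR) {I : Type} (T : I → B10.TowerRun) : PrintedCarriersR :=
  { X with I10 := I, runs10 := fun i => (T i).toRunData }

/-- Leaf `b10` of the current P-binding for such carriers, unfolded (`Iff.rfl`). [cite: Balaban1985UV3, Thm 1 p.257, Thm 2 p.272] -/
theorem ofPrintedAllXP_withTowerRuns10_b10_iff (X : PrintedCarriersR) {I : Type} (T : I → B10.TowerRun)
    (Y : PrintedCarriers9X) (Z : PrintedCarriers11) (V : PrintedCarriers14R) (W : PrintedCarriers15) :
    (Upstream.ofPrintedAllXP (X.withTowerRuns10 T) Y Z V W).b10 ↔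
      B10.Thm1Printed (fun i => (T i).toRunData) ∧ B10.Thm2Printed (fun i => (T i).toRunData) :=
  Iff.rfl

/-- The same for the κ-form K-binding of v3 (its `b10` field is the P-binding's). [cite: Balaban1985UV3, Thm 1 p.257, Thm 2 p.272] -/
theorem ofPrintedAllXPK_withTowerRuns10_b10_iff (X : PrintedCarriersR) {I : Type} (T : I → B10.TowerRun)
    (Y : PrintedCarriers9X) (Z : PrintedCarriers11) (V : PrintedCarriers14R) (W : PrintedCarriers15) (κ : ℝ) :
    (Upstream.ofPrintedAllXPK (X.withTowerRuns10 T) Y Z V W κ).b10 ↔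
      B10.Thm1Printed (fun i => (T i).toRunData) ∧ B10.Thm2Printed (fun i => (T i).toRunData) :=
  Iff.rfl

/-- **NEGATIVE EDGE (kernel, by name)**: for carriers whose B10 runs carry leaf systems with common constants, the
labelled reader's items (R1) `UnitConfig0`, (R2) `StarLower … s₀` (s₀ > 0), (R3) `DgLower … d₀` (d₀ > 0) of
`…B10DagLeaf` §1 — HYPOTHESES, never cited facts — and runs with arbitrarily small bare coupling (`SmallBareOccur`),
leaf `b10` of the current P-binding is FALSE: `B10DagLeaf.not_dagLeaf_b10_of_leafSystems` ((62) carries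
`d(𝔤) log g_k|T₁^{(k)*}|`; k = 0 at the unit configuration through `B16B10Shape.b10_O1_lower_of_bounds5At_zero`).
A statement about the TYPING `B10.Thm1Printed`, not about Bałaban's densities. [cite: Balaban1985UV3, (62) p.271, (64) p.273, (1)+(5) p.256, Thm 1 p.257] -/
theorem not_b10_withTowerRuns10_of_leafSystems (X : PrintedCarriersR) {I : Type} {C : B10Assembly.Consts}
    (T : I → B10.TowerRun) (S : ∀ i, B10Assembly.LeafSystem C (T i)) {d₀ s₀ : ℝ} (hd : 0 < d₀) (hs : 0 < s₀)
    (hU : ∀ i, B10DagLeaf.UnitConfig0 (T i)) (hS : ∀ i, B10DagLeaf.StarLower (S i) s₀)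
    (hD : ∀ i, B10DagLeaf.DgLower (S i) d₀) (hsmall : B10DagLeaf.SmallBareOccur T)
    (Y : PrintedCarriers9X) (Z : PrintedCarriers11) (V : PrintedCarriers14R) (W : PrintedCarriers15) :
    ¬ (Upstream.ofPrintedAllXP (X.withTowerRuns10 T) Y Z V W).b10 := fun h =>
  B10DagLeaf.not_dagLeaf_b10_of_leafSystems T S hd hs hU hS hD hsmall
    ((ofPrintedAllXP_withTowerRuns10_b10_iff X T Y Z V W).1 h)

/-- The fine-lattice form (`B10DagLeaf.FineLattices S`: arbitrarily fine lattices at the family's fixed g, p. 256 —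
the continuum limit the paper is about — instead of `SmallBareOccur`). [cite: Balaban1985UV3, (62) p.271, (64) p.273, (1)+(5) p.256, Thm 1 p.257] -/
theorem not_b10_withTowerRuns10_of_fineLattices (X : PrintedCarriersR) {I : Type} {C : B10Assembly.Consts}
    (T : I → B10.TowerRun) (S : ∀ i, B10Assembly.LeafSystem C (T i)) {d₀ s₀ : ℝ} (hd : 0 < d₀) (hs : 0 < s₀)
    (hU : ∀ i, B10DagLeaf.UnitConfig0 (T i)) (hS : ∀ i, B10DagLeaf.StarLower (S i) s₀)
    (hD : ∀ i, B10DagLeaf.DgLower (S i) d₀) (hfine : B10DagLeaf.FineLattices S)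
    (Y : PrintedCarriers9X) (Z : PrintedCarriers11) (V : PrintedCarriers14R) (W : PrintedCarriers15) :
    ¬ (Upstream.ofPrintedAllXP (X.withTowerRuns10 T) Y Z V W).b10 :=
  not_b10_withTowerRuns10_of_leafSystems X T S hd hs hU hS hD (B10DagLeaf.smallBare_of_fineLattices S hfine) Y Z V W

/-- … while the COMPACT node holds for the same carriers from the leaf system ALONE (no reader's item, no smallness):
`B10Assembly.thm1Compact_and_thm2_of_leafSystem`. [cite: Balaban1985UV3, Thm 1 p.257, Thm 2 p.272, Sect. D pp.272–275] -/
theorem b10Compact_withTowerRuns10_of_leafSystems (X : PrintedCarriersR) {I : Type} {C : B10Assembly.Consts}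
    (T : I → B10.TowerRun) (S : ∀ i, B10Assembly.LeafSystem C (T i)) :
    b10Compact (X.withTowerRuns10 T).toPrintedCarriers :=
  B10Assembly.thm1Compact_and_thm2_of_leafSystem T S

/-- **THE SEPARATION AT THE BINDING, UNCONDITIONAL**: rebinding the B10 runs of ANY carriers to the model family
`B10DagLeaf.logRun` (d(𝔤) = 3, |T₁^{(k)*}| = (7∕4)|T₁^{(k)}|, E^{(k)} by (62), E_k by (64), ρ_k ≡ e^{−E_k}, ε = 2^{−K};
a leaf system for `B10DagLeaf.logConsts` at every K, couplings in (0, 1]) makes leaf `b10` FALSE, whatever the other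
carriers: `B10DagLeaf.not_thm1Printed_logRun`. [folklore] -/
theorem not_b10_withTowerRuns10_logRun (X : PrintedCarriersR) (Y : PrintedCarriers9X) (Z : PrintedCarriers11)
    (V : PrintedCarriers14R) (W : PrintedCarriers15) :
    ¬ (Upstream.ofPrintedAllXP (X.withTowerRuns10 (fun K : ℕ => B10DagLeaf.logRun K)) Y Z V W).b10 := fun h =>
  B10DagLeaf.not_thm1Printed_logRun
    ((ofPrintedAllXP_withTowerRuns10_b10_iff X (fun K : ℕ => B10DagLeaf.logRun K) Y Z V W).1 h).1

/-- … and the compact node TRUE there: `B10DagLeaf.logRun_compact_and_thm2`. [folklore] -/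
theorem b10Compact_withTowerRuns10_logRun (X : PrintedCarriersR) :
    b10Compact (X.withTowerRuns10 (fun K : ℕ => B10DagLeaf.logRun K)).toPrintedCarriers :=
  B10DagLeaf.logRun_compact_and_thm2

/-- Side by side: on the model rebinding the compact node holds and the literal leaf fails — the literal first
conjunct of node `b10` is NOT a consequence of the hypothesis bundle under which the cell derived the paper
(`B10Assembly.LeafSystem`), whereas its audit reading is (`B10DagLeaf.logRun_separation`, restated at the binding). [folklore] -/
theorem b10Compact_and_not_b10_logRun (X : PrintedCarriersR) (Y : PrintedCarriers9X) (Z : PrintedCarriers11)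
    (V : PrintedCarriers14R) (W : PrintedCarriers15) :
    b10Compact (X.withTowerRuns10 (fun K : ℕ => B10DagLeaf.logRun K)).toPrintedCarriers ∧
      ¬ (Upstream.ofPrintedAllXP (X.withTowerRuns10 (fun K : ℕ => B10DagLeaf.logRun K)) Y Z V W).b10 :=
  ⟨b10Compact_withTowerRuns10_logRun X, not_b10_withTowerRuns10_logRun X Y Z V W⟩

/-- Bookkeeping (`rfl`): replacing the B10 runs leaves every other leaf of the P-binding unchanged — stated for the
three leaves this module discharges elsewhere (`b4`, `b5`, `b6`). [folklore] -/
theorem ofPrintedAllXP_withTowerRuns10_b4_b5_b6 (X : PrintedCarriersR) {I : Type} (T : I → B10.TowerRun)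
    (Y : PrintedCarriers9X) (Z : PrintedCarriers11) (V : PrintedCarriers14R) (W : PrintedCarriers15) :
    (Upstream.ofPrintedAllXP (X.withTowerRuns10 T) Y Z V W).b4 = (Upstream.ofPrintedAllXP X Y Z V W).b4 ∧
    (Upstream.ofPrintedAllXP (X.withTowerRuns10 T) Y Z V W).b5 = (Upstream.ofPrintedAllXP X Y Z V W).b5 ∧
    (Upstream.ofPrintedAllXP (X.withTowerRuns10 T) Y Z V W).b6 = (Upstream.ofPrintedAllXP X Y Z V W).b6 :=
  ⟨rfl, rfl, rfl⟩

end LeafB10Literal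

/-! ## Leaf `b6`, the PRINTED Lemma 2.4 for the concrete lattice trees, every block size L (v7)

[Balaban1984PropagatorsII] Lemma 2.4 (2.128) p. 245 — *"L^{d−2} Σ_{c∈Λ′} |(Q₁B)(c)|² + Σ_p |(∂₁B)(p)|² ≥
(1/(12d²)) L^{−d−1} ‖B‖²"* — is bound as the conjunct `B6.Lemma24Printed D.d D.L D.tree` of `B6BlockRest` (node `b6`,
P-binding).  The b06 lineage's `…B6Lemma24Printed` (cell GAPS C-b06g8-1, cross-read C-pv27-37, verdict update G-B6-10U)
proves it WITH THE PRINTED CONSTANT for the concrete lattice carriers of `…B6Lemma24Carrier` for every d ≥ 2 and every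
L ≥ 1 (`B6Lemma24Printed.lemma24Printed_carrier`), by a route that is not the printed one (layer-restricted tree-gauge
Poincaré `layer_sq_le`, exact mean∕fluctuation split `face_split`, assembly `assembly_core_one` at the layer constant
2∕(L+1)); the printed derivation stays refuted from L = 10 on (`B6LayerTensor.layerIneq_one_iff`, G-B6-09).  This
section feeds that theorem, BY NAME, into the v3 reductions: for block data with these carriers the printed Lemma-2.4
conjunct is a theorem at every block size — in particular on the series' regime L > 11 ([Balaban1987RG] p. 251 (0.1))
— and leaf `b6` reduces to `B6Lemma21Param ∧` its six quoted statements with no κ, no layer hypothesis and no bound on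
L (module docstring, eighth bullet; the v3 ∕ v5 instances stay for the record).  Typed-carrier proviso as in the fourth
bullet; nothing is rebound (`…DagBinding` untouched). -/

section LeafB6AllBlocks

/-- **DISCHARGE at the printed constant, every block size** (b06-g8 `B6Lemma24Printed.lemma24Printed_carrier`, BY
NAME): for block data whose tree-gauge carriers are the concrete lattice trees (d ≥ 2, L ≥ 1, Λ′ j ⊂ LZ^d finite) the
PRINTED Lemma-2.4 conjunct (2.128), AS TYPED in the leaf (`B6.Lemma24Printed`, constant 1∕(12d²)), is a theorem of the
package — in particular on the series' own regime «L … an odd, positive integer > 11» ([Balaban1987RG] p. 251 (0.1)),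
where the printed DERIVATION fails at (2.127) (`B6.ineq2127_fails_L10`, `B6LayerTensor.layerIneq_one_iff`).  The b06
lineage's route — a layer-RESTRICTED tree-gauge Poincaré inequality (`B6Lemma24Printed.layer_sq_le`) and the exact
mean∕fluctuation split of the face sums of (2.124) (`B6Lemma24Printed.face_split`, the mean part being exactly the
square that (2.125) bounds) — does not use the refuted sentence.  Supersedes `lemma24Printed_latticeTrees_of_le_nine`
(v5), which stays for the record.
[cite: Balaban1984PropagatorsII, Lemma 2.4 (2.128) p.245 (kernel version for the typed carriers of …B6Lemma24Carrier, printed constant, every L ≥ 1; proof the package's — cell GAPS C-b06g8-1 ∕ G-B6-10U, cross-read C-pv27-37)] -/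
theorem lemma24Printed_latticeTrees (D : B6.BlockData) {J : Type} (L : ℕ) (hd : 2 ≤ D.d) (hL : 1 ≤ L)
    (Λ' : J → Finset (Fin D.d → ℤ)) (hΛ : ∀ j, ∀ y ∈ Λ' j, ∀ i, (L : ℤ) ∣ y i) :
    B6.Lemma24Printed (latticeTrees D L Λ').d (latticeTrees D L Λ').L (latticeTrees D L Λ').tree :=
  B6Lemma24Printed.lemma24Printed_carrier hd hL Λ' hΛ

/-- The same conjunct at κ = 1 in the κ-form `B6.Lemma24K` of v3 (`B6.lemma24K_one_iff`: κ = 1 is literally the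
printed statement; b06-g8 `B6Lemma24Printed.lemma24K_one_carrier`). [cite: Balaban1984PropagatorsII, Lemma 2.4 (2.128) p.245 (kernel version for the typed carriers of …B6Lemma24Carrier, printed factor 1, every L ≥ 1; proof the package's)] -/
theorem lemma24K_latticeTrees_one (D : B6.BlockData) {J : Type} (L : ℕ) (hd : 2 ≤ D.d) (hL : 1 ≤ L)
    (Λ' : J → Finset (Fin D.d → ℤ)) (hΛ : ∀ j, ∀ y ∈ Λ' j, ∀ i, (L : ℤ) ∣ y i) :
    B6.Lemma24K (latticeTrees D L Λ').d (latticeTrees D L Λ').L 1 (latticeTrees D L Λ').tree :=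
  B6Lemma24Printed.lemma24K_one_carrier hd hL Λ' hΛ

/-- Hence the Lemma-2.4_κ conjunct of the K-binding for EVERY κ ≤ 1, with NO layer hypothesis (b06-g8
`B6Lemma24Printed.lemma24K_carrier_of_le_one`, from the printed factor by `B6.lemma24K_mono`) — the v3 instances
κ₁(d, L), κ₀(d, L) and the `LayerIneq`-conditional `lemma24K_latticeTrees_K` become special cases and stay for the
record. [cite: Balaban1984PropagatorsII, Lemma 2.4 (2.128) p.245 (kernel version for the typed carriers of …B6Lemma24Carrier, any factor κ ≤ 1, every L ≥ 1; proof the package's)] -/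
theorem lemma24K_latticeTrees_of_le_one (D : B6.BlockData) {J : Type} (L : ℕ) (hd : 2 ≤ D.d) (hL : 1 ≤ L)
    {κ : ℝ} (hκ : κ ≤ 1) (Λ' : J → Finset (Fin D.d → ℤ)) (hΛ : ∀ j, ∀ y ∈ Λ' j, ∀ i, (L : ℤ) ∣ y i) :
    B6.Lemma24K (latticeTrees D L Λ').d (latticeTrees D L Λ').L κ (latticeTrees D L Λ').tree :=
  B6Lemma24Printed.lemma24K_carrier_of_le_one hd hL hκ Λ' hΛ

/-- **The series' own regime is covered**: for block sizes L > 11 — [Balaban1987RG] p. 251 (0.1) fixes «L … an odd,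
positive integer > 11» (cell census S-B12.1) — the printed Lemma-2.4 conjunct holds for the concrete lattice trees
(a specialisation of `lemma24Printed_latticeTrees`, recorded because v5's sixth header bullet located the then-open
estimate G-B6-09R exactly on this regime; only `1 ≤ L` is used). [cite: Balaban1984PropagatorsII, Lemma 2.4 (2.128) p.245 (kernel version for the typed carriers of …B6Lemma24Carrier, printed constant, block sizes L > 11; proof the package's)] -/
theorem lemma24Printed_latticeTrees_of_eleven_lt (D : B6.BlockData) {J : Type} (L : ℕ) (hd : 2 ≤ D.d)
    (hL11 : 11 < L) (Λ' : J → Finset (Fin D.d → ℤ)) (hΛ : ∀ j, ∀ y ∈ Λ' j, ∀ i, (L : ℤ) ∣ y i) :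
    B6.Lemma24Printed (latticeTrees D L Λ').d (latticeTrees D L Λ').L (latticeTrees D L Λ').tree :=
  lemma24Printed_latticeTrees D L hd (by omega) Λ' hΛ

/-- **Leaf `b6`'s rest block AS PRINTED, for the concrete lattice trees of ANY block size L ≥ 1, reduced to its QUOTED
statements**: `B6BlockRest` is EQUIVALENT to Props. 2.2, 2.3, 2.5, 2.6, 2.7 ∧ Cor. 2.8 alone — the printed Lemma-2.4
conjunct is a theorem of the package at every L (supersedes `b6BlockRest_latticeTrees_iff_of_le_nine`, v5, and the
κ₁-form `b6BlockRestK_latticeTrees_iff`, v3, which stay for the record). [cite: Balaban1984PropagatorsII, Props. 2.2–2.7, Cor. 2.8 pp.234–249 (quoted); Lemma 2.4 (2.128) p.245 (printed constant, proved for every L ≥ 1)] -/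
theorem b6BlockRest_latticeTrees_iff (D : B6.BlockData) {J : Type} (L : ℕ) (hd : 2 ≤ D.d) (hL : 1 ≤ L)
    (Λ' : J → Finset (Fin D.d → ℤ)) (hΛ : ∀ j, ∀ y ∈ Λ' j, ∀ i, (L : ℤ) ∣ y i) :
    B6BlockRest (latticeTrees D L Λ') ↔ B6RestQuoted D :=
  (b6BlockRestK_one_iff _).symm.trans
    (b6BlockRestK_iff_quoted_of_lemma24K (latticeTrees D L Λ') 1 (lemma24K_latticeTrees_one D L hd hL Λ' hΛ))

/-- **The P-binding's `b6` leaf (`B6BlockParam`: Lemma 2.1 in parameter form, the rest block AS PRINTED) for the concrete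
lattice trees of ANY block size L ≥ 1 is EQUIVALENT to `B6Lemma21Param D ∧` the six quoted statements** — no κ, no
K-binding and no bound on L are needed. [cite: Balaban1984PropagatorsII, Lemma 2.1 p.234 (parameter form), Props. 2.2–2.7, Cor. 2.8 (quoted); Lemma 2.4 (2.128) p.245 (printed constant, proved for every L ≥ 1)] -/
theorem b6BlockParam_latticeTrees_iff (D : B6.BlockData) {J : Type} (L : ℕ) (hd : 2 ≤ D.d) (hL : 1 ≤ L)
    (Λ' : J → Finset (Fin D.d → ℤ)) (hΛ : ∀ j, ∀ y ∈ Λ' j, ∀ i, (L : ℤ) ∣ y i) :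
    B6BlockParam (latticeTrees D L Λ') ↔ B6Lemma21Param D ∧ B6RestQuoted D :=
  (b6BlockParamK_one_iff _).symm.trans
    (b6BlockParamK_iff_of_lemma24K (latticeTrees D L Λ') 1 (lemma24K_latticeTrees_one D L hd hL Λ' hΛ))

/-- The quoted statements give the P-binding's `b6` leaf for the concrete lattice trees of any block size. [cite: Balaban1984PropagatorsII, Lemma 2.1 p.234 (parameter form), Props. 2.2–2.7, Cor. 2.8 (quoted)] -/
theorem b6BlockParam_latticeTrees_of_quoted (D : B6.BlockData) {J : Type} (L : ℕ) (hd : 2 ≤ D.d) (hL : 1 ≤ L)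
    (Λ' : J → Finset (Fin D.d → ℤ)) (hΛ : ∀ j, ∀ y ∈ Λ' j, ∀ i, (L : ℤ) ∣ y i)
    (h21 : B6Lemma21Param D) (hq : B6RestQuoted D) : B6BlockParam (latticeTrees D L Λ') :=
  (b6BlockParam_latticeTrees_iff D L hd hL Λ' hΛ).2 ⟨h21, hq⟩

/-- The κ-form leaf of v3 for the concrete lattice trees, at EVERY κ ≤ 1 and every L ≥ 1 (no layer hypothesis), is
EQUIVALENT to `B6Lemma21Param D ∧` the six quoted statements. [cite: Balaban1984PropagatorsII, Lemma 2.1 p.234 (parameter form), Props. 2.2–2.7, Cor. 2.8 (quoted); Lemma 2.4 (2.128) p.245 (any factor κ ≤ 1, proved for every L ≥ 1)] -/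
theorem b6BlockParamK_latticeTrees_iff_of_le_one (D : B6.BlockData) {J : Type} (L : ℕ) (hd : 2 ≤ D.d) (hL : 1 ≤ L)
    {κ : ℝ} (hκ : κ ≤ 1) (Λ' : J → Finset (Fin D.d → ℤ)) (hΛ : ∀ j, ∀ y ∈ Λ' j, ∀ i, (L : ℤ) ∣ y i) :
    B6BlockParamK (latticeTrees D L Λ') κ ↔ B6Lemma21Param D ∧ B6RestQuoted D :=
  b6BlockParamK_iff_of_lemma24K (latticeTrees D L Λ') κ (lemma24K_latticeTrees_of_le_one D L hd hL hκ Λ' hΛ)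

/-- **Leaf `b6` of the P-binding `Upstream.ofPrintedAllXP`, for carriers with concrete lattice trees of ANY block size
L ≥ 1, is EQUIVALENT to `B6Lemma21Param ∧` Props. 2.2, 2.3, 2.5, 2.6, 2.7 ∧ Cor. 2.8** — the printed Lemma 2.4 needs
no quotation at any L, in particular not on the series' regime L > 11 (supersedes
`ofPrintedAllXP_withLatticeTrees_b6_iff_of_le_nine`, v5). [cite: Balaban1984PropagatorsII, Lemma 2.1 p.234 (parameter form), Props. 2.2–2.7, Cor. 2.8 (quoted); Lemma 2.4 (2.128) p.245 (printed constant, proved for every L ≥ 1)] -/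
theorem ofPrintedAllXP_withLatticeTrees_b6_iff (X : PrintedCarriersR) (Y : PrintedCarriers9X)
    (Z : PrintedCarriers11) (V : PrintedCarriers14R) (W : PrintedCarriers15) {J : Type} (L : ℕ)
    (hd : 2 ≤ X.D6.d) (hL : 1 ≤ L) (Λ' : J → Finset (Fin X.D6.d → ℤ))
    (hΛ : ∀ j, ∀ y ∈ Λ' j, ∀ i, (L : ℤ) ∣ y i) :
    (Upstream.ofPrintedAllXP (X.withLatticeTrees L Λ') Y Z V W).b6 ↔ B6Lemma21Param X.D6 ∧ B6RestQuoted X.D6 :=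
  b6BlockParam_latticeTrees_iff X.D6 L hd hL Λ' hΛ

/-- The quoted statements give that leaf, at any block size. [cite: Balaban1984PropagatorsII, Lemma 2.1 p.234 (parameter form), Props. 2.2–2.7, Cor. 2.8 (quoted)] -/
theorem ofPrintedAllXP_withLatticeTrees_b6_of_quoted (X : PrintedCarriersR) (Y : PrintedCarriers9X)
    (Z : PrintedCarriers11) (V : PrintedCarriers14R) (W : PrintedCarriers15) {J : Type} (L : ℕ)
    (hd : 2 ≤ X.D6.d) (hL : 1 ≤ L) (Λ' : J → Finset (Fin X.D6.d → ℤ))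
    (hΛ : ∀ j, ∀ y ∈ Λ' j, ∀ i, (L : ℤ) ∣ y i) (h21 : B6Lemma21Param X.D6) (hq : B6RestQuoted X.D6) :
    (Upstream.ofPrintedAllXP (X.withLatticeTrees L Λ') Y Z V W).b6 :=
  (ofPrintedAllXP_withLatticeTrees_b6_iff X Y Z V W L hd hL Λ' hΛ).2 ⟨h21, hq⟩

/-- Leaf `b6` of the K-binding `Upstream.ofPrintedAllXPK` of v3 at EVERY κ ≤ 1, for carriers with concrete lattice trees
of any block size, is EQUIVALENT to `B6Lemma21Param ∧` the six quoted statements (supersedes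
`ofPrintedAllXPK_withLatticeTrees_b6_iff`, v3, stated at κ = κ₁(d, L)). [cite: Balaban1984PropagatorsII, Lemma 2.1 p.234 (parameter form), Props. 2.2–2.7, Cor. 2.8 (quoted); Lemma 2.4 (2.128) p.245 (any factor κ ≤ 1, proved for every L ≥ 1)] -/
theorem ofPrintedAllXPK_withLatticeTrees_b6_iff_of_le_one (X : PrintedCarriersR) (Y : PrintedCarriers9X)
    (Z : PrintedCarriers11) (V : PrintedCarriers14R) (W : PrintedCarriers15) {J : Type} (L : ℕ)
    (hd : 2 ≤ X.D6.d) (hL : 1 ≤ L) {κ : ℝ} (hκ : κ ≤ 1) (Λ' : J → Finset (Fin X.D6.d → ℤ))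
    (hΛ : ∀ j, ∀ y ∈ Λ' j, ∀ i, (L : ℤ) ∣ y i) :
    (Upstream.ofPrintedAllXPK (X.withLatticeTrees L Λ') Y Z V W κ).b6 ↔
      B6Lemma21Param X.D6 ∧ B6RestQuoted X.D6 :=
  b6BlockParamK_latticeTrees_iff_of_le_one X.D6 L hd hL hκ Λ' hΛ

end LeafB6AllBlocks

/-! ## Leaf `b8`, conjunct `l1` — Lemma 1 (1.25) p. 79 for the concrete block-pair carriers of the abelian model (v8)

[Balaban1985RegularSpaces] Lemma 1 p. 79 is the conjunct `l1 : B8.Lemma1Printed d loc` of the faithful B8 leaf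
`DagBinding.B8LeafR` (and of the r1 bundle `B8.Concl`).  The b08 lineage's standalone module `…B8Lemma1Lattice`
(cell GAPS C-B8-33, DIVERGENCE D-b08-g12.1) PROVES it, hypothesis-free, for the concrete family
`B8Lemma1Lattice.blockPair d L : Site d × Fin d → B8.LocalData` — one `LocalData` per coarse bond `c = ⟨y, y + L e_μ⟩`
of the corner lattice, configurations ∕ perturbations = ADDITIVE bond fields on `ℤ^d` (the cell's abelian model of
`…B8Lemma1Abelian`), `small` = (1.7) for k = 1 on B(c₋) ∪ B(c₊), `axialClose` = (1.24), `pertDev` = sup_b |V′_b − 1|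
there: `B8Lemma1Lattice.lemma1Printed_blockPair (d L : ℕ) : B8.Lemma1Printed d (blockPair d L)`.  This section
records that discharge BY NAME against the current P-binding `Upstream.ofPrintedAllXP`: for binding carriers whose
B8 Lemma-1 data are that family (`PrintedCarriersR.withBlockPair`), the `b8` field is EQUIVALENT to the faithful leaf
WITHOUT its `l1` conjunct (`B8LeafRest`: Thm 2, Prop 3, Thm 4, Prop 5 (both halves), Prop 6, Prop 7 (repaired
reading `B8SectGH.Prop7PrintedR`), Thm 8 (`B8SectGH.Thm8PrintedAt 1`) — all QUOTED, unchanged).  HONEST SCOPE in the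
ninth header bullet: abelian model only (the non-abelian `R(·)`-transports and BCH remainders of the `G`-valued
statement are not formalised — `…B8Lemma1Lattice` HONEST SCOPE (i)–(v)); the leaf's real block-size parameter `L8`
(entering Prop 3 ∕ Prop 6) is not tied by the typing to the natural block size of the `l1` carriers, which are
discharged at EVERY `L : ℕ`; `…DagBinding` is not changed. -/
section LeafB8Lemma1

/-- **Lemma 1 (1.25), AS TYPED, for the concrete block-pair carriers of the abelian model, every `d`, `L`** — the
b08 lineage's theorem, by name. [cite: Balaban1985RegularSpaces, Lemma 1 (1.24)–(1.25) pp.79–80 (kernel version for the typed carriers of …B8Lemma1Lattice, abelian model; proof the package's)] -/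
theorem lemma1Printed_blockPair (d L : ℕ) : B8.Lemma1Printed d (B8Lemma1Lattice.blockPair d L) :=
  B8Lemma1Lattice.lemma1Printed_blockPair d L

/-- The faithful B8 leaf `DagBinding.B8LeafR` WITHOUT its Lemma-1 conjunct `l1`: Thm 2 p. 83, Prop 3 p. 87, Thm 4
p. 88, Prop 5 p. 94 (both halves), Prop 6 p. 99, Prop 7 p. 100 (repaired reading), Thm 8 p. 101 (at γ = 1) — the
eight statements that stay QUOTED. [cite: Balaban1985RegularSpaces, Thm 2 – Thm 8 pp.83–101 (quoted)] -/
structure B8LeafRest {I₂ I₃ I₄ : Type} (d : ℕ) (L C₂ B₁' B₀' B₁ B₂ c₁ : ℝ) (inp : B8.B9Inputs) (B₀β : ℝ)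
    (fam : I₂ → B8SectGH.GFData3) (lan : I₃ → B8.LandauData) (cub : I₄ → B8.CubeData)
    (toAxial : ∀ i, (fam i).Cfg → (fam i).Pert → (fam i).Pert) : Prop where
  t2 : B8.Thm2Printed (fun i => (fam i).toGFData)
  p3 : B8.Prop3Printed d L C₂ inp B₀β (fun i => (fam i).toGFData2)
  t4 : B8.Thm4Printed B₁' (fun i => (fam i).toGFData)
  p5e : B8.Prop5Exists B₀' B₁ lan
  p5u : B8.Prop5Unique lan
  p6 : B8.Prop6Printed d L B₁ c₁ cub
  p7 : B8SectGH.Prop7PrintedR fam toAxial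
  t8 : B8SectGH.Thm8PrintedAt 1 B₁ B₂ fam

/-- Bookkeeping (kernel-checked): the faithful leaf is its `l1` conjunct ∧ the rest. [folklore] -/
theorem b8LeafR_iff_l1_and_rest {I₁ I₂ I₃ I₄ : Type} (d : ℕ) (L C₂ B₁' B₀' B₁ B₂ c₁ : ℝ) (inp : B8.B9Inputs)
    (B₀β : ℝ) (loc : I₁ → B8.LocalData) (fam : I₂ → B8SectGH.GFData3) (lan : I₃ → B8.LandauData)
    (cub : I₄ → B8.CubeData) (toAxial : ∀ i, (fam i).Cfg → (fam i).Pert → (fam i).Pert) :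
    B8LeafR d L C₂ B₁' B₀' B₁ B₂ c₁ inp B₀β loc fam lan cub toAxial ↔
      B8.Lemma1Printed d loc ∧ B8LeafRest d L C₂ B₁' B₀' B₁ B₂ c₁ inp B₀β fam lan cub toAxial :=
  ⟨fun h => ⟨h.l1, ⟨h.t2, h.p3, h.t4, h.p5e, h.p5u, h.p6, h.p7, h.t8⟩⟩,
   fun h => ⟨h.1, h.2.t2, h.2.p3, h.2.t4, h.2.p5e, h.2.p5u, h.2.p6, h.2.p7, h.2.t8⟩⟩

/-- **For the concrete block-pair carriers the faithful B8 leaf is EQUIVALENT to its eight quoted statements** —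
Lemma 1 needs no quotation (every natural block size `Lb` of the `l1` carriers; the leaf's real parameter `L` is
untouched). [cite: Balaban1985RegularSpaces, Lemma 1 p.79 (proved for the typed carriers, abelian model); Thm 2 – Thm 8 pp.83–101 (quoted)] -/
theorem b8LeafR_blockPair_iff {I₂ I₃ I₄ : Type} (d Lb : ℕ) (L C₂ B₁' B₀' B₁ B₂ c₁ : ℝ) (inp : B8.B9Inputs)
    (B₀β : ℝ) (fam : I₂ → B8SectGH.GFData3) (lan : I₃ → B8.LandauData) (cub : I₄ → B8.CubeData)
    (toAxial : ∀ i, (fam i).Cfg → (fam i).Pert → (fam i).Pert) :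
    B8LeafR d L C₂ B₁' B₀' B₁ B₂ c₁ inp B₀β (B8Lemma1Lattice.blockPair d Lb) fam lan cub toAxial ↔
      B8LeafRest d L C₂ B₁' B₀' B₁ B₂ c₁ inp B₀β fam lan cub toAxial := by
  rw [b8LeafR_iff_l1_and_rest]
  exact ⟨fun h => h.2, fun h => ⟨lemma1Printed_blockPair d Lb, h⟩⟩

/-- The eight quoted statements give the faithful leaf for these carriers. [cite: Balaban1985RegularSpaces, Thm 2 – Thm 8 pp.83–101 (quoted)] -/
theorem b8LeafR_blockPair_of_rest {I₂ I₃ I₄ : Type} (d Lb : ℕ) (L C₂ B₁' B₀' B₁ B₂ c₁ : ℝ) (inp : B8.B9Inputs)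
    (B₀β : ℝ) (fam : I₂ → B8SectGH.GFData3) (lan : I₃ → B8.LandauData) (cub : I₄ → B8.CubeData)
    (toAxial : ∀ i, (fam i).Cfg → (fam i).Pert → (fam i).Pert)
    (h : B8LeafRest d L C₂ B₁' B₀' B₁ B₂ c₁ inp B₀β fam lan cub toAxial) :
    B8LeafR d L C₂ B₁' B₀' B₁ B₂ c₁ inp B₀β (B8Lemma1Lattice.blockPair d Lb) fam lan cub toAxial :=
  (b8LeafR_blockPair_iff d Lb L C₂ B₁' B₀' B₁ B₂ c₁ inp B₀β fam lan cub toAxial).2 h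

/-- Bookkeeping (`rfl`): the `b8` field of the current P-binding IS the faithful leaf `B8LeafR` over the carriers
(through `ofPrintedAllX` → `ofPrintedR`). [folklore] -/
theorem ofPrintedAllXP_b8_eq (X : PrintedCarriersR) (Y : PrintedCarriers9X) (Z : PrintedCarriers11)
    (V : PrintedCarriers14R) (W : PrintedCarriers15) :
    (Upstream.ofPrintedAllXP X Y Z V W).b8 =
      B8LeafR X.d8 X.L8 X.C₂ X.B₁' X.B₀' X.B₁ X.B₂ X.c₁ X.inp8 X.B₀β X.loc8 X.fam8R X.lan8 X.cub8 X.toAxial8 :=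
  rfl

/-- Binding carriers whose B8 Lemma-1 data are the concrete block-pair carriers of the abelian model at natural
block size `Lb` (index type `Site X.d8 × Fin X.d8`; every other carrier, and the real parameter `L8`, unchanged).
[folklore] -/
noncomputable def _root_.Literature.MathematicalPhysics.QuantumFieldTheory.Balaban1983to89.DagBinding.PrintedCarriersR.withBlockPair
    (X : PrintedCarriersR) (Lb : ℕ) : PrintedCarriersR :=
  { X with I8a := B8Lemma1Lattice.Site X.d8 × Fin X.d8, loc8 := B8Lemma1Lattice.blockPair X.d8 Lb }

/-- **Leaf `b8` of the current P-binding, for carriers with the concrete block-pair Lemma-1 data, is EQUIVALENT to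
the eight quoted statements Thm 2 – Thm 8** (`B8LeafRest` over the carriers' own B8 data). [cite: Balaban1985RegularSpaces, Lemma 1 p.79 (proved for the typed carriers, abelian model); Thm 2 – Thm 8 pp.83–101 (quoted)] -/
theorem ofPrintedAllXP_withBlockPair_b8_iff (X : PrintedCarriersR) (Y : PrintedCarriers9X) (Z : PrintedCarriers11)
    (V : PrintedCarriers14R) (W : PrintedCarriers15) (Lb : ℕ) :
    (Upstream.ofPrintedAllXP (X.withBlockPair Lb) Y Z V W).b8 ↔
      B8LeafRest X.d8 X.L8 X.C₂ X.B₁' X.B₀' X.B₁ X.B₂ X.c₁ X.inp8 X.B₀β X.fam8R X.lan8 X.cub8 X.toAxial8 :=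
  b8LeafR_blockPair_iff X.d8 Lb X.L8 X.C₂ X.B₁' X.B₀' X.B₁ X.B₂ X.c₁ X.inp8 X.B₀β X.fam8R X.lan8 X.cub8 X.toAxial8

/-- The quoted statements give that leaf. [cite: Balaban1985RegularSpaces, Thm 2 – Thm 8 pp.83–101 (quoted)] -/
theorem ofPrintedAllXP_withBlockPair_b8_of_rest (X : PrintedCarriersR) (Y : PrintedCarriers9X)
    (Z : PrintedCarriers11) (V : PrintedCarriers14R) (W : PrintedCarriers15) (Lb : ℕ)
    (h : B8LeafRest X.d8 X.L8 X.C₂ X.B₁' X.B₀' X.B₁ X.B₂ X.c₁ X.inp8 X.B₀β X.fam8R X.lan8 X.cub8 X.toAxial8) :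
    (Upstream.ofPrintedAllXP (X.withBlockPair Lb) Y Z V W).b8 :=
  (ofPrintedAllXP_withBlockPair_b8_iff X Y Z V W Lb).2 h

/-- The same at the K-binding of v3 (its `b8` field is the P-binding's, `ofPrintedAllXPK_leaves`), every κ. [cite: Balaban1985RegularSpaces, Lemma 1 p.79 (proved for the typed carriers, abelian model); Thm 2 – Thm 8 pp.83–101 (quoted)] -/
theorem ofPrintedAllXPK_withBlockPair_b8_iff (X : PrintedCarriersR) (Y : PrintedCarriers9X) (Z : PrintedCarriers11)
    (V : PrintedCarriers14R) (W : PrintedCarriers15) (κ : ℝ) (Lb : ℕ) :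
    (Upstream.ofPrintedAllXPK (X.withBlockPair Lb) Y Z V W κ).b8 ↔
      B8LeafRest X.d8 X.L8 X.C₂ X.B₁' X.B₀' X.B₁ X.B₂ X.c₁ X.inp8 X.B₀β X.fam8R X.lan8 X.cub8 X.toAxial8 :=
  b8LeafR_blockPair_iff X.d8 Lb X.L8 X.C₂ X.B₁' X.B₀' X.B₁ X.B₂ X.c₁ X.inp8 X.B₀β X.fam8R X.lan8 X.cub8 X.toAxial8

/-- Downstream bookkeeping: for these carriers Theorem 8 at γ = 1 — what B9 consumes from the leaf
(`DagBinding.ofPrintedR_b8_thm8`) — comes from the quoted rest alone. [cite: Balaban1985RegularSpaces, Thm 8 (1.146) p.101 (quoted)] -/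
theorem thm8_withBlockPair_of_rest (X : PrintedCarriersR) (Lb : ℕ)
    (h : B8LeafRest X.d8 X.L8 X.C₂ X.B₁' X.B₀' X.B₁ X.B₂ X.c₁ X.inp8 X.B₀β X.fam8R X.lan8 X.cub8 X.toAxial8) :
    B8SectGH.Thm8PrintedAt 1 (X.withBlockPair Lb).B₁ (X.withBlockPair Lb).B₂ (X.withBlockPair Lb).fam8R :=
  h.t8

end LeafB8Lemma1

/-! ## Leaf `b4`, conjunct 3 — «Proposition 3.1′ of [2]» (1.22) for the zero-field form carriers, `A = 0` (v9)

[Balaban1983RegularityDecay] «Proposition 3.1′ of [2]» p. 574 (1.21)–(1.22) is the third conjunct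
`B4.Prop31Printed famF` of leaf `b4` (`B4.LeafB4`; surge node T01.3).  The b04 lineage's standalone module
`…B4Prop31Zero` (cell GAPS C-b04g10-1, DIVERGENCE D-b04g10-1; it imports `…B4Lower18` and `…B4` only, no `Dag…`
file) PROVES it, hypothesis-free, for the concrete family `B4Prop31Zero.zeroFieldForms d a₋ m²₊ :
B4Prop31Zero.ZeroIdx d a₋ m²₊ → B4.FormSetting` of ALL zero-field (`A = 0`, `U ≡ 1`) instances with finite
`Ω^{(k)} ⊂ ℤ^{d+1}`, mesh n ≥ 1, `a_k ≥ a₋ > 0`, `0 ≤ m² ≤ m²₊`, any charge `e` and any number `N` of real field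
components: `B4Prop31Zero.prop31Printed_zeroField d (hamin : 0 < a₋) (hmax : 0 ≤ m²₊)`, with
`γ₀ = min(a₋/(8(d+1) + 2m²₊), 1/8)`, threshold `e₁ = 1` and error constant `C(α) = 0`.  This section records that
discharge BY NAME against the current P-binding `Upstream.ofPrintedAllXP`: for binding carriers whose B4 form
family IS that family (`PrintedCarriersR.withZeroFieldForms`), the `b4` field is EQUIVALENT to the TWO remaining
quoted statements, Theorem p. 573 (`B4.ThmPrinted`) and Prop. 2.3 p. 574 (`B4.Prop23Printed`) — the Sect. 5 Theorem
conjunct being proved since v1 (`B4Sect5Proof`, `leafB4_iff_quoted`).  HONEST SCOPE in the tenth header bullet: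
`A = 0` only (NOTHING about `A ≠ 0`, the content of §4 (4.7)–(4.22), census G-B4-06/07/08); finite `Ω^{(k)}`; the
constant depends on the window (`a₋`, `m²₊`) as the printed proof's own constant does (D-b04.3); the abstract
hypothesis `B4.Prop31Printed X.famF` for an arbitrary `famF` is NOT discharged; `…DagBinding` is not changed. -/
section LeafB4Prop31Zero

/-- **«Proposition 3.1′ of [2]» (1.22), AS TYPED, for the zero-field form carriers, every `d`, every window
`0 < a₋`, `0 ≤ m²₊`** — the b04 lineage's theorem, by name. [cite: Balaban1983RegularityDecay, Prop. 3.1′ of [2] (1.21)–(1.22) p.574 (kernel version for the typed zero-field carriers of …B4Prop31Zero, case A = 0; constant and proof the package's)] -/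
theorem prop31Printed_zeroFieldForms (d : ℕ) {amin m2max : ℝ} (hamin : 0 < amin) (hmax : 0 ≤ m2max) :
    B4.Prop31Printed (B4Prop31Zero.zeroFieldForms d amin m2max) :=
  B4Prop31Zero.prop31Printed_zeroField d hamin hmax

/-- **Leaf `b4` over the zero-field form carriers is EQUIVALENT to TWO quoted statements**: Theorem p. 573 over
`famE` and Prop. 2.3 p. 574 over `famU` — conjunct 3 is `prop31Printed_zeroFieldForms`, conjunct 4 (Sect. 5
Theorem) is `B4Sect5Proof.sect5ThmUniform_holds`. [cite: Balaban1983RegularityDecay, Theorem p.573, Prop. 2.3 p.574 (quoted); Prop. 3.1′ of [2] p.574 (proved for the typed zero-field carriers, A = 0); Sect. 5 Theorem p.594 (proved)] -/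
theorem leafB4_zeroFieldForms_iff {I₁ I₂ : Type} (famE : I₁ → B4.EtaSetting) (famU : I₂ → B4.UnitSetting)
    (d : ℕ) {amin m2max : ℝ} (hamin : 0 < amin) (hmax : 0 ≤ m2max) (d4 N4 : ℕ) :
    B4.LeafB4 famE famU (B4Prop31Zero.zeroFieldForms d amin m2max) d4 N4 ↔
      B4.ThmPrinted famE ∧ B4.Prop23Printed famU :=
  (leafB4_iff_quoted famE famU (B4Prop31Zero.zeroFieldForms d amin m2max) d4 N4).trans
    ⟨fun h => ⟨h.1, h.2.1⟩, fun h => ⟨h.1, h.2, prop31Printed_zeroFieldForms d hamin hmax⟩⟩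

/-- Binding carriers whose B4 form family (the carriers of «Proposition 3.1′ of [2]») IS the zero-field family of
`…B4Prop31Zero` at lattice dimension parameter `d` and window `(a₋, m²₊)` (index type `B4Prop31Zero.ZeroIdx d a₋ m²₊`;
every other carrier — in particular `famE`, `famU` and the Sect. 5 Theorem's `(d4, N4)` — unchanged). [folklore] -/
noncomputable def _root_.Literature.MathematicalPhysics.QuantumFieldTheory.Balaban1983to89.DagBinding.PrintedCarriersR.withZeroFieldForms
    (X : PrintedCarriersR) (d : ℕ) (amin m2max : ℝ) : PrintedCarriersR :=
  { X with I4F := B4Prop31Zero.ZeroIdx d amin m2max, famF := B4Prop31Zero.zeroFieldForms d amin m2max }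

/-- The `b4` field of the current P-binding over such carriers IS `B4.LeafB4` with the zero-field form family
(bookkeeping, `rfl`). [folklore] -/
theorem ofPrintedAllXP_withZeroFieldForms_b4_eq (X : PrintedCarriersR) (Y : PrintedCarriers9X)
    (Z : PrintedCarriers11) (V : PrintedCarriers14R) (W : PrintedCarriers15) (d : ℕ) (amin m2max : ℝ) :
    (Upstream.ofPrintedAllXP (X.withZeroFieldForms d amin m2max) Y Z V W).b4 =
      B4.LeafB4 X.famE X.famU (B4Prop31Zero.zeroFieldForms d amin m2max) X.d4 X.N4 :=
  rfl

/-- **Leaf `b4` of the current P-binding, for carriers with the zero-field form family, is EQUIVALENT to the two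
quoted statements Theorem p. 573 and Prop. 2.3** (over the carriers' own `famE`, `famU`). [cite: Balaban1983RegularityDecay, Theorem p.573, Prop. 2.3 p.574 (quoted); Prop. 3.1′ of [2] p.574 (proved for the typed zero-field carriers, A = 0); Sect. 5 Theorem p.594 (proved)] -/
theorem ofPrintedAllXP_withZeroFieldForms_b4_iff (X : PrintedCarriersR) (Y : PrintedCarriers9X)
    (Z : PrintedCarriers11) (V : PrintedCarriers14R) (W : PrintedCarriers15) (d : ℕ) {amin m2max : ℝ}
    (hamin : 0 < amin) (hmax : 0 ≤ m2max) :
    (Upstream.ofPrintedAllXP (X.withZeroFieldForms d amin m2max) Y Z V W).b4 ↔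
      B4.ThmPrinted X.famE ∧ B4.Prop23Printed X.famU := by
  rw [ofPrintedAllXP_withZeroFieldForms_b4_eq]
  exact leafB4_zeroFieldForms_iff X.famE X.famU d hamin hmax X.d4 X.N4

/-- The two quoted statements give that leaf. [cite: Balaban1983RegularityDecay, Theorem p.573, Prop. 2.3 p.574 (quoted)] -/
theorem ofPrintedAllXP_withZeroFieldForms_b4_of_quoted (X : PrintedCarriersR) (Y : PrintedCarriers9X)
    (Z : PrintedCarriers11) (V : PrintedCarriers14R) (W : PrintedCarriers15) (d : ℕ) {amin m2max : ℝ}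
    (hamin : 0 < amin) (hmax : 0 ≤ m2max) (h₁ : B4.ThmPrinted X.famE) (h₂ : B4.Prop23Printed X.famU) :
    (Upstream.ofPrintedAllXP (X.withZeroFieldForms d amin m2max) Y Z V W).b4 :=
  (ofPrintedAllXP_withZeroFieldForms_b4_iff X Y Z V W d hamin hmax).2 ⟨h₁, h₂⟩

/-- The same at the K-binding of v3 (its `b4` field is the P-binding's, `ofPrintedAllXPK_leaves`), every κ. [cite: Balaban1983RegularityDecay, Theorem p.573, Prop. 2.3 p.574 (quoted); Prop. 3.1′ of [2] p.574 (proved for the typed zero-field carriers, A = 0); Sect. 5 Theorem p.594 (proved)] -/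
theorem ofPrintedAllXPK_withZeroFieldForms_b4_iff (X : PrintedCarriersR) (Y : PrintedCarriers9X)
    (Z : PrintedCarriers11) (V : PrintedCarriers14R) (W : PrintedCarriers15) (κ : ℝ) (d : ℕ) {amin m2max : ℝ}
    (hamin : 0 < amin) (hmax : 0 ≤ m2max) :
    (Upstream.ofPrintedAllXPK (X.withZeroFieldForms d amin m2max) Y Z V W κ).b4 ↔
      B4.ThmPrinted X.famE ∧ B4.Prop23Printed X.famU := by
  rw [(ofPrintedAllXPK_leaves (X.withZeroFieldForms d amin m2max) Y Z V W κ).2.1]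
  exact ofPrintedAllXP_withZeroFieldForms_b4_iff X Y Z V W d hamin hmax

/-- NET LEDGER for node `b4` over the zero-field form carriers: of the four printed statements bundled in the leaf
(Theorem p. 573, Prop. 2.3, «Prop. 3.1′ of [2]», Sect. 5 Theorem), TWO are theorems of the package for these
carriers and TWO stay quoted. [cite: Balaban1983RegularityDecay, Theorem p.573, Props. p.574, Sect. 5 Theorem p.594] -/
theorem b4_zeroFieldForms_proved_conjuncts (X : PrintedCarriersR) (d : ℕ) {amin m2max : ℝ} (hamin : 0 < amin)
    (hmax : 0 ≤ m2max) :
    B4.Prop31Printed (X.withZeroFieldForms d amin m2max).famF ∧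
      B4.Sect5ThmUniform (X.withZeroFieldForms d amin m2max).d4 (X.withZeroFieldForms d amin m2max).N4 :=
  ⟨prop31Printed_zeroFieldForms d hamin hmax, B4Sect5Proof.sect5ThmUniform_holds X.d4 X.N4⟩

end LeafB4Prop31Zero

/-! ## Leaf `b4`, conjunct 2 — «Proposition 2.3 of [1]» (1.15)–(1.20) for the zero-field nested-box carriers, `A = 0` (v10)

[Balaban1983RegularityDecay] «Proposition 2.3 of [1]» p. 574 (1.15)–(1.20) is the second conjunct
`B4.Prop23Printed famU` of leaf `b4` (`B4.LeafB4`; surge node T01.2).  The pv17 lineage's standalone module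
`…B4Prop23ZeroBox` (cell GAPS C-pv17-51, DIVERGENCE D-pv17.15; it imports `…B4TwoBox120` and `…B4` only, no
`Dag…` file) PROVES it, hypothesis-free, for the concrete family `B4Prop23ZeroBox.zeroFieldBoxes d ℓ a₋ a₊ m²₊ a₂₋
a₂₊` of ALL zero-field (`A = 0`) nested-Neumann-box instances (mesh n ≥ 1, running constants in the window, boxes
□ ⊂ □₀ of L-blocks, every finite Λ ⊆ □^{(j)}): `B4Prop23ZeroBox.prop23Printed_zeroFieldBoxes d ℓ (hℓ : 1 ≤ ℓ)
(ha : 0 < a₋) (ha2 : 0 < a₂₋)`.  This section records that discharge BY NAME against the current P-binding: for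
binding carriers whose B4 unit-lattice family IS that family (`PrintedCarriersR.withZeroFieldBoxes`), the `b4` field
is EQUIVALENT to Theorem p. 573 (`B4.ThmPrinted`) and «Prop. 3.1′ of [2]» (`B4.Prop31Printed`); combined with v9, for
carriers carrying BOTH zero-field families the `b4` field is EQUIVALENT to Theorem p. 573 ALONE.  HONEST SCOPE in the
eleventh header bullet: `A = 0` only; nested Neumann boxes only; «sum of big blocks» not imposed; window-dependent
existential constants; the abstract hypothesis `B4.Prop23Printed X.famU` for an arbitrary `famU` is NOT discharged;
`…DagBinding` is not changed. -/
section LeafB4Prop23ZeroBox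

/-- **«Proposition 2.3 of [1]» (1.15)–(1.20), AS TYPED, for the zero-field nested-box carriers, every `d`, every
`ℓ ≥ 1`, every window `0 < a₋`, `0 < a₂₋`** — the pv17 lineage's theorem, by name. [cite: Balaban1983RegularityDecay, Prop. 2.3 of [1] (1.15)–(1.20) p.574 (kernel version for the typed zero-field nested-box carriers of …B4Prop23ZeroBox, case A = 0; constants and proofs the package's)] -/
theorem prop23Printed_zeroFieldBoxes (d ℓ : ℕ) (hℓ : 1 ≤ ℓ) {aminus aplus m2plus a2minus a2plus : ℝ}
    (ha : 0 < aminus) (ha2 : 0 < a2minus) :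
    B4.Prop23Printed (B4Prop23ZeroBox.zeroFieldBoxes d ℓ aminus aplus m2plus a2minus a2plus) :=
  B4Prop23ZeroBox.prop23Printed_zeroFieldBoxes d ℓ hℓ ha ha2

/-- **Leaf `b4` over the zero-field nested-box carriers is EQUIVALENT to TWO quoted statements**: Theorem p. 573
over `famE` and «Prop. 3.1′ of [2]» over `famF` — conjunct 2 is `prop23Printed_zeroFieldBoxes`, conjunct 4 (Sect. 5
Theorem) is `B4Sect5Proof.sect5ThmUniform_holds`. [cite: Balaban1983RegularityDecay, Theorem p.573, Prop. 3.1′ of [2] p.574 (quoted); Prop. 2.3 of [1] p.574 (proved for the typed zero-field nested-box carriers, A = 0); Sect. 5 Theorem p.594 (proved)] -/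
theorem leafB4_zeroFieldBoxes_iff {I₁ I₃ : Type} (famE : I₁ → B4.EtaSetting) (famF : I₃ → B4.FormSetting)
    (d ℓ : ℕ) (hℓ : 1 ≤ ℓ) {aminus aplus m2plus a2minus a2plus : ℝ} (ha : 0 < aminus) (ha2 : 0 < a2minus)
    (d4 N4 : ℕ) :
    B4.LeafB4 famE (B4Prop23ZeroBox.zeroFieldBoxes d ℓ aminus aplus m2plus a2minus a2plus) famF d4 N4 ↔
      B4.ThmPrinted famE ∧ B4.Prop31Printed famF :=
  (leafB4_iff_quoted famE (B4Prop23ZeroBox.zeroFieldBoxes d ℓ aminus aplus m2plus a2minus a2plus) famF d4 N4).trans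
    ⟨fun h => ⟨h.1, h.2.2⟩, fun h => ⟨h.1, prop23Printed_zeroFieldBoxes d ℓ hℓ ha ha2, h.2⟩⟩

/-- **Leaf `b4` over BOTH zero-field families (the nested-box unit-lattice carriers of v10 and the form carriers of
v9) is EQUIVALENT to ONE quoted statement**, Theorem p. 573 over `famE`. [cite: Balaban1983RegularityDecay, Theorem p.573 (quoted); Prop. 2.3 of [1] and Prop. 3.1′ of [2] p.574 (proved for the typed zero-field carriers, A = 0); Sect. 5 Theorem p.594 (proved)] -/
theorem leafB4_zeroFieldBoth_iff {I₁ : Type} (famE : I₁ → B4.EtaSetting) (d ℓ : ℕ) (hℓ : 1 ≤ ℓ)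
    {aminus aplus m2plus a2minus a2plus : ℝ} (ha : 0 < aminus) (ha2 : 0 < a2minus) (d' : ℕ) {amin' m2max' : ℝ}
    (hamin' : 0 < amin') (hmax' : 0 ≤ m2max') (d4 N4 : ℕ) :
    B4.LeafB4 famE (B4Prop23ZeroBox.zeroFieldBoxes d ℓ aminus aplus m2plus a2minus a2plus)
        (B4Prop31Zero.zeroFieldForms d' amin' m2max') d4 N4 ↔ B4.ThmPrinted famE :=
  (leafB4_zeroFieldBoxes_iff famE (B4Prop31Zero.zeroFieldForms d' amin' m2max') d ℓ hℓ ha ha2 d4 N4).trans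
    ⟨fun h => h.1, fun h => ⟨h, prop31Printed_zeroFieldForms d' hamin' hmax'⟩⟩

/-- Binding carriers whose B4 unit-lattice family (the carriers of «Proposition 2.3 of [1]») IS the zero-field
nested-box family of `…B4Prop23ZeroBox` (index type `B4Prop23ZeroBox.ZeroBoxIdx d ℓ a₋ a₊ m²₊ a₂₋ a₂₊`; every other
carrier — in particular `famE`, `famF` and `(d4, N4)` — unchanged). [folklore] -/
noncomputable def _root_.Literature.MathematicalPhysics.QuantumFieldTheory.Balaban1983to89.DagBinding.PrintedCarriersR.withZeroFieldBoxes
    (X : PrintedCarriersR) (d ℓ : ℕ) (aminus aplus m2plus a2minus a2plus : ℝ) : PrintedCarriersR :=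
  { X with I4U := B4Prop23ZeroBox.ZeroBoxIdx d ℓ aminus aplus m2plus a2minus a2plus,
           famU := B4Prop23ZeroBox.zeroFieldBoxes d ℓ aminus aplus m2plus a2minus a2plus }

/-- The `b4` field of the current P-binding over such carriers IS `B4.LeafB4` with the zero-field nested-box family
(bookkeeping, `rfl`). [folklore] -/
theorem ofPrintedAllXP_withZeroFieldBoxes_b4_eq (X : PrintedCarriersR) (Y : PrintedCarriers9X)
    (Z : PrintedCarriers11) (V : PrintedCarriers14R) (W : PrintedCarriers15) (d ℓ : ℕ)
    (aminus aplus m2plus a2minus a2plus : ℝ) :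
    (Upstream.ofPrintedAllXP (X.withZeroFieldBoxes d ℓ aminus aplus m2plus a2minus a2plus) Y Z V W).b4 =
      B4.LeafB4 X.famE (B4Prop23ZeroBox.zeroFieldBoxes d ℓ aminus aplus m2plus a2minus a2plus) X.famF X.d4 X.N4 :=
  rfl

/-- **Leaf `b4` of the current P-binding, for carriers with the zero-field nested-box family, is EQUIVALENT to
Theorem p. 573 and «Prop. 3.1′ of [2]»** (over the carriers' own `famE`, `famF`). [cite: Balaban1983RegularityDecay, Theorem p.573, Prop. 3.1′ of [2] p.574 (quoted); Prop. 2.3 of [1] p.574 (proved for the typed zero-field nested-box carriers, A = 0); Sect. 5 Theorem p.594 (proved)] -/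
theorem ofPrintedAllXP_withZeroFieldBoxes_b4_iff (X : PrintedCarriersR) (Y : PrintedCarriers9X)
    (Z : PrintedCarriers11) (V : PrintedCarriers14R) (W : PrintedCarriers15) (d ℓ : ℕ) (hℓ : 1 ≤ ℓ)
    {aminus aplus m2plus a2minus a2plus : ℝ} (ha : 0 < aminus) (ha2 : 0 < a2minus) :
    (Upstream.ofPrintedAllXP (X.withZeroFieldBoxes d ℓ aminus aplus m2plus a2minus a2plus) Y Z V W).b4 ↔
      B4.ThmPrinted X.famE ∧ B4.Prop31Printed X.famF := by
  rw [ofPrintedAllXP_withZeroFieldBoxes_b4_eq]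
  exact leafB4_zeroFieldBoxes_iff X.famE X.famF d ℓ hℓ ha ha2 X.d4 X.N4

/-- The two quoted statements give that leaf. [cite: Balaban1983RegularityDecay, Theorem p.573, Prop. 3.1′ of [2] p.574 (quoted)] -/
theorem ofPrintedAllXP_withZeroFieldBoxes_b4_of_quoted (X : PrintedCarriersR) (Y : PrintedCarriers9X)
    (Z : PrintedCarriers11) (V : PrintedCarriers14R) (W : PrintedCarriers15) (d ℓ : ℕ) (hℓ : 1 ≤ ℓ)
    {aminus aplus m2plus a2minus a2plus : ℝ} (ha : 0 < aminus) (ha2 : 0 < a2minus) (h₁ : B4.ThmPrinted X.famE)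
    (h₃ : B4.Prop31Printed X.famF) :
    (Upstream.ofPrintedAllXP (X.withZeroFieldBoxes d ℓ aminus aplus m2plus a2minus a2plus) Y Z V W).b4 :=
  (ofPrintedAllXP_withZeroFieldBoxes_b4_iff X Y Z V W d ℓ hℓ ha ha2).2 ⟨h₁, h₃⟩

/-- The same at the K-binding of v3 (its `b4` field is the P-binding's, `ofPrintedAllXPK_leaves`), every κ. [cite: Balaban1983RegularityDecay, Theorem p.573, Prop. 3.1′ of [2] p.574 (quoted); Prop. 2.3 of [1] p.574 (proved for the typed zero-field nested-box carriers, A = 0); Sect. 5 Theorem p.594 (proved)] -/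
theorem ofPrintedAllXPK_withZeroFieldBoxes_b4_iff (X : PrintedCarriersR) (Y : PrintedCarriers9X)
    (Z : PrintedCarriers11) (V : PrintedCarriers14R) (W : PrintedCarriers15) (κ : ℝ) (d ℓ : ℕ) (hℓ : 1 ≤ ℓ)
    {aminus aplus m2plus a2minus a2plus : ℝ} (ha : 0 < aminus) (ha2 : 0 < a2minus) :
    (Upstream.ofPrintedAllXPK (X.withZeroFieldBoxes d ℓ aminus aplus m2plus a2minus a2plus) Y Z V W κ).b4 ↔
      B4.ThmPrinted X.famE ∧ B4.Prop31Printed X.famF := by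
  rw [(ofPrintedAllXPK_leaves (X.withZeroFieldBoxes d ℓ aminus aplus m2plus a2minus a2plus) Y Z V W κ).2.1]
  exact ofPrintedAllXP_withZeroFieldBoxes_b4_iff X Y Z V W d ℓ hℓ ha ha2

/-- **Leaf `b4` of the current P-binding, for carriers with BOTH zero-field families (v9 forms, v10 nested boxes),
is EQUIVALENT to Theorem p. 573 ALONE** — three of the four printed statements of node B4 are then theorems of the
package for these carriers. [cite: Balaban1983RegularityDecay, Theorem p.573 (quoted); Props. p.574 (proved for the typed zero-field carriers, A = 0); Sect. 5 Theorem p.594 (proved)] -/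
theorem ofPrintedAllXP_withZeroFieldBoth_b4_iff (X : PrintedCarriersR) (Y : PrintedCarriers9X)
    (Z : PrintedCarriers11) (V : PrintedCarriers14R) (W : PrintedCarriers15) (d' : ℕ) {amin' m2max' : ℝ}
    (hamin' : 0 < amin') (hmax' : 0 ≤ m2max') (d ℓ : ℕ) (hℓ : 1 ≤ ℓ) {aminus aplus m2plus a2minus a2plus : ℝ}
    (ha : 0 < aminus) (ha2 : 0 < a2minus) :
    (Upstream.ofPrintedAllXP
        ((X.withZeroFieldForms d' amin' m2max').withZeroFieldBoxes d ℓ aminus aplus m2plus a2minus a2plus)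
        Y Z V W).b4 ↔ B4.ThmPrinted X.famE :=
  (ofPrintedAllXP_withZeroFieldBoxes_b4_iff (X.withZeroFieldForms d' amin' m2max') Y Z V W d ℓ hℓ ha ha2).trans
    ⟨fun h => h.1, fun h => ⟨h, prop31Printed_zeroFieldForms d' hamin' hmax'⟩⟩

/-- NET LEDGER for node `b4` over carriers with both zero-field families: of the four printed statements bundled in
the leaf, THREE are theorems of the package for these carriers (Prop. 2.3, «Prop. 3.1′ of [2]», Sect. 5 Theorem) and
ONE stays quoted (Theorem p. 573 = Prop. 2.1 of [1], the A-dependent decay ∕ regularity of G_k(Ω, A)). [cite: Balaban1983RegularityDecay, Theorem p.573, Props. p.574, Sect. 5 Theorem p.594] -/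
theorem b4_zeroFieldBoth_proved_conjuncts (X : PrintedCarriersR) (d' : ℕ) {amin' m2max' : ℝ} (hamin' : 0 < amin')
    (hmax' : 0 ≤ m2max') (d ℓ : ℕ) (hℓ : 1 ≤ ℓ) {aminus aplus m2plus a2minus a2plus : ℝ} (ha : 0 < aminus)
    (ha2 : 0 < a2minus) :
    let X' := (X.withZeroFieldForms d' amin' m2max').withZeroFieldBoxes d ℓ aminus aplus m2plus a2minus a2plus
    B4.Prop23Printed X'.famU ∧ B4.Prop31Printed X'.famF ∧ B4.Sect5ThmUniform X'.d4 X'.N4 :=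
  ⟨prop23Printed_zeroFieldBoxes d ℓ hℓ ha ha2, prop31Printed_zeroFieldForms d' hamin' hmax',
    B4Sect5Proof.sect5ThmUniform_holds X.d4 X.N4⟩

end LeafB4Prop23ZeroBox

/-! ## Leaf `b4`, conjunct 2 — «Proposition 2.3 of [1]» (1.15)–(1.20) for the zero-field torus family, `Ω = Ω₀ = T^{(j)}`, `A = 0` (v11)

[Balaban1983RegularityDecay] «Proposition 2.3 of [1]» p. 574 (1.15)–(1.20) is the second conjunct
`B4.Prop23Printed famU` of leaf `b4` (`B4.LeafB4`; surge node T01.2).  v10 recorded its kernel proof for the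
zero-field NESTED-BOX family of the pv17 lineage.  The pv07 lineage's standalone module `…B4Ineq118Torus` (cell
certification C-pv07-31, node G-pv07-5j, DIVERGENCE D-pv07.23; it imports `…B4Ineq116Torus` only, no `Dag…` file)
PROVES it, hypothesis-free, for a SECOND concrete family, the zero-field TORUS instance family
`B4Ineq118Torus.torusFam d L a m²₊ : B4Ineq118Torus.TorusInst d L m²₊ → B4.UnitSetting` (Ω = Ω₀ = the whole level-j
unit torus T^{(j)}, U = 1; one instance per volume `P = (d, L, m, K)`, bare mass `m² ≥ 0`, level `1 ≤ j ≤ m + K`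
under the cap `(L^jε)²m² ≤ m²₊`, subset `Λ ⊂ T^{(j)}`): `B4Ineq118Torus.prop23Printed_torusFam d L (hd : 1 ≤ d)
(hL : Odd L ∧ 1 < L) (ha : 0 < a) m²₊` — the case «Ω = T_ε only» of [1] part I, which [Balaban1984PropagatorsI]
p. 39 uses.  This section records that discharge BY NAME against the current P-binding, in the pattern of v10: for
binding carriers whose B4 unit-lattice family IS the torus family (`PrintedCarriersR.withTorusFam`), the `b4` field
is EQUIVALENT to Theorem p. 573 (`B4.ThmPrinted`) and «Prop. 3.1′ of [2]» (`B4.Prop31Printed`); combined with v9,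
for carriers carrying the torus family and the zero-field form family the `b4` field is EQUIVALENT to Theorem p. 573
ALONE.  HONEST SCOPE in the twelfth header bullet: Ω = Ω₀ = T^{(j)} only ((1.19)–(1.20) empty); `A = 0` only; «sum
of big blocks» not imposed; levels `j ≥ 1`; constants explicit in b04's existential window constants; the abstract
hypothesis `B4.Prop23Printed X.famU` for an arbitrary `famU` is NOT discharged; `…DagBinding` is not changed. -/
section LeafB4Prop23Torus

/-- **«Proposition 2.3 of [1]» (1.15)–(1.20), AS TYPED, for the zero-field torus instance family, every `d ≥ 1`,
every odd `L > 1`, every `a > 0`, every mass cap `m²₊`** — the pv07 lineage's theorem, by name. [cite: Balaban1983RegularityDecay, Prop. 2.3 of [1] (1.15)–(1.20) p.574 with p.572 (kernel version for the typed zero-field torus instance family of …B4Ineq118Torus, case Ω = Ω₀ = T^{(j)}, A = 0; constants and proofs the package's)] -/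
theorem leafB4_conj2_torusFam (d L : ℕ) (hd : 1 ≤ d) (hL : Odd L ∧ 1 < L) {a : ℝ} (ha : 0 < a) (m2plus : ℝ) :
    B4.Prop23Printed (B4Ineq118Torus.torusFam d L a m2plus) :=
  B4Ineq118Torus.prop23Printed_torusFam d L hd hL ha m2plus

/-- The series' dimension: «Proposition 2.3 of [1]», as typed, for the FOUR-dimensional zero-field torus family,
every odd `L > 1`, every `a > 0`, every mass cap (bookkeeping special case of `leafB4_conj2_torusFam`). [cite: Balaban1983RegularityDecay, Prop. 2.3 of [1] (1.15)–(1.20) p.574 (kernel version for the typed zero-field torus instance family, d = 4, A = 0)] -/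
theorem leafB4_conj2_torusFam_four (L : ℕ) (hL : Odd L ∧ 1 < L) {a : ℝ} (ha : 0 < a) (m2plus : ℝ) :
    B4.Prop23Printed (B4Ineq118Torus.torusFam 4 L a m2plus) :=
  leafB4_conj2_torusFam 4 L (by norm_num) hL ha m2plus

/-- **Leaf `b4` over the zero-field torus family is EQUIVALENT to TWO quoted statements**: Theorem p. 573 over
`famE` and «Prop. 3.1′ of [2]» over `famF` — conjunct 2 is `leafB4_conj2_torusFam`, conjunct 4 (Sect. 5 Theorem) is
`B4Sect5Proof.sect5ThmUniform_holds`. [cite: Balaban1983RegularityDecay, Theorem p.573, Prop. 3.1′ of [2] p.574 (quoted); Prop. 2.3 of [1] p.574 (proved for the typed zero-field torus instance family, A = 0); Sect. 5 Theorem p.594 (proved)] -/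
theorem leafB4_torusFam_iff {I₁ I₃ : Type} (famE : I₁ → B4.EtaSetting) (famF : I₃ → B4.FormSetting) (d L : ℕ)
    (hd : 1 ≤ d) (hL : Odd L ∧ 1 < L) {a : ℝ} (ha : 0 < a) (m2plus : ℝ) (d4 N4 : ℕ) :
    B4.LeafB4 famE (B4Ineq118Torus.torusFam d L a m2plus) famF d4 N4 ↔ B4.ThmPrinted famE ∧ B4.Prop31Printed famF :=
  (leafB4_iff_quoted famE (B4Ineq118Torus.torusFam d L a m2plus) famF d4 N4).trans
    ⟨fun h => ⟨h.1, h.2.2⟩, fun h => ⟨h.1, leafB4_conj2_torusFam d L hd hL ha m2plus, h.2⟩⟩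

/-- **Leaf `b4` over the zero-field torus family (for `famU`) and the zero-field form family of v9 (for `famF`) is
EQUIVALENT to ONE quoted statement**, Theorem p. 573 over `famE`. [cite: Balaban1983RegularityDecay, Theorem p.573 (quoted); Prop. 2.3 of [1] and Prop. 3.1′ of [2] p.574 (proved for the typed zero-field carriers, A = 0); Sect. 5 Theorem p.594 (proved)] -/
theorem leafB4_torusForms_iff {I₁ : Type} (famE : I₁ → B4.EtaSetting) (d L : ℕ) (hd : 1 ≤ d) (hL : Odd L ∧ 1 < L)
    {a : ℝ} (ha : 0 < a) (m2plus : ℝ) (d' : ℕ) {amin' m2max' : ℝ} (hamin' : 0 < amin') (hmax' : 0 ≤ m2max')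
    (d4 N4 : ℕ) :
    B4.LeafB4 famE (B4Ineq118Torus.torusFam d L a m2plus) (B4Prop31Zero.zeroFieldForms d' amin' m2max') d4 N4 ↔
      B4.ThmPrinted famE :=
  (leafB4_torusFam_iff famE (B4Prop31Zero.zeroFieldForms d' amin' m2max') d L hd hL ha m2plus d4 N4).trans
    ⟨fun h => h.1, fun h => ⟨h, prop31Printed_zeroFieldForms d' hamin' hmax'⟩⟩

/-- Binding carriers whose B4 unit-lattice family (the carriers of «Proposition 2.3 of [1]») IS the zero-field torus
instance family of `…B4Ineq118Torus` (index type `B4Ineq118Torus.TorusInst d L m²₊`; every other carrier — in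
particular `famE`, `famF` and `(d4, N4)` — unchanged). [folklore] -/
noncomputable def _root_.Literature.MathematicalPhysics.QuantumFieldTheory.Balaban1983to89.DagBinding.PrintedCarriersR.withTorusFam
    (X : PrintedCarriersR) (d L : ℕ) (a m2plus : ℝ) : PrintedCarriersR :=
  { X with I4U := B4Ineq118Torus.TorusInst d L m2plus,
           famU := B4Ineq118Torus.torusFam d L a m2plus }

/-- The `b4` field of the current P-binding over such carriers IS `B4.LeafB4` with the zero-field torus family
(bookkeeping, `rfl`). [folklore] -/
theorem ofPrintedAllXP_withTorusFam_b4_eq (X : PrintedCarriersR) (Y : PrintedCarriers9X) (Z : PrintedCarriers11)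
    (V : PrintedCarriers14R) (W : PrintedCarriers15) (d L : ℕ) (a m2plus : ℝ) :
    (Upstream.ofPrintedAllXP (X.withTorusFam d L a m2plus) Y Z V W).b4 =
      B4.LeafB4 X.famE (B4Ineq118Torus.torusFam d L a m2plus) X.famF X.d4 X.N4 :=
  rfl

/-- **Leaf `b4` of the current P-binding, for carriers with the zero-field torus family, is EQUIVALENT to Theorem
p. 573 and «Prop. 3.1′ of [2]»** (over the carriers' own `famE`, `famF`). [cite: Balaban1983RegularityDecay, Theorem p.573, Prop. 3.1′ of [2] p.574 (quoted); Prop. 2.3 of [1] p.574 (proved for the typed zero-field torus instance family, A = 0); Sect. 5 Theorem p.594 (proved)] -/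
theorem ofPrintedAllXP_withTorusFam_b4_iff (X : PrintedCarriersR) (Y : PrintedCarriers9X) (Z : PrintedCarriers11)
    (V : PrintedCarriers14R) (W : PrintedCarriers15) (d L : ℕ) (hd : 1 ≤ d) (hL : Odd L ∧ 1 < L) {a : ℝ}
    (ha : 0 < a) (m2plus : ℝ) :
    (Upstream.ofPrintedAllXP (X.withTorusFam d L a m2plus) Y Z V W).b4 ↔
      B4.ThmPrinted X.famE ∧ B4.Prop31Printed X.famF := by
  rw [ofPrintedAllXP_withTorusFam_b4_eq]
  exact leafB4_torusFam_iff X.famE X.famF d L hd hL ha m2plus X.d4 X.N4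

/-- The two quoted statements give that leaf. [cite: Balaban1983RegularityDecay, Theorem p.573, Prop. 3.1′ of [2] p.574 (quoted)] -/
theorem ofPrintedAllXP_withTorusFam_b4_of_quoted (X : PrintedCarriersR) (Y : PrintedCarriers9X)
    (Z : PrintedCarriers11) (V : PrintedCarriers14R) (W : PrintedCarriers15) (d L : ℕ) (hd : 1 ≤ d)
    (hL : Odd L ∧ 1 < L) {a : ℝ} (ha : 0 < a) (m2plus : ℝ) (h₁ : B4.ThmPrinted X.famE)
    (h₃ : B4.Prop31Printed X.famF) :
    (Upstream.ofPrintedAllXP (X.withTorusFam d L a m2plus) Y Z V W).b4 :=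
  (ofPrintedAllXP_withTorusFam_b4_iff X Y Z V W d L hd hL ha m2plus).2 ⟨h₁, h₃⟩

/-- The same at the K-binding of v3 (its `b4` field is the P-binding's, `ofPrintedAllXPK_leaves`), every κ. [cite: Balaban1983RegularityDecay, Theorem p.573, Prop. 3.1′ of [2] p.574 (quoted); Prop. 2.3 of [1] p.574 (proved for the typed zero-field torus instance family, A = 0); Sect. 5 Theorem p.594 (proved)] -/
theorem ofPrintedAllXPK_withTorusFam_b4_iff (X : PrintedCarriersR) (Y : PrintedCarriers9X) (Z : PrintedCarriers11)
    (V : PrintedCarriers14R) (W : PrintedCarriers15) (κ : ℝ) (d L : ℕ) (hd : 1 ≤ d) (hL : Odd L ∧ 1 < L)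
    {a : ℝ} (ha : 0 < a) (m2plus : ℝ) :
    (Upstream.ofPrintedAllXPK (X.withTorusFam d L a m2plus) Y Z V W κ).b4 ↔
      B4.ThmPrinted X.famE ∧ B4.Prop31Printed X.famF := by
  rw [(ofPrintedAllXPK_leaves (X.withTorusFam d L a m2plus) Y Z V W κ).2.1]
  exact ofPrintedAllXP_withTorusFam_b4_iff X Y Z V W d L hd hL ha m2plus

/-- **Leaf `b4` of the current P-binding, for carriers with the zero-field form family of v9 and the zero-field torus
family of v11, is EQUIVALENT to Theorem p. 573 ALONE** — three of the four printed statements of node B4 are then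
theorems of the package for these carriers. [cite: Balaban1983RegularityDecay, Theorem p.573 (quoted); Props. p.574 (proved for the typed zero-field carriers, A = 0); Sect. 5 Theorem p.594 (proved)] -/
theorem ofPrintedAllXP_withTorusForms_b4_iff (X : PrintedCarriersR) (Y : PrintedCarriers9X) (Z : PrintedCarriers11)
    (V : PrintedCarriers14R) (W : PrintedCarriers15) (d' : ℕ) {amin' m2max' : ℝ} (hamin' : 0 < amin')
    (hmax' : 0 ≤ m2max') (d L : ℕ) (hd : 1 ≤ d) (hL : Odd L ∧ 1 < L) {a : ℝ} (ha : 0 < a) (m2plus : ℝ) :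
    (Upstream.ofPrintedAllXP ((X.withZeroFieldForms d' amin' m2max').withTorusFam d L a m2plus) Y Z V W).b4 ↔
      B4.ThmPrinted X.famE :=
  (ofPrintedAllXP_withTorusFam_b4_iff (X.withZeroFieldForms d' amin' m2max') Y Z V W d L hd hL ha m2plus).trans
    ⟨fun h => h.1, fun h => ⟨h, prop31Printed_zeroFieldForms d' hamin' hmax'⟩⟩

/-- NET LEDGER for node `b4` over carriers with the zero-field form family and the zero-field torus family: of the
four printed statements bundled in the leaf, THREE are theorems of the package for these carriers (Prop. 2.3, «Prop.
3.1′ of [2]», Sect. 5 Theorem) and ONE stays quoted (Theorem p. 573 = Prop. 2.1 of [1], the A-dependent decay ∕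
regularity of G_k(Ω, A)). [cite: Balaban1983RegularityDecay, Theorem p.573, Props. p.574, Sect. 5 Theorem p.594] -/
theorem b4_torusForms_proved_conjuncts (X : PrintedCarriersR) (d' : ℕ) {amin' m2max' : ℝ} (hamin' : 0 < amin')
    (hmax' : 0 ≤ m2max') (d L : ℕ) (hd : 1 ≤ d) (hL : Odd L ∧ 1 < L) {a : ℝ} (ha : 0 < a) (m2plus : ℝ) :
    let X' := (X.withZeroFieldForms d' amin' m2max').withTorusFam d L a m2plus
    B4.Prop23Printed X'.famU ∧ B4.Prop31Printed X'.famF ∧ B4.Sect5ThmUniform X'.d4 X'.N4 :=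
  ⟨leafB4_conj2_torusFam d L hd hL ha m2plus, prop31Printed_zeroFieldForms d' hamin' hmax',
    B4Sect5Proof.sect5ThmUniform_holds X.d4 X.N4⟩

/-- Conjunct 2 of leaf `b4` is now a theorem of the package for TWO concrete zero-field `famU` families: the nested
Neumann boxes of v10 (regions Ω ⊊ ℤ^d, (1.19)–(1.20) with content) and the whole torus of v11 (Ω = Ω₀ = T^{(j)}) —
the two halves of the printed «Ω ⊂ Ω₀» at A = 0. [cite: Balaban1983RegularityDecay, Prop. 2.3 of [1] (1.15)–(1.20) p.574 (kernel versions for the two typed zero-field families, A = 0)] -/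
theorem leafB4_conj2_zeroField_families (d ℓ : ℕ) (hℓ : 1 ≤ ℓ) {aminus aplus m2plus a2minus a2plus : ℝ}
    (ha : 0 < aminus) (ha2 : 0 < a2minus) (d₂ L : ℕ) (hd₂ : 1 ≤ d₂) (hL : Odd L ∧ 1 < L) {a : ℝ} (ha' : 0 < a)
    (m2plus' : ℝ) :
    B4.Prop23Printed (B4Prop23ZeroBox.zeroFieldBoxes d ℓ aminus aplus m2plus a2minus a2plus) ∧
      B4.Prop23Printed (B4Ineq118Torus.torusFam d₂ L a m2plus') :=
  ⟨prop23Printed_zeroFieldBoxes d ℓ hℓ ha ha2, leafB4_conj2_torusFam d₂ L hd₂ hL ha' m2plus'⟩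

end LeafB4Prop23Torus

/-! ## Leaf `b6`, the PRINTED Lemma 2.4 on the PERIODIC carriers — the series' ambient torus `T` (v12)

[Balaban1984PropagatorsII] Lemma 2.4 (2.128) p. 245 is printed for a finite union of blocks Λ ⊂ Z^d with *"We put
B = 0 outside Λ"* and is USED on p. 249 *"on the whole lattice T^{(k)}, or on a subset Λ ⊂ T^{(k)}"* (before (2.153))
— a TORUS, where no configuration vanishes "outside".  The v3 ∕ v5 ∕ v7 sections discharge the conjunct
`B6.Lemma24Printed D.d D.L D.tree` of `B6BlockRest` for the lattice trees of `…B6Lemma24Carrier` (ambient Z^d; the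
eighth header bullet's READING NOTE (i) leaves the series' torus OUT).  The pv09 lineage has since PROVED (2.128) WITH
ITS PRINTED CONSTANT ON THE TORUS (`B6Lemma24Torus.lemma24_torus`, by the b06 route `face_split` ∕ `assembly_core_one`
∕ (2.123) transported to periodic configurations — not by the printed route, whose layer sentence stays refuted from
L = 10 on, G-B6-09) and typed it on B5's own configuration type `Tor M × Fin d → ℝ` as
`B6LowerBound2153Torus.lemma24Printed_tor` (whole torus) and `…lemma24Printed_torSub` (the printed case «or on a subset
Λ ⊂ T^{(k)}», HONEST SCOPE (ii) of that module), for every d ≥ 2, L ≥ 1 and periods that are non-zero multiples of L.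
This section feeds those two theorems, BY NAME, into the v3 ∕ v7 reductions (`torusTrees`, `torusSubTrees`;
`PrintedCarriersR.withTorusTrees`, `.withTorusSubTrees`): for these carriers the printed Lemma-2.4 conjunct is a
theorem of the package at every block size — in particular on the series' regime L > 11 — and leaf `b6` reduces to
`B6Lemma21Param ∧` its six quoted statements (module docstring, thirteenth bullet).  `…DagBinding` untouched; (2.153)
itself (`…lowerBound2153_tor` ∕ `_torSub`) is the USE of the lemma, not one of the eight typed statements, and is not
used here. -/

section LeafB6TorusTrees

/-- Block data whose Lemma-2.4 carriers are the PERIODIC tree-gauge carriers of the pv09 lineage on the WHOLE torus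
`Tor (M j) = Π_μ ℤ∕(M j μ)` (B5's configuration type `Tor (M j) × Fin d → ℝ`, gauge (2.121) on the blocks of T′ for the
periodic extension, ‖B‖² = Σ_x Σ_ν B(x,ν)², Σ_p |∂₁B|² = `B5Bounds167Lattice.d1Sq`, Q₁ verbatim (2.125) over the coarse
bonds of T: `B6LowerBound2153Torus.torCarrier`); every other field of `D` unchanged. [cite: Balaban1984PropagatorsII, (2.121)–(2.128) pp.244–245; p.249 («on the whole lattice T^{(k)}»)] -/
noncomputable def torusTrees (D : B6.BlockData) {J : Type} (L : ℕ) (M : J → Fin D.d → ℕ)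
    [∀ j μ, NeZero (M j μ)] : B6.BlockData :=
  { D with L := (L : ℝ), J := J, tree := fun j => B6LowerBound2153Torus.torCarrier L (M j) }

/-- Block data whose Lemma-2.4 carriers are the periodic carriers of the printed case *"or on a subset Λ ⊂ T^{(k)}"*:
Λ = B(Λ′₀ j), «B = 0 outside Λ» in Lemma 2.4's bond convention, the gauge (2.121) on the blocks of Λ′₀ j, the Q₁-sum
over the coarse bonds meeting Λ′₀ j (`B6LowerBound2153Torus.torCarrierSub`, HONEST SCOPE (ii) there); every other
field of `D` unchanged. [cite: Balaban1984PropagatorsII, (2.121)–(2.128) pp.244–245; p.249 («or on a subset Λ ⊂ T^{(k)}»)] -/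
noncomputable def torusSubTrees (D : B6.BlockData) {J : Type} (L : ℕ) (M : J → Fin D.d → ℕ)
    [∀ j μ, NeZero (M j μ)] (Λ : J → Finset (Fin D.d → ℤ)) : B6.BlockData :=
  { D with L := (L : ℝ), J := J, tree := fun j => B6LowerBound2153Torus.torCarrierSub L (M j) (Λ j) }

/-- **DISCHARGE at the printed constant on the WHOLE TORUS** (pv09-g5 `B6LowerBound2153Torus.lemma24Printed_tor`, BY
NAME): for the periodic carriers (d ≥ 2, L ≥ 1, periods `M j μ ≠ 0` with `L ∣ M j μ`) the PRINTED Lemma-2.4 conjunct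
(2.128), AS TYPED (`B6.Lemma24Printed`, constant 1∕(12d²)), is a theorem of the package — the case *"on the whole
lattice T^{(k)}"* of p. 249, which the lattice-tree discharges of v3 ∕ v5 ∕ v7 do not cover. [cite: Balaban1984PropagatorsII, Lemma 2.4 (2.128) p.245 (kernel version for the typed periodic carriers of …B6LowerBound2153Torus, printed constant, every L ≥ 1; proof the package's, not the printed one); p.249] -/
theorem lemma24Printed_torusTrees (D : B6.BlockData) {J : Type} (L : ℕ) (hd : 2 ≤ D.d) (hL : 1 ≤ L)
    (M : J → Fin D.d → ℕ) [∀ j μ, NeZero (M j μ)] (hLM : ∀ j μ, L ∣ M j μ) :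
    B6.Lemma24Printed (torusTrees D L M).d (torusTrees D L M).L (torusTrees D L M).tree :=
  B6LowerBound2153Torus.lemma24Printed_tor hd hL M hLM

/-- **DISCHARGE at the printed constant for Λ ⊂ T** (pv09-g5 `B6LowerBound2153Torus.lemma24Printed_torSub`, BY NAME):
every d ≥ 2, L ≥ 1, non-zero periods divisible by L, every family of coarse-site sets Λ′₀ j. [cite: Balaban1984PropagatorsII, Lemma 2.4 (2.128) p.245 (kernel version for the typed periodic carriers, subset case, printed constant); p.249 («or on a subset Λ ⊂ T^{(k)}»)] -/
theorem lemma24Printed_torusSubTrees (D : B6.BlockData) {J : Type} (L : ℕ) (hd : 2 ≤ D.d) (hL : 1 ≤ L)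
    (M : J → Fin D.d → ℕ) [∀ j μ, NeZero (M j μ)] (hLM : ∀ j μ, L ∣ M j μ) (Λ : J → Finset (Fin D.d → ℤ)) :
    B6.Lemma24Printed (torusSubTrees D L M Λ).d (torusSubTrees D L M Λ).L (torusSubTrees D L M Λ).tree :=
  B6LowerBound2153Torus.lemma24Printed_torSub hd hL M hLM Λ

/-- The same conjunct at κ = 1 in the κ-form `B6.Lemma24K` of v3 (`B6.lemma24K_one_iff`), whole torus. [cite: Balaban1984PropagatorsII, Lemma 2.4 (2.128) p.245 (typed periodic carriers, factor 1)] -/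
theorem lemma24K_torusTrees_one (D : B6.BlockData) {J : Type} (L : ℕ) (hd : 2 ≤ D.d) (hL : 1 ≤ L)
    (M : J → Fin D.d → ℕ) [∀ j μ, NeZero (M j μ)] (hLM : ∀ j μ, L ∣ M j μ) :
    B6.Lemma24K (torusTrees D L M).d (torusTrees D L M).L 1 (torusTrees D L M).tree :=
  (B6.lemma24K_one_iff _ _ _).2 (lemma24Printed_torusTrees D L hd hL M hLM)

/-- The same conjunct at κ = 1, subset case Λ ⊂ T. [cite: Balaban1984PropagatorsII, Lemma 2.4 (2.128) p.245 (typed periodic carriers, subset case, factor 1)] -/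
theorem lemma24K_torusSubTrees_one (D : B6.BlockData) {J : Type} (L : ℕ) (hd : 2 ≤ D.d) (hL : 1 ≤ L)
    (M : J → Fin D.d → ℕ) [∀ j μ, NeZero (M j μ)] (hLM : ∀ j μ, L ∣ M j μ) (Λ : J → Finset (Fin D.d → ℤ)) :
    B6.Lemma24K (torusSubTrees D L M Λ).d (torusSubTrees D L M Λ).L 1 (torusSubTrees D L M Λ).tree :=
  (B6.lemma24K_one_iff _ _ _).2 (lemma24Printed_torusSubTrees D L hd hL M hLM Λ)

/-- ‖B‖² = Σ_x Σ_ν B(x,ν)² ≥ 0 on the periodic carriers (bookkeeping for `B6.lemma24K_mono`). [folklore] -/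
theorem torusTrees_normSq_nonneg (D : B6.BlockData) {J : Type} (L : ℕ) (M : J → Fin D.d → ℕ)
    [∀ j μ, NeZero (M j μ)] (j : J) (B : ((torusTrees D L M).tree j).Cfg) :
    0 ≤ ((torusTrees D L M).tree j).normSq B := by
  dsimp only [torusTrees, B6LowerBound2153Torus.torCarrier]
  positivity

/-- Hence the Lemma-2.4_κ conjunct of the K-binding for EVERY κ ≤ 1 on the whole torus, with no layer hypothesis
(`B6.lemma24K_mono`). [cite: Balaban1984PropagatorsII, Lemma 2.4 (2.128) p.245 (typed periodic carriers, any factor κ ≤ 1)] -/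
theorem lemma24K_torusTrees_of_le_one (D : B6.BlockData) {J : Type} (L : ℕ) (hd : 2 ≤ D.d) (hL : 1 ≤ L)
    {κ : ℝ} (hκ : κ ≤ 1) (M : J → Fin D.d → ℕ) [∀ j μ, NeZero (M j μ)] (hLM : ∀ j μ, L ∣ M j μ) :
    B6.Lemma24K (torusTrees D L M).d (torusTrees D L M).L κ (torusTrees D L M).tree :=
  B6.lemma24K_mono _ _ 1 κ (Nat.cast_pos.mpr hL) hκ _ (torusTrees_normSq_nonneg D L M)
    (lemma24K_torusTrees_one D L hd hL M hLM)

/-- **The series' own regime is covered on the torus**: for block sizes L > 11 ([Balaban1987RG] p. 251 (0.1): «L … an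
odd, positive integer > 11», cell census S-B12.1) the printed Lemma-2.4 conjunct holds for the periodic carriers
(only `1 ≤ L` is used). [cite: Balaban1984PropagatorsII, Lemma 2.4 (2.128) p.245 (typed periodic carriers); Balaban1987RG, p.251 (0.1)] -/
theorem lemma24Printed_torusTrees_of_eleven_lt (D : B6.BlockData) {J : Type} (L : ℕ) (hd : 2 ≤ D.d)
    (hL11 : 11 < L) (M : J → Fin D.d → ℕ) [∀ j μ, NeZero (M j μ)] (hLM : ∀ j μ, L ∣ M j μ) :
    B6.Lemma24Printed (torusTrees D L M).d (torusTrees D L M).L (torusTrees D L M).tree :=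
  lemma24Printed_torusTrees D L hd (by omega) M hLM

/-- **Leaf `b6`'s rest block AS PRINTED, for the periodic carriers on the whole torus, is EQUIVALENT to its QUOTED
statements** Props. 2.2, 2.3, 2.5, 2.6, 2.7 ∧ Cor. 2.8 — the printed Lemma-2.4 conjunct is a theorem of the package at
every L ≥ 1. [cite: Balaban1984PropagatorsII, Props. 2.2–2.7, Cor. 2.8 pp.234–249 (quoted); Lemma 2.4 (2.128) p.245 (proved for the typed periodic carriers)] -/
theorem b6BlockRest_torusTrees_iff (D : B6.BlockData) {J : Type} (L : ℕ) (hd : 2 ≤ D.d) (hL : 1 ≤ L)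
    (M : J → Fin D.d → ℕ) [∀ j μ, NeZero (M j μ)] (hLM : ∀ j μ, L ∣ M j μ) :
    B6BlockRest (torusTrees D L M) ↔ B6RestQuoted D :=
  (b6BlockRestK_one_iff _).symm.trans
    (b6BlockRestK_iff_quoted_of_lemma24K (torusTrees D L M) 1 (lemma24K_torusTrees_one D L hd hL M hLM))

/-- The same for the periodic carriers of the subset case Λ ⊂ T. [cite: Balaban1984PropagatorsII, Props. 2.2–2.7, Cor. 2.8 pp.234–249 (quoted); Lemma 2.4 (2.128) p.245 (proved for the typed periodic carriers, subset case)] -/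
theorem b6BlockRest_torusSubTrees_iff (D : B6.BlockData) {J : Type} (L : ℕ) (hd : 2 ≤ D.d) (hL : 1 ≤ L)
    (M : J → Fin D.d → ℕ) [∀ j μ, NeZero (M j μ)] (hLM : ∀ j μ, L ∣ M j μ) (Λ : J → Finset (Fin D.d → ℤ)) :
    B6BlockRest (torusSubTrees D L M Λ) ↔ B6RestQuoted D :=
  (b6BlockRestK_one_iff _).symm.trans
    (b6BlockRestK_iff_quoted_of_lemma24K (torusSubTrees D L M Λ) 1 (lemma24K_torusSubTrees_one D L hd hL M hLM Λ))

/-- **The P-binding's `b6` leaf (`B6BlockParam`) for the periodic carriers on the whole torus is EQUIVALENT to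
`B6Lemma21Param D ∧` the six quoted statements** — no κ and no bound on L. [cite: Balaban1984PropagatorsII, Lemma 2.1 p.234 (parameter form), Props. 2.2–2.7, Cor. 2.8 (quoted); Lemma 2.4 (2.128) p.245 (proved for the typed periodic carriers)] -/
theorem b6BlockParam_torusTrees_iff (D : B6.BlockData) {J : Type} (L : ℕ) (hd : 2 ≤ D.d) (hL : 1 ≤ L)
    (M : J → Fin D.d → ℕ) [∀ j μ, NeZero (M j μ)] (hLM : ∀ j μ, L ∣ M j μ) :
    B6BlockParam (torusTrees D L M) ↔ B6Lemma21Param D ∧ B6RestQuoted D :=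
  (b6BlockParamK_one_iff _).symm.trans
    (b6BlockParamK_iff_of_lemma24K (torusTrees D L M) 1 (lemma24K_torusTrees_one D L hd hL M hLM))

/-- The same for the subset case Λ ⊂ T. [cite: Balaban1984PropagatorsII, Lemma 2.1 p.234 (parameter form), Props. 2.2–2.7, Cor. 2.8 (quoted); Lemma 2.4 (2.128) p.245 (proved for the typed periodic carriers, subset case)] -/
theorem b6BlockParam_torusSubTrees_iff (D : B6.BlockData) {J : Type} (L : ℕ) (hd : 2 ≤ D.d) (hL : 1 ≤ L)
    (M : J → Fin D.d → ℕ) [∀ j μ, NeZero (M j μ)] (hLM : ∀ j μ, L ∣ M j μ) (Λ : J → Finset (Fin D.d → ℤ)) :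
    B6BlockParam (torusSubTrees D L M Λ) ↔ B6Lemma21Param D ∧ B6RestQuoted D :=
  (b6BlockParamK_one_iff _).symm.trans
    (b6BlockParamK_iff_of_lemma24K (torusSubTrees D L M Λ) 1 (lemma24K_torusSubTrees_one D L hd hL M hLM Λ))

/-- The κ-form leaf of v3 for the periodic carriers on the whole torus, at EVERY κ ≤ 1 and every L ≥ 1, is EQUIVALENT
to `B6Lemma21Param D ∧` the six quoted statements. [cite: Balaban1984PropagatorsII, Lemma 2.1 p.234 (parameter form), Props. 2.2–2.7, Cor. 2.8 (quoted); Lemma 2.4 (2.128) p.245 (factor κ ≤ 1, proved for the typed periodic carriers)] -/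
theorem b6BlockParamK_torusTrees_iff_of_le_one (D : B6.BlockData) {J : Type} (L : ℕ) (hd : 2 ≤ D.d) (hL : 1 ≤ L)
    {κ : ℝ} (hκ : κ ≤ 1) (M : J → Fin D.d → ℕ) [∀ j μ, NeZero (M j μ)] (hLM : ∀ j μ, L ∣ M j μ) :
    B6BlockParamK (torusTrees D L M) κ ↔ B6Lemma21Param D ∧ B6RestQuoted D :=
  b6BlockParamK_iff_of_lemma24K (torusTrees D L M) κ (lemma24K_torusTrees_of_le_one D L hd hL hκ M hLM)

/-- Binding carriers whose B6 tree-gauge data are the periodic carriers on the whole torus (every other carrier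
unchanged). [folklore] -/
noncomputable def _root_.Literature.MathematicalPhysics.QuantumFieldTheory.Balaban1983to89.DagBinding.PrintedCarriersR.withTorusTrees
    (X : PrintedCarriersR) {J : Type} (L : ℕ) (M : J → Fin X.D6.d → ℕ) [∀ j μ, NeZero (M j μ)] :
    PrintedCarriersR :=
  { X with D6 := torusTrees X.D6 L M }

/-- Binding carriers whose B6 tree-gauge data are the periodic carriers of the subset case Λ ⊂ T. [folklore] -/
noncomputable def _root_.Literature.MathematicalPhysics.QuantumFieldTheory.Balaban1983to89.DagBinding.PrintedCarriersR.withTorusSubTrees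
    (X : PrintedCarriersR) {J : Type} (L : ℕ) (M : J → Fin X.D6.d → ℕ) [∀ j μ, NeZero (M j μ)]
    (Λ : J → Finset (Fin X.D6.d → ℤ)) : PrintedCarriersR :=
  { X with D6 := torusSubTrees X.D6 L M Λ }

/-- **Leaf `b6` of the P-binding `Upstream.ofPrintedAllXP`, for carriers with the periodic tree-gauge data on the WHOLE
TORUS, is EQUIVALENT to `B6Lemma21Param ∧` Props. 2.2, 2.3, 2.5, 2.6, 2.7 ∧ Cor. 2.8** — the printed Lemma 2.4 needs no
quotation at any block size L ≥ 1 on the series' own ambient torus. [cite: Balaban1984PropagatorsII, Lemma 2.1 p.234 (parameter form), Props. 2.2–2.7, Cor. 2.8 (quoted); Lemma 2.4 (2.128) p.245 (proved for the typed periodic carriers); p.249] -/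
theorem ofPrintedAllXP_withTorusTrees_b6_iff (X : PrintedCarriersR) (Y : PrintedCarriers9X)
    (Z : PrintedCarriers11) (V : PrintedCarriers14R) (W : PrintedCarriers15) {J : Type} (L : ℕ)
    (hd : 2 ≤ X.D6.d) (hL : 1 ≤ L) (M : J → Fin X.D6.d → ℕ) [∀ j μ, NeZero (M j μ)] (hLM : ∀ j μ, L ∣ M j μ) :
    (Upstream.ofPrintedAllXP (X.withTorusTrees L M) Y Z V W).b6 ↔ B6Lemma21Param X.D6 ∧ B6RestQuoted X.D6 :=
  b6BlockParam_torusTrees_iff X.D6 L hd hL M hLM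

/-- **Leaf `b6` of the P-binding for carriers with the periodic tree-gauge data of the subset case Λ ⊂ T is EQUIVALENT to
`B6Lemma21Param ∧` the six quoted statements.** [cite: Balaban1984PropagatorsII, Lemma 2.1 p.234 (parameter form), Props. 2.2–2.7, Cor. 2.8 (quoted); Lemma 2.4 (2.128) p.245 (proved for the typed periodic carriers, subset case); p.249] -/
theorem ofPrintedAllXP_withTorusSubTrees_b6_iff (X : PrintedCarriersR) (Y : PrintedCarriers9X)
    (Z : PrintedCarriers11) (V : PrintedCarriers14R) (W : PrintedCarriers15) {J : Type} (L : ℕ)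
    (hd : 2 ≤ X.D6.d) (hL : 1 ≤ L) (M : J → Fin X.D6.d → ℕ) [∀ j μ, NeZero (M j μ)] (hLM : ∀ j μ, L ∣ M j μ)
    (Λ : J → Finset (Fin X.D6.d → ℤ)) :
    (Upstream.ofPrintedAllXP (X.withTorusSubTrees L M Λ) Y Z V W).b6 ↔
      B6Lemma21Param X.D6 ∧ B6RestQuoted X.D6 :=
  b6BlockParam_torusSubTrees_iff X.D6 L hd hL M hLM Λ

/-- Leaf `b6` of the K-binding `Upstream.ofPrintedAllXPK` of v3 at EVERY κ ≤ 1, for carriers with the periodic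
tree-gauge data on the whole torus, is EQUIVALENT to `B6Lemma21Param ∧` the six quoted statements. [cite: Balaban1984PropagatorsII, Lemma 2.1 p.234 (parameter form), Props. 2.2–2.7, Cor. 2.8 (quoted); Lemma 2.4 (2.128) p.245 (factor κ ≤ 1, proved for the typed periodic carriers)] -/
theorem ofPrintedAllXPK_withTorusTrees_b6_iff_of_le_one (X : PrintedCarriersR) (Y : PrintedCarriers9X)
    (Z : PrintedCarriers11) (V : PrintedCarriers14R) (W : PrintedCarriers15) {J : Type} (L : ℕ)
    (hd : 2 ≤ X.D6.d) (hL : 1 ≤ L) {κ : ℝ} (hκ : κ ≤ 1) (M : J → Fin X.D6.d → ℕ) [∀ j μ, NeZero (M j μ)]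
    (hLM : ∀ j μ, L ∣ M j μ) :
    (Upstream.ofPrintedAllXPK (X.withTorusTrees L M) Y Z V W κ).b6 ↔
      B6Lemma21Param X.D6 ∧ B6RestQuoted X.D6 :=
  b6BlockParamK_torusTrees_iff_of_le_one X.D6 L hd hL hκ M hLM

/-- **The Lemma-2.4 records of leaf `b6` side by side** (v7 lattice trees in ambient Z^d; v12 periodic carriers, both
printed cases of p. 249): on each of the three concrete carrier families the cell has typed, the P-binding's `b6` leaf is
EQUIVALENT to `B6Lemma21Param ∧` the six quoted statements, at every block size. [cite: Balaban1984PropagatorsII, Lemma 2.4 (2.128) p.245 (proved for the lattice trees of …B6Lemma24Carrier and the periodic carriers of …B6LowerBound2153Torus); Lemma 2.1, Props. 2.2–2.7, Cor. 2.8 (quoted)] -/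
theorem b6_lemma24_families (X : PrintedCarriersR) (Y : PrintedCarriers9X) (Z : PrintedCarriers11)
    (V : PrintedCarriers14R) (W : PrintedCarriers15) {J : Type} (L : ℕ) (hd : 2 ≤ X.D6.d) (hL : 1 ≤ L)
    (Λ' : J → Finset (Fin X.D6.d → ℤ)) (hΛ : ∀ j, ∀ y ∈ Λ' j, ∀ i, (L : ℤ) ∣ y i)
    (M : J → Fin X.D6.d → ℕ) [∀ j μ, NeZero (M j μ)] (hLM : ∀ j μ, L ∣ M j μ)
    (Λ : J → Finset (Fin X.D6.d → ℤ)) :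
    ((Upstream.ofPrintedAllXP (X.withLatticeTrees L Λ') Y Z V W).b6 ↔ B6Lemma21Param X.D6 ∧ B6RestQuoted X.D6) ∧
    ((Upstream.ofPrintedAllXP (X.withTorusTrees L M) Y Z V W).b6 ↔ B6Lemma21Param X.D6 ∧ B6RestQuoted X.D6) ∧
    ((Upstream.ofPrintedAllXP (X.withTorusSubTrees L M Λ) Y Z V W).b6 ↔ B6Lemma21Param X.D6 ∧ B6RestQuoted X.D6) :=
  ⟨ofPrintedAllXP_withLatticeTrees_b6_iff X Y Z V W L hd hL Λ' hΛ,
    ofPrintedAllXP_withTorusTrees_b6_iff X Y Z V W L hd hL M hLM,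
    ofPrintedAllXP_withTorusSubTrees_b6_iff X Y Z V W L hd hL M hLM Λ⟩

end LeafB6TorusTrees

end Literature.MathematicalPhysics.QuantumFieldTheory.Balaban1983to89.DagDischarged
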